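import Literature.Barriers.CriticalPhenomena.GridSAWLOTTilesSite1
import Literature.Barriers.CriticalPhenomena.GridSAWLOTTilesSite2
import Literature.Barriers.CriticalPhenomena.GridSAWLOTTilesSite3
import Literature.Barriers.CriticalPhenomena.GridSAWLOTTilesSite4
import Literature.Barriers.CriticalPhenomena.GridSAWLOTTilesOther
import Literature.Combinatorics.SimpleGraph.HamiltonianLOTCount
import Literature.Barriers.CriticalPhenomena.GridSAWHamPathCountTransfer
import HarnessLib

/-!
# The grid drawing of the `#3SAT → #HamPath` gadget graph, I: the tiling

The graph `graph₂ φ` of `HamiltonianLOTCount.lean` (vertices `0, …, totalV φ - 1`) is drawn on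
the grid by TILES (`GridSAWTiledDrawing.lean`, tiles in `GridSAWLOTTiles*.lean`): a row of
dummy-pair tiles (column `c` at `x ∈ [56c, 56c+56]`, `y ∈ [0, 44]`), below it the `N` rows of site
tiles (row `r` at `y ∈ [-100(r+1), -100r]`, the site `(r, s)` in the column strip `J r s`, even rows
mirrored — the chain runs boustrophedon), below them the clause row (`K_0`, the clause tiles three
strips wide, the end cell). This file defines the placements (tile by flags, origin, numbering of
the local vertices by anchors `+` offsets) and proves the geometric hypotheses of the assembly:
no placement twice, all tiles valid, boxes meeting along boundaries with one side restricted.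

## References

* M. Liśkiewicz, M. Ogihara, S. Toda, TCS 304 (2003) 129–156, §4 (proof of Theorem 7, `E₀`).
-/

namespace Literature.Barriers.CriticalPhenomena.GridSAW

/-! ## The tile selectors and the facts about the tiles (formerly `GridSAWLOTTilesIndex.lean`)

# Tiles of the grid drawing of the `#3SAT → #HamPath` gadget graph: the index

The tiles of `GridSAWLOTTilesSite1–4.lean`, `GridSAWLOTTilesOther.lean` selected by their flags
(`siteTile`, `dummyTile`, `k0Tile`, `clauseTile`, `zTile`, with the numbering keys `siteNum`, …),
their validity (`siteTile_valid`, … — dispatch to the `decide`d theorems), and the finite facts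
about them that the assembly uses (dimensions, key lists, side inventories), all by `decide`.

## References

* M. Liśkiewicz, M. Ogihara, S. Toda, TCS 304 (2003) 129–156, §4 (proof of Theorem 7, `E₀`).
-/

namespace LOTTiles

/-- The admissible site flag combinations `(first, last, tap, set0, set1)`. [folklore] -/
def siteOK (f _l t s0 s1 : Bool) : Bool :=
  !(s0 && s1) && (!s0 || t) && (!s1 || !f)

/-- **The site tile** with flags `(first, last, tap, set0, set1, mirrored)` (inadmissible flag
combinations are sent to an arbitrary tile). [folklore] -/
def siteTile (f l t s0 s1 m : Bool) : Tile :=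
  match f, l, t, s0, s1, m with
  | false, false, false, false, false, false => site_00000s
  | false, false, false, false, false, true => site_00000m
  | false, false, false, false, true, false => site_00001s
  | false, false, false, false, true, true => site_00001m
  | false, false, true, false, false, false => site_00100s
  | false, false, true, false, false, true => site_00100m
  | false, false, true, false, true, false => site_00101s
  | false, false, true, false, true, true => site_00101m
  | false, false, true, true, false, false => site_00110s
  | false, false, true, true, false, true => site_00110m
  | false, true, false, false, false, false => site_01000s
  | false, true, false, false, false, true => site_01000m
  | false, true, false, false, true, false => site_01001s
  | false, true, false, false, true, true => site_01001m
  | false, true, true, false, false, false => site_01100s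
  | false, true, true, false, false, true => site_01100m
  | false, true, true, false, true, false => site_01101s
  | false, true, true, false, true, true => site_01101m
  | false, true, true, true, false, false => site_01110s
  | false, true, true, true, false, true => site_01110m
  | true, false, false, false, false, false => site_10000s
  | true, false, false, false, false, true => site_10000m
  | true, false, true, false, false, false => site_10100s
  | true, false, true, false, false, true => site_10100m
  | true, false, true, true, false, false => site_10110s
  | true, false, true, true, false, true => site_10110m
  | true, true, false, false, false, false => site_11000s
  | true, true, false, false, false, true => site_11000m
  | true, true, true, false, false, false => site_11100s
  | true, true, true, false, false, true => site_11100m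
  | true, true, true, true, false, false => site_11110s
  | true, true, true, true, false, true => site_11110m
  | _, _, _, _, _, true => site_00000m
  | _, _, _, _, _, false => site_00000s

/-- The numbering keys of the site tile (the same for both orientations). [folklore] -/
def siteNum (f l t s0 s1 : Bool) : List (ℕ × ℕ) :=
  match f, l, t, s0, s1 with
  | false, false, false, false, false => site_00000s_num
  | false, false, false, false, true => site_00001s_num
  | false, false, true, false, false => site_00100s_num
  | false, false, true, false, true => site_00101s_num
  | false, false, true, true, false => site_00110s_num
  | false, true, false, false, false => site_01000s_num
  | false, true, false, false, true => site_01001s_num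
  | false, true, true, false, false => site_01100s_num
  | false, true, true, false, true => site_01101s_num
  | false, true, true, true, false => site_01110s_num
  | true, false, false, false, false => site_10000s_num
  | true, false, true, false, false => site_10100s_num
  | true, false, true, true, false => site_10110s_num
  | true, true, false, false, false => site_11000s_num
  | true, true, true, false, false => site_11100s_num
  | true, true, true, true, false => site_11110s_num
  | _, _, _, _, _ => site_00000s_num

/-- **Every site tile is valid.** [folklore] -/
theorem siteTile_valid (f l t s0 s1 m : Bool) : (siteTile f l t s0 s1 m).Valid := by
  cases f <;> cases l <;> cases t <;> cases s0 <;> cases s1 <;> cases m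
  · exact site_00000s_valid
  · exact site_00000m_valid
  · exact site_00001s_valid
  · exact site_00001m_valid
  · exact site_00000s_valid
  · exact site_00000m_valid
  · exact site_00000s_valid
  · exact site_00000m_valid
  · exact site_00100s_valid
  · exact site_00100m_valid
  · exact site_00101s_valid
  · exact site_00101m_valid
  · exact site_00110s_valid
  · exact site_00110m_valid
  · exact site_00000s_valid
  · exact site_00000m_valid
  · exact site_01000s_valid
  · exact site_01000m_valid
  · exact site_01001s_valid
  · exact site_01001m_valid
  · exact site_00000s_valid
  · exact site_00000m_valid
  · exact site_00000s_valid
  · exact site_00000m_valid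
  · exact site_01100s_valid
  · exact site_01100m_valid
  · exact site_01101s_valid
  · exact site_01101m_valid
  · exact site_01110s_valid
  · exact site_01110m_valid
  · exact site_00000s_valid
  · exact site_00000m_valid
  · exact site_10000s_valid
  · exact site_10000m_valid
  · exact site_00000s_valid
  · exact site_00000m_valid
  · exact site_00000s_valid
  · exact site_00000m_valid
  · exact site_00000s_valid
  · exact site_00000m_valid
  · exact site_10100s_valid
  · exact site_10100m_valid
  · exact site_00000s_valid
  · exact site_00000m_valid
  · exact site_10110s_valid
  · exact site_10110m_valid
  · exact site_00000s_valid
  · exact site_00000m_valid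
  · exact site_11000s_valid
  · exact site_11000m_valid
  · exact site_00000s_valid
  · exact site_00000m_valid
  · exact site_00000s_valid
  · exact site_00000m_valid
  · exact site_00000s_valid
  · exact site_00000m_valid
  · exact site_11100s_valid
  · exact site_11100m_valid
  · exact site_00000s_valid
  · exact site_00000m_valid
  · exact site_11110s_valid
  · exact site_11110m_valid
  · exact site_00000s_valid
  · exact site_00000m_valid

/-- **The dummy-pair tile** with flags `(first, last, vacuous set ladder)`. [folklore] -/
def dummyTile (f l v : Bool) : Tile :=
  match f, l, v with
  | false, false, false => dummy_000
  | false, false, true => dummy_001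
  | false, true, false => dummy_010
  | false, true, true => dummy_011
  | true, false, false => dummy_100
  | true, false, true => dummy_101
  | true, true, false => dummy_110
  | true, true, true => dummy_111

/-- The numbering keys of the dummy-pair tile. [folklore] -/
def dummyNum (f l v : Bool) : List (ℕ × ℕ) :=
  match f, l, v with
  | false, false, false => dummy_000_num
  | false, false, true => dummy_001_num
  | false, true, false => dummy_010_num
  | false, true, true => dummy_011_num
  | true, false, false => dummy_100_num
  | true, false, true => dummy_101_num
  | true, true, false => dummy_110_num
  | true, true, true => dummy_111_num

/-- **Every dummy-pair tile is valid.** [folklore] -/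
theorem dummyTile_valid (f l v : Bool) : (dummyTile f l v).Valid := by
  cases f <;> cases l <;> cases v
  · exact dummy_000_valid
  · exact dummy_001_valid
  · exact dummy_010_valid
  · exact dummy_011_valid
  · exact dummy_100_valid
  · exact dummy_101_valid
  · exact dummy_110_valid
  · exact dummy_111_valid

/-- **The tile of `K_0`** (flag: the unit-clause literal is positive). [folklore] -/
def k0Tile (p : Bool) : Tile := match p with | true => ktile0_1 | false => ktile0_0

/-- The numbering keys of the tile of `K_0`. [folklore] -/
def k0Num (p : Bool) : List (ℕ × ℕ) := match p with | true => ktile0_1_num | false => ktile0_0_num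

/-- **Every tile of `K_0` is valid.** [folklore] -/
theorem k0Tile_valid (p : Bool) : (k0Tile p).Valid := by
  cases p
  · exact ktile0_0_valid
  · exact ktile0_1_valid

/-- **The clause tile** with the polarities of its three literals. [folklore] -/
def clauseTile (p0 p1 p2 : Bool) : Tile :=
  match p0, p1, p2 with
  | false, false, false => clause_000
  | false, false, true => clause_001
  | false, true, false => clause_010
  | false, true, true => clause_011
  | true, false, false => clause_100
  | true, false, true => clause_101
  | true, true, false => clause_110
  | true, true, true => clause_111

/-- The numbering keys of the clause tile. [folklore] -/
def clauseNum (p0 p1 p2 : Bool) : List (ℕ × ℕ) :=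
  match p0, p1, p2 with
  | false, false, false => clause_000_num
  | false, false, true => clause_001_num
  | false, true, false => clause_010_num
  | false, true, true => clause_011_num
  | true, false, false => clause_100_num
  | true, false, true => clause_101_num
  | true, true, false => clause_110_num
  | true, true, true => clause_111_num

/-- **Every clause tile is valid.** [folklore] -/
theorem clauseTile_valid (p0 p1 p2 : Bool) : (clauseTile p0 p1 p2).Valid := by
  cases p0 <;> cases p1 <;> cases p2
  · exact clause_000_valid
  · exact clause_001_valid
  · exact clause_010_valid
  · exact clause_011_valid
  · exact clause_100_valid
  · exact clause_101_valid
  · exact clause_110_valid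
  · exact clause_111_valid

/-- Dimensions and orientation of the site tiles. [folklore] -/
theorem siteTile_dims (f l t s0 s1 m : Bool) :
    (siteTile f l t s0 s1 m).w = 56 ∧ (siteTile f l t s0 s1 m).h = 100 ∧ (siteTile f l t s0 s1 m).mirrored = m := by
  cases f <;> cases l <;> cases t <;> cases s0 <;> cases s1 <;> cases m <;> exact ⟨rfl, rfl, rfl⟩

/-- Dimensions and orientation of the dummy-pair tiles. [folklore] -/
theorem dummyTile_dims (f l v : Bool) :
    (dummyTile f l v).w = 56 ∧ (dummyTile f l v).h = 44 ∧ (dummyTile f l v).mirrored = false := by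
  cases f <;> cases l <;> cases v <;> exact ⟨rfl, rfl, rfl⟩

/-- Dimensions and orientation of the tiles of `K_0`. [folklore] -/
theorem k0Tile_dims (p : Bool) : (k0Tile p).w = 56 ∧ (k0Tile p).h = 60 ∧ (k0Tile p).mirrored = false := by
  cases p <;> exact ⟨rfl, rfl, rfl⟩

/-- Dimensions and orientation of the clause tiles. [folklore] -/
theorem clauseTile_dims (p0 p1 p2 : Bool) :
    (clauseTile p0 p1 p2).w = 168 ∧ (clauseTile p0 p1 p2).h = 60 ∧ (clauseTile p0 p1 p2).mirrored = false := by
  cases p0 <;> cases p1 <;> cases p2 <;> exact ⟨rfl, rfl, rfl⟩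

/-- **The end tile** and its keys. [folklore] -/
def zTile : Tile := ztile

/-- The numbering keys of the end tile. [folklore] -/
def zNum : List (ℕ × ℕ) := ztile_num

/-- The end tile is valid. [folklore] -/
theorem zTile_valid : zTile.Valid := ztile_valid

/-- Dimensions and orientation of the end tile. [folklore] -/
theorem zTile_dims : zTile.w = 56 ∧ zTile.h = 60 ∧ zTile.mirrored = false := ⟨rfl, rfl, rfl⟩


/-! ### Finite facts about the tiles (all by `decide`) -/

/-- **The boundary inventory** of a tile with keys: the keys and positions of its local vertices on
the boundary of its box. [folklore] -/
def bdryInv (T : Tile) (num : List (ℕ × ℕ)) : List ((ℕ × ℕ) × GridPoint) :=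
  ((List.range T.nv).filter fun i => decide (T.OnBdry (T.pos.getD i (0, 0)))).map fun i =>
    (num.getD i (0, 0), T.pos.getD i (0, 0))

/-- Reflection of local coordinates in a mirrored site tile. [folklore] -/
def mx (m : Bool) (p : GridPoint) : GridPoint := if m then (56 - p.1, p.2) else p

/-- The heights of the four diamonds of a site. [folklore] -/
def Yd (k : ℕ) : ℤ := 80 - 16 * k

/-- **The expected boundary inventory of a site tile**, by its flags: on the left the chain entry
`c(Bl_s)` and the `q`-vertices of the previous diamond ladder (not for the first site, whose entry is
on top) and the midpoints of the second set rail; on the right the chain exit `c(Bl_{s+1})`, the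
`q`-vertices of the diamond ladder and the set midpoints (not for the last site, whose exit is at
the bottom); on top the midpoints of the first hop ladder; at the bottom those of the exit ladder.
[folklore] -/
def siteBdry (f l _t s0 s1 m : Bool) : List ((ℕ × ℕ) × GridPoint) :=
  ((if f then [((0, 0), ((6 : ℤ), (100 : ℤ)))]
    else ((0, 0), ((0 : ℤ), (20 : ℤ))) :: (List.range 4).map fun k : ℕ => ((3, 11 + 4 * k), ((0 : ℤ), Yd k))) ++
   (if s1 then (List.range 4).map fun i : ℕ => ((6, 8 + i), ((0 : ℤ), (12 : ℤ) + 2 * (i : ℤ))) else []) ++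
   (if l then [((1, 0), ((50 : ℤ), (0 : ℤ)))]
    else ((0, 10), ((56 : ℤ), (20 : ℤ))) :: (List.range 4).map fun k : ℕ => ((2, 11 + 4 * k), ((56 : ℤ), Yd k))) ++
   (if s0 && !l then (List.range 4).map fun i : ℕ => ((6, 8 + i), ((56 : ℤ), (12 : ℤ) + 2 * (i : ℤ))) else []) ++
   (List.range 4).map (fun i : ℕ => ((4, 8 + i), ((20 : ℤ) + 2 * (i : ℤ), (100 : ℤ)))) ++
   (List.range 4).map (fun i : ℕ => ((5, 8 + i), ((36 : ℤ) - 2 * (i : ℤ), (0 : ℤ))))).map fun e : (ℕ × ℕ) × GridPoint => (e.1, mx m e.2)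

/-- **The keys of a site tile at home in it**, by its flags (every global vertex has one home
occurrence). [folklore] -/
def siteHome (f l s0 s1 : Bool) : List (ℕ × ℕ) :=
  (List.range 10).map (fun d => (0, d)) ++ (if l then (List.range 5).map (fun d => (0, 10 + d)) else []) ++
  ((List.range 24).filter fun d => d < 4 ∨ 8 ≤ d).map (fun d => (2, d)) ++ (if l then (List.range 4).map (fun d => (2, 4 + d)) else []) ++
  (if f then [] else (List.range 4).map fun d => (3, 4 + d)) ++
  ((List.range 60).filter fun d => 4 ≤ d).map (fun d => (4, d)) ++ (List.range 4).map (fun d => (5, d)) ++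
  (if s0 then ((List.range 12).filter fun d => d < 4 ∨ 8 ≤ d).map (fun d => (6, d)) else []) ++
  (if s1 || (s0 && l) then (List.range 4).map (fun d => (6, 4 + d)) else [])

/-- **The keys of a site tile at home in a neighbour**: the chain exit (or, for the last site, the
entry cell of the next row), the `q`-vertices of the previous diamond ladder, the midpoints of the
exit ladder, the midpoints of the set ladder at its second rail. [folklore] -/
def siteAway (f l s1 : Bool) : List (ℕ × ℕ) :=
  (if l then [(1, 0)] else [(0, 10)]) ++ (if f then [] else (List.range 4).map fun k => (3, 11 + 4 * k)) ++
  (List.range 4).map (fun i => (5, 8 + i)) ++ (if s1 then (List.range 4).map (fun i => (6, 8 + i)) else [])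

/-- The expected boundary inventory of a dummy-pair tile. [folklore] -/
def dummyBdry (f l : Bool) : List ((ℕ × ℕ) × GridPoint) :=
  (if f then [] else [((0, 0), ((0 : ℤ), (20 : ℤ)))]) ++ (if l then [((1, 0), ((50 : ℤ), (0 : ℤ)))] else [((0, 10), ((56 : ℤ), (20 : ℤ)))]) ++
    (List.range 4).map fun i : ℕ => ((3, 8 + i), ((36 : ℤ) - 2 * (i : ℤ), (0 : ℤ)))

/-- The keys at home in a dummy-pair tile. [folklore] -/
def dummyHome (v : Bool) : List (ℕ × ℕ) :=
  (List.range 10).map (fun d => (0, d)) ++ (List.range 6).map (fun d => (2, d)) ++ (List.range 4).map (fun d => (3, d)) ++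
    (if v then (List.range 12).map (fun d => (4, d)) else [])

/-- The keys of a dummy-pair tile at home in a neighbour. [folklore] -/
def dummyAway (l : Bool) : List (ℕ × ℕ) := (if l then [(1, 0)] else [(0, 10)]) ++ (List.range 4).map fun i => (3, 8 + i)

/-- The expected boundary inventory of the tile of `K_0`. [folklore] -/
def k0Bdry : List ((ℕ × ℕ) × GridPoint) :=
  [((0, 0), ((6 : ℤ), (60 : ℤ))), ((0, 5), ((56 : ℤ), (30 : ℤ)))] ++ (List.range 4).map fun i : ℕ => ((1, 8 + i), ((20 : ℤ) + 2 * (i : ℤ), (60 : ℤ)))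

/-- The keys at home in the tile of `K_0` (the other one is `(0, 5)`, the next cell's entry). [folklore] -/
def k0Home : List (ℕ × ℕ) := (List.range 5).map (fun d => (0, d)) ++ (List.range 8).map (fun d => (1, 4 + d)) ++ (List.range 3).map (fun d => (2, d))

/-- The expected boundary inventory of a clause tile. [folklore] -/
def clauseBdry : List ((ℕ × ℕ) × GridPoint) :=
  [((0, 0), ((0 : ℤ), (30 : ℤ))), ((0, 15), ((168 : ℤ), (30 : ℤ)))] ++
    (List.range 12).map fun j : ℕ => ((1, 12 * (j / 4) + 8 + j % 4), ((56 : ℤ) * (j / 4 : ℕ) + 20 + 2 * (j % 4 : ℕ), (60 : ℤ)))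

/-- The keys at home in a clause tile (the other one is `(0, 15)`, the next cell's entry). [folklore] -/
def clauseHome : List (ℕ × ℕ) := (List.range 15).map (fun d => (0, d)) ++
  ((List.range 36).filter fun d => 4 ≤ d % 12).map (fun d => (1, d)) ++ (List.range 27).map (fun d => (2, d))

/-- The expected boundary inventory of the end tile. [folklore] -/
def zBdry : List ((ℕ × ℕ) × GridPoint) := [((0, 0), ((0 : ℤ), (30 : ℤ)))]

set_option maxHeartbeats 4000000 in
set_option maxRecDepth 100000 in
/-- **The boundary inventories of the site tiles are as expected** (by `decide`). [folklore] -/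
theorem site_bdry (f l t s0 s1 m : Bool) (h : siteOK f l t s0 s1 = true) :
    (∀ e ∈ bdryInv (siteTile f l t s0 s1 m) (siteNum f l t s0 s1), e ∈ siteBdry f l t s0 s1 m) ∧
      ∀ e ∈ siteBdry f l t s0 s1 m, e ∈ bdryInv (siteTile f l t s0 s1 m) (siteNum f l t s0 s1) := by
  revert h; cases f <;> cases l <;> cases t <;> cases s0 <;> cases s1 <;> cases m <;> decide +kernel

set_option maxHeartbeats 4000000 in
set_option maxRecDepth 100000 in
/-- **The keys of the site tiles are exactly the home and away keys, without repetition** (by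
`decide`). [folklore] -/
theorem site_keys (f l t s0 s1 : Bool) (h : siteOK f l t s0 s1 = true) :
    (siteNum f l t s0 s1).Nodup ∧ (∀ k ∈ siteNum f l t s0 s1, k ∈ siteHome f l s0 s1 ∨ k ∈ siteAway f l s1) ∧
      (∀ k ∈ siteHome f l s0 s1, k ∈ siteNum f l t s0 s1) ∧ (∀ k ∈ siteAway f l s1, k ∈ siteNum f l t s0 s1) ∧
      ∀ k ∈ siteHome f l s0 s1, k ∉ siteAway f l s1 := by
  revert h; cases f <;> cases l <;> cases t <;> cases s0 <;> cases s1 <;> decide +kernel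

set_option maxHeartbeats 4000000 in
set_option maxRecDepth 100000 in
/-- The keys of the site tiles match their positions in number (so `getD` is a genuine lookup). [folklore] -/
theorem siteNum_length (f l t s0 s1 m : Bool) : (siteNum f l t s0 s1).length = (siteTile f l t s0 s1 m).nv := by
  cases f <;> cases l <;> cases t <;> cases s0 <;> cases s1 <;> cases m <;> decide +kernel

set_option maxHeartbeats 4000000 in
set_option maxRecDepth 100000 in
/-- The boundary inventories of the dummy-pair tiles (by `decide`). [folklore] -/
theorem dummy_bdry (f l v : Bool) :
    (∀ e ∈ bdryInv (dummyTile f l v) (dummyNum f l v), e ∈ dummyBdry f l) ∧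
      ∀ e ∈ dummyBdry f l, e ∈ bdryInv (dummyTile f l v) (dummyNum f l v) := by
  cases f <;> cases l <;> cases v <;> decide +kernel

set_option maxHeartbeats 4000000 in
set_option maxRecDepth 100000 in
/-- The keys of the dummy-pair tiles (by `decide`). [folklore] -/
theorem dummy_keys (f l v : Bool) :
    (dummyNum f l v).Nodup ∧ (dummyNum f l v).length = (dummyTile f l v).nv ∧
      (∀ k ∈ dummyNum f l v, k ∈ dummyHome v ∨ k ∈ dummyAway l) ∧
      (∀ k ∈ dummyHome v, k ∈ dummyNum f l v) ∧ (∀ k ∈ dummyAway l, k ∈ dummyNum f l v) ∧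
      ∀ k ∈ dummyHome v, k ∉ dummyAway l := by
  cases f <;> cases l <;> cases v <;> decide +kernel

set_option maxHeartbeats 4000000 in
set_option maxRecDepth 100000 in
/-- The boundary inventories and keys of the tiles of `K_0` (by `decide`). [folklore] -/
theorem k0_facts (p : Bool) :
    ((∀ e ∈ bdryInv (k0Tile p) (k0Num p), e ∈ k0Bdry) ∧ ∀ e ∈ k0Bdry, e ∈ bdryInv (k0Tile p) (k0Num p)) ∧
      (k0Num p).Nodup ∧ (k0Num p).length = (k0Tile p).nv ∧
      (∀ k ∈ k0Num p, k ∈ k0Home ∨ k = (0, 5)) ∧ (∀ k ∈ k0Home, k ∈ k0Num p) ∧ (0, 5) ∈ k0Num p ∧ (0, 5) ∉ k0Home := by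
  cases p <;> decide +kernel

set_option maxHeartbeats 4000000 in
set_option maxRecDepth 100000 in
/-- The boundary inventories and keys of the clause tiles (by `decide`). [folklore] -/
theorem clause_facts (p0 p1 p2 : Bool) :
    ((∀ e ∈ bdryInv (clauseTile p0 p1 p2) (clauseNum p0 p1 p2), e ∈ clauseBdry) ∧
        ∀ e ∈ clauseBdry, e ∈ bdryInv (clauseTile p0 p1 p2) (clauseNum p0 p1 p2)) ∧
      (clauseNum p0 p1 p2).Nodup ∧ (clauseNum p0 p1 p2).length = (clauseTile p0 p1 p2).nv ∧
      (∀ k ∈ clauseNum p0 p1 p2, k ∈ clauseHome ∨ k = (0, 15)) ∧ (∀ k ∈ clauseHome, k ∈ clauseNum p0 p1 p2) ∧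
      (0, 15) ∈ clauseNum p0 p1 p2 ∧ (0, 15) ∉ clauseHome := by
  cases p0 <;> cases p1 <;> cases p2 <;> decide +kernel

set_option maxHeartbeats 4000000 in
set_option maxRecDepth 100000 in
/-- The boundary inventory and keys of the end tile (by `decide`). [folklore] -/
theorem z_facts :
    ((∀ e ∈ bdryInv zTile zNum, e ∈ zBdry) ∧ ∀ e ∈ zBdry, e ∈ bdryInv zTile zNum) ∧
      zNum.Nodup ∧ zNum.length = zTile.nv ∧ (∀ k ∈ zNum, k.1 = 0 ∧ k.2 < 5) ∧ ∀ d < 5, (0, d) ∈ zNum := by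
  decide +kernel

/-! ### Ports: how neighbouring tiles share their boundary vertices (facts about the tables, by `decide`) -/

/-- A port: the key of a shared vertex in the first tile, in the second tile, and its local position in each. [folklore] -/
abbrev Port := (ℕ × ℕ) × (ℕ × ℕ) × GridPoint × GridPoint

/-- Ports between a site and the next site of its row (to its right; to its left in a mirrored row):
chain exit/entry, the `q`-vertices of the diamond ladder, the set-ladder midpoints. [folklore] -/
def hsPorts (s0 m : Bool) : List Port :=
  ((((0, 10), (0, 0), ((56 : ℤ), (20 : ℤ))) :: (List.range 4).map fun k : ℕ => ((2, 11 + 4 * k), (3, 11 + 4 * k), ((56 : ℤ), Yd k))) ++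
    (if s0 then (List.range 4).map fun i : ℕ => ((6, 8 + i), (6, 8 + i), ((56 : ℤ), (12 : ℤ) + 2 * (i : ℤ))) else [])).map
    fun e : (ℕ × ℕ) × (ℕ × ℕ) × GridPoint => (e.1, e.2.1, mx m e.2.2, mx m (e.2.2.1 - 56, e.2.2.2))

/-- Ports between a site and the site below it on the same column: the midpoints of the exit ladder,
and (last site of the row) the entry of the next row. [folklore] -/
def vsPorts (l m : Bool) : List Port :=
  ((List.range 4).map fun i : ℕ =>
      ((5, 8 + i), (4, 8 + i), ((if m then (20 : ℤ) + 2 * (i : ℤ) else (36 : ℤ) - 2 * (i : ℤ)), (0 : ℤ)),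
        ((if m then (20 : ℤ) + 2 * (i : ℤ) else (36 : ℤ) - 2 * (i : ℤ)), (100 : ℤ)))) ++
    (if l then [((1, 0), (0, 0), ((if m then (6 : ℤ) else 50), (0 : ℤ)), ((if m then (6 : ℤ) else 50), (100 : ℤ)))] else [])

/-- Ports between a dummy pair and the site of row `0` below it. [folklore] -/
def dvPorts (l : Bool) : List Port :=
  ((List.range 4).map fun i : ℕ => ((3, 8 + i), (4, 8 + i), ((36 : ℤ) - 2 * (i : ℤ), (0 : ℤ)), ((36 : ℤ) - 2 * (i : ℤ), (100 : ℤ)))) ++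
    (if l then [((1, 0), (0, 0), ((50 : ℤ), (0 : ℤ)), ((50 : ℤ), (100 : ℤ)))] else [])

/-- Ports between the last site of the last row and the tile of `K_0` below it. [folklore] -/
def sk0Ports : List Port :=
  ((List.range 4).map fun i : ℕ => ((5, 8 + i), (1, 8 + i), ((20 : ℤ) + 2 * (i : ℤ), (0 : ℤ)), ((20 : ℤ) + 2 * (i : ℤ), (60 : ℤ)))) ++
    [((1, 0), (0, 0), ((6 : ℤ), (0 : ℤ)), ((6 : ℤ), (60 : ℤ)))]

/-- Ports between a site of the last row and the clause tile below it (`u`-th strip of the clause tile). [folklore] -/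
def sclPorts (u : ℕ) : List Port :=
  (List.range 4).map fun i : ℕ =>
    ((5, 8 + i), (1, 12 * u + 8 + i), ((20 : ℤ) + 2 * (i : ℤ), (0 : ℤ)), ((56 : ℤ) * (u : ℤ) + 20 + 2 * (i : ℤ), (60 : ℤ)))

/-- The port between consecutive dummy pairs. [folklore] -/
def dhPorts : List Port := [((0, 10), (0, 0), ((56 : ℤ), (20 : ℤ)), ((0 : ℤ), (20 : ℤ)))]

/-- The port between the tile of `K_0` and the next tile of the clause row. [folklore] -/
def khPorts : List Port := [((0, 5), (0, 0), ((56 : ℤ), (30 : ℤ)), ((0 : ℤ), (30 : ℤ)))]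

/-- The port between a clause tile and the next tile of the clause row. [folklore] -/
def chPorts : List Port := [((0, 15), (0, 0), ((168 : ℤ), (30 : ℤ)), ((0 : ℤ), (30 : ℤ)))]

/-- **The port condition** (Boolean) between two tables of boundary vertices: the facing entries of
each are exactly the ports, the ports are entries at corresponding positions, one end of each port is
at home and the other away, and ports are told apart by position. [folklore] -/
def portOK (ps : List Port) (TP TQ : List ((ℕ × ℕ) × GridPoint)) (faceP faceQ : GridPoint → Bool) (shift : GridPoint → GridPoint)
    (homeP awayP homeQ awayQ : List (ℕ × ℕ)) : Bool :=
  TP.all (fun e => !faceP e.2 || ps.any fun π => e == (π.1, π.2.2.1)) &&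
  TQ.all (fun e => !faceQ e.2 || ps.any fun π => e == (π.2.1, π.2.2.2)) &&
  ps.all (fun π => TP.any (· == (π.1, π.2.2.1)) && TQ.any (· == (π.2.1, π.2.2.2)) && π.2.2.2 == shift π.2.2.1 &&
    (homeP.any (· == π.1) && awayQ.any (· == π.2.1) || awayP.any (· == π.1) && homeQ.any (· == π.2.1))) &&
  ps.all (fun π => ps.all fun π' => !(π.2.2.1 == π'.2.2.1) || π == π')

/-- **Site / next site ports are correct** (by `decide` over the flags). [folklore] -/
theorem hs_ports (f t s0 s1 l' t' s0' m : Bool) :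
    portOK (hsPorts s0 m) (siteBdry f false t s0 s1 m) (siteBdry false l' t' s0' s0 m)
      (fun p => p.1 == (if m then 0 else 56)) (fun p => p.1 == (if m then 56 else 0))
      (fun p => (p.1 + (if m then 56 else -56), p.2))
      (siteHome f false s0 s1) (siteAway f false s1) (siteHome false l' s0' s0) (siteAway false l' s0) = true := by
  cases f <;> cases t <;> cases s0 <;> cases s1 <;> cases l' <;> cases t' <;> cases s0' <;> cases m <;> decide

/-- **Site / site-below ports are correct** (by `decide`). [folklore] -/
theorem vs_ports (f l t s0 s1 l' t' s0' s1' m : Bool) :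
    portOK (vsPorts l m) (siteBdry f l t s0 s1 m) (siteBdry l l' t' s0' s1' (!m))
      (fun p => p.2 == 0) (fun p => p.2 == 100) (fun p => (p.1, 100))
      (siteHome f l s0 s1) (siteAway f l s1) (siteHome l l' s0' s1') (siteAway l l' s1') = true := by
  cases f <;> cases l <;> cases t <;> cases s0 <;> cases s1 <;> cases l' <;> cases t' <;> cases s0' <;> cases s1' <;> cases m <;> decide

/-- **Dummy / site-below ports are correct** (by `decide`). [folklore] -/
theorem dv_ports (f l v l' t' s0' s1' : Bool) :
    portOK (dvPorts l) (dummyBdry f l) (siteBdry l l' t' s0' s1' true)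
      (fun p => p.2 == 0) (fun p => p.2 == 100) (fun p => (p.1, 100))
      (dummyHome v) (dummyAway l) (siteHome l l' s0' s1') (siteAway l l' s1') = true := by
  cases f <;> cases l <;> cases v <;> cases l' <;> cases t' <;> cases s0' <;> cases s1' <;> decide

/-- **Last site / `K_0` ports are correct** (by `decide`). [folklore] -/
theorem sk0_ports (f t s0 s1 : Bool) :
    portOK sk0Ports (siteBdry f true t s0 s1 true) k0Bdry (fun p => p.2 == 0) (fun p => p.2 == 60) (fun p => (p.1, 60))
      (siteHome f true s0 s1) (siteAway f true s1) k0Home [(0, 5)] = true := by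
  cases f <;> cases t <;> cases s0 <;> cases s1 <;> decide

/-- **Site / clause-tile ports are correct** (by `decide`; `u` is the strip of the clause tile). [folklore] -/
theorem scl_ports (f t s0 s1 : Bool) (u : ℕ) (hu : u < 3) :
    portOK (sclPorts u) (siteBdry f false t s0 s1 true) clauseBdry (fun p => p.2 == 0)
      (fun p => p.2 == 60 && decide ((56 : ℤ) * u ≤ p.1) && decide (p.1 ≤ (56 : ℤ) * u + 56)) (fun p => (p.1 + 56 * u, 60))
      (siteHome f false s0 s1) (siteAway f false s1) clauseHome [(0, 15)] = true := by
  obtain rfl | rfl | rfl : u = 0 ∨ u = 1 ∨ u = 2 := by omega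
  all_goals cases f <;> cases t <;> cases s0 <;> cases s1 <;> decide

/-- **Dummy / dummy ports are correct** (by `decide`). [folklore] -/
theorem dh_ports (f v l' v' : Bool) :
    portOK dhPorts (dummyBdry f false) (dummyBdry false l') (fun p => p.1 == 56) (fun p => p.1 == 0) (fun p => (p.1 - 56, p.2))
      (dummyHome v) (dummyAway false) (dummyHome v') (dummyAway l') = true := by
  cases f <;> cases v <;> cases l' <;> cases v' <;> decide

/-- **Clause-row ports are correct** (by `decide`): `K_0` / clause, `K_0` / end, clause / clause, clause / end. [folklore] -/
theorem krow_ports :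
    portOK khPorts k0Bdry clauseBdry (fun p => p.1 == 56) (fun p => p.1 == 0) (fun p => (p.1 - 56, p.2)) k0Home [(0, 5)] clauseHome [(0, 15)] = true ∧
    portOK khPorts k0Bdry zBdry (fun p => p.1 == 56) (fun p => p.1 == 0) (fun p => (p.1 - 56, p.2)) k0Home [(0, 5)]
      ((List.range 5).map fun d => (0, d)) [] = true ∧
    portOK chPorts clauseBdry clauseBdry (fun p => p.1 == 168) (fun p => p.1 == 0) (fun p => (p.1 - 168, p.2)) clauseHome [(0, 15)]
      clauseHome [(0, 15)] = true ∧
    portOK chPorts clauseBdry zBdry (fun p => p.1 == 168) (fun p => p.1 == 0) (fun p => (p.1 - 168, p.2)) clauseHome [(0, 15)]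
      ((List.range 5).map fun d => (0, d)) [] = true := by
  decide

/-! ### Edges: the key pairs joined by the local edges (facts about the tiles, by `decide`) -/

/-- A code ordering the keys. [folklore] -/
def kcode (k : ℕ × ℕ) : ℕ := 100 * k.1 + k.2

/-- An unordered pair of keys, smaller code first. [folklore] -/
def kpair (a b : ℕ × ℕ) : (ℕ × ℕ) × (ℕ × ℕ) := if kcode a ≤ kcode b then (a, b) else (b, a)

/-- **The key pairs of the local edges** of a tile with keys. [folklore] -/
def edgeKeys (T : Tile) (num : List (ℕ × ℕ)) : List ((ℕ × ℕ) × (ℕ × ℕ)) :=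
  T.edges.map fun e => kpair (num.getD e.1 (0, 0)) (num.getD e.2.1 (0, 0))

/-- Rail edges `(a, b + t) – (a, b + t + 1)`, `t < n`. [folklore] -/
def railE (a b n : ℕ) : List ((ℕ × ℕ) × (ℕ × ℕ)) := (List.range n).map fun t => ((a, b + t), (a, b + t + 1))

/-- Rung halves `(a, b + t) – (a, m + t)`, `t < n`. [folklore] -/
def rungE (a b m n : ℕ) : List ((ℕ × ℕ) × (ℕ × ℕ)) := (List.range n).map fun t => ((a, b + t), (a, m + t))

/-- **The expected key pairs of a site tile**, by its flags: the chain edges of `Bl_s` and `W_s` that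
are not slots, the diamond ladder with its ports (hop edges `p a`, `p b` removed), the second rail of
the previous ladder (or, last site, its own) with its ports, the hop ladders `h₀ … h₄` with their
ports, the first rail of the exit ladder with its ports, the set-ladder rails with their ports, and
(last site) the cell `Bl_N` with the entry of the next row. [folklore] -/
def siteEdges (f l t s0 s1 : Bool) : List ((ℕ × ℕ) × (ℕ × ℕ)) :=
  [((0, 0), (0, 1)), ((0, 2), (0, 3)), ((0, 4), (0, 5)), ((0, 5), (0, 6)), ((0, 7), (0, 8)), ((0, 7), (0, 9)), ((0, 8), (0, 9)),
    ((0, 9), (0, 10))] ++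
  (if f then [((0, 1), (0, 2))] else []) ++ (if s1 then [] else [((0, 1), (0, 3))]) ++ (if t then [] else [((0, 3), (0, 4))]) ++
  (if t && !s0 then [((0, 6), (0, 8))] else []) ++
  [((0, 2), (2, 0)), ((0, 4), (2, 3))] ++ railE 2 0 3 ++
  (List.range 4).flatMap (fun k => [((2, k), (2, 8 + 4 * k)), ((2, 9 + 4 * k), (2, 10 + 4 * k)), ((2, 9 + 4 * k), (2, 11 + 4 * k)),
    ((2, 10 + 4 * k), (2, 11 + 4 * k))]) ++
  (if f then [] else railE 3 4 3 ++ (List.range 4).map (fun k => ((3, 4 + k), (3, 11 + 4 * k))) ++ [((0, 1), (3, 7)), ((0, 2), (3, 4))]) ++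
  (if l then railE 2 4 3 ++ (List.range 4).map (fun k => ((2, 4 + k), (2, 11 + 4 * k))) ++ [((0, 11), (2, 7)), ((0, 12), (2, 4)),
    ((0, 10), (0, 11)), ((0, 12), (0, 13)), ((0, 12), (0, 14)), ((0, 13), (0, 14)), ((0, 14), (1, 0))] ++
    (if s0 then [((0, 11), (6, 7)), ((0, 13), (6, 4))] else [((0, 11), (0, 13))]) else []) ++
  railE 4 4 3 ++ rungE 4 4 8 4 ++ [((2, 8), (4, 4)), ((2, 9), (4, 7))] ++
  (List.range 4).flatMap (fun h' => railE 4 (12 * h' + 12) 3 ++ railE 4 (12 * h' + 16) 3 ++ rungE 4 (12 * h' + 12) (12 * h' + 20) 4 ++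
    rungE 4 (12 * h' + 16) (12 * h' + 20) 4 ++ [((2, 8 + 4 * h'), (4, 12 * h' + 12)), ((2, 10 + 4 * h'), (4, 12 * h' + 15))] ++
    (if h' < 3 then [((2, 12 + 4 * h'), (4, 12 * h' + 16)), ((2, 13 + 4 * h'), (4, 12 * h' + 19))] else [((0, 6), (4, 52)), ((0, 7), (4, 55))])) ++
  railE 5 0 3 ++ rungE 5 0 8 4 ++ (if t then [((0, 4), (5, 0)), ((0, 3), (5, 3))] else [((0, 8), (5, 0)), ((0, 6), (5, 3))]) ++
  (if s0 then railE 6 0 3 ++ rungE 6 0 8 4 ++ [((0, 6), (6, 0)), ((0, 8), (6, 3))] else []) ++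
  (if s1 || (s0 && l) then railE 6 4 3 ++ rungE 6 4 8 4 else []) ++ (if s1 then [((0, 3), (6, 4)), ((0, 1), (6, 7))] else [])

/-- The expected key pairs of a dummy-pair tile: the cells `D_c`, `D'_c`, their pins, the first
rail of `h₀` of the column, and (no previous occurrence) the vacuous set ladder. [folklore] -/
def dummyEdges (l v : Bool) : List ((ℕ × ℕ) × (ℕ × ℕ)) :=
  [((0, 0), (0, 1)), ((0, 2), (0, 3)), ((0, 2), (0, 4)), ((0, 4), (0, 5)), ((0, 5), (0, 6)), ((0, 7), (0, 8)), ((0, 7), (0, 9)), ((0, 8), (0, 9))] ++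
  (if v then [] else [((0, 3), (0, 4)), ((0, 6), (0, 8))]) ++ (if l then [((0, 9), (1, 0))] else [((0, 9), (0, 10))]) ++
  [((2, 0), (2, 1)), ((2, 0), (2, 2)), ((2, 1), (2, 2)), ((2, 3), (2, 4)), ((2, 3), (2, 5)), ((2, 4), (2, 5)),
    ((0, 1), (2, 0)), ((0, 2), (2, 1)), ((0, 6), (2, 3)), ((0, 7), (2, 4))] ++
  railE 3 0 3 ++ rungE 3 0 8 4 ++ [((0, 3), (3, 0)), ((0, 1), (3, 3))] ++
  (if v then railE 4 0 3 ++ railE 4 4 3 ++ rungE 4 0 8 4 ++ rungE 4 4 8 4 ++ [((0, 3), (4, 0)), ((0, 4), (4, 3)), ((0, 8), (4, 4)), ((0, 6), (4, 7))]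
    else [])

/-- The expected key pairs of a clause cell `K` (keys `(0, b + _)`) with its gadget ports
`(g₁, g₂)` (first and last node of its rail) and clause link (keys `(1, m + _)`). [folklore] -/
def kcellEdges (b : ℕ) (pol : Bool) (g₁ g₂ : ℕ × ℕ) (m : ℕ) : List ((ℕ × ℕ) × (ℕ × ℕ)) :=
  [((0, b), (0, b + 1)), ((0, b + 2), (0, b + 3)), ((0, b + 2), (0, b + 4)), ((0, b + 4), (0, b + 5))] ++
  (if pol then [((0, b + 3), (0, b + 4)), ((0, b + 1), g₁), ((0, b + 3), g₂)] else [((0, b + 1), (0, b + 3)), ((0, b + 3), g₁), ((0, b + 4), g₂)]) ++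
  railE 1 m 3 ++ rungE 1 m (m + 4) 4 ++ [((0, b + 1), (1, m)), ((0, b + 2), (1, m + 3))]

/-- The expected key pairs of the tile of `K_0`. [folklore] -/
def k0Edges (pol : Bool) : List ((ℕ × ℕ) × (ℕ × ℕ)) :=
  kcellEdges 0 pol (2, 0) (2, 1) 4 ++ [((2, 0), (2, 1)), ((2, 0), (2, 2)), ((2, 1), (2, 2))]

/-- The ends of the rungs of the three-input OR-gadget, as node codes `6 · rail + position`. [folklore] -/
def or3Rungs : List (ℕ × ℕ) := [(1, 5), (7, 11), (13, 17), (0, 16), (2, 15), (3, 8), (4, 6), (9, 14), (10, 12)]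

/-- The expected key pairs of a clause tile. [folklore] -/
def clauseEdges (p0 p1 p2 : Bool) : List ((ℕ × ℕ) × (ℕ × ℕ)) :=
  kcellEdges 0 p0 (2, 0) (2, 5) 4 ++ kcellEdges 5 p1 (2, 6) (2, 11) 16 ++ kcellEdges 10 p2 (2, 12) (2, 17) 28 ++
  railE 2 0 5 ++ railE 2 6 5 ++ railE 2 12 5 ++
  (List.range 9).flatMap fun ρ => [((2, (or3Rungs.getD ρ (0, 0)).1), (2, 18 + ρ)), ((2, (or3Rungs.getD ρ (0, 0)).2), (2, 18 + ρ))]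

/-- The expected key pairs of the end tile: the whole cell. [folklore] -/
def zEdges : List ((ℕ × ℕ) × (ℕ × ℕ)) :=
  [((0, 0), (0, 1)), ((0, 1), (0, 2)), ((0, 1), (0, 3)), ((0, 2), (0, 3)), ((0, 2), (0, 4)), ((0, 3), (0, 4))]

/-- Two lists of key pairs agree as sets of unordered pairs (Boolean). [folklore] -/
def edgesAgree (A B : List ((ℕ × ℕ) × (ℕ × ℕ))) : Bool :=
  A.all (fun e => B.any fun e' => kpair e.1 e.2 == kpair e'.1 e'.2) && B.all (fun e => A.any fun e' => kpair e.1 e.2 == kpair e'.1 e'.2)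

set_option maxHeartbeats 4000000 in
set_option maxRecDepth 100000 in
/-- **The site tiles join exactly the expected key pairs** (by `decide`). [folklore] -/
theorem site_edges (f l t s0 s1 m : Bool) (h : siteOK f l t s0 s1 = true) :
    edgesAgree (edgeKeys (siteTile f l t s0 s1 m) (siteNum f l t s0 s1)) (siteEdges f l t s0 s1) = true := by
  revert h; cases f <;> cases l <;> cases t <;> cases s0 <;> cases s1 <;> cases m <;> decide +kernel

set_option maxHeartbeats 4000000 in
set_option maxRecDepth 100000 in
/-- The dummy-pair tiles join exactly the expected key pairs (by `decide`). [folklore] -/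
theorem dummy_edges (f l v : Bool) : edgesAgree (edgeKeys (dummyTile f l v) (dummyNum f l v)) (dummyEdges l v) = true := by
  cases f <;> cases l <;> cases v <;> decide +kernel

set_option maxHeartbeats 4000000 in
set_option maxRecDepth 100000 in
/-- The tiles of the clause row join exactly the expected key pairs (by `decide`). [folklore] -/
theorem krow_edges (p p0 p1 p2 : Bool) :
    edgesAgree (edgeKeys (k0Tile p) (k0Num p)) (k0Edges p) = true ∧
      edgesAgree (edgeKeys (clauseTile p0 p1 p2) (clauseNum p0 p1 p2)) (clauseEdges p0 p1 p2) = true ∧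
      edgesAgree (edgeKeys zTile zNum) zEdges = true := by
  refine ⟨?_, ?_, by decide +kernel⟩
  · cases p <;> decide +kernel
  · cases p0 <;> cases p1 <;> cases p2 <;> decide +kernel

/-! ### Membership of the edge families in the expected key pairs (by `decide`) -/

set_option synthInstance.maxSize 8192 in
set_option synthInstance.maxHeartbeats 800000 in
/-- Hop ladders `h₁ … h₄`: rails, rungs and ports are expected key pairs of every site. [folklore] -/
theorem mem_siteEdges_hop (f l t s0 s1 : Bool) : ∀ H : Fin 4,
    (∀ R : Fin 2, ∀ U : Fin 3, ((4, 12 * H.val + 12 + 4 * R.val + U.val), (4, 12 * H.val + 12 + 4 * R.val + U.val + 1)) ∈ siteEdges f l t s0 s1) ∧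
    (∀ R : Fin 2, ∀ U : Fin 4, ((4, 12 * H.val + 12 + 4 * R.val + U.val), (4, 12 * H.val + 20 + U.val)) ∈ siteEdges f l t s0 s1) ∧
    ((2, 8 + 4 * H.val), (4, 12 * H.val + 12)) ∈ siteEdges f l t s0 s1 ∧ ((2, 10 + 4 * H.val), (4, 12 * H.val + 15)) ∈ siteEdges f l t s0 s1 ∧
    (H.val < 3 → ((2, 12 + 4 * H.val), (4, 12 * H.val + 16)) ∈ siteEdges f l t s0 s1 ∧
      ((2, 13 + 4 * H.val), (4, 12 * H.val + 19)) ∈ siteEdges f l t s0 s1) := by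
  cases f <;> cases l <;> cases t <;> cases s0 <;> cases s1 <;> decide

set_option synthInstance.maxSize 8192 in
set_option synthInstance.maxHeartbeats 800000 in
/-- `h₀` (second rail, rungs, ports at `p₀ a₀`), `h₄`'s ports at the door, the exit ladder's first
rail with rungs and ports. [folklore] -/
theorem mem_siteEdges_h0_exit (f l t s0 s1 : Bool) :
    (∀ U : Fin 3, ((4, 4 + U.val), (4, 4 + U.val + 1)) ∈ siteEdges f l t s0 s1) ∧
    (∀ U : Fin 4, ((4, 4 + U.val), (4, 8 + U.val)) ∈ siteEdges f l t s0 s1) ∧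
    ((2, 8), (4, 4)) ∈ siteEdges f l t s0 s1 ∧ ((2, 9), (4, 7)) ∈ siteEdges f l t s0 s1 ∧
    ((0, 6), (4, 52)) ∈ siteEdges f l t s0 s1 ∧ ((0, 7), (4, 55)) ∈ siteEdges f l t s0 s1 ∧
    (∀ U : Fin 3, ((5, U.val), (5, U.val + 1)) ∈ siteEdges f l t s0 s1) ∧
    (∀ U : Fin 4, ((5, U.val), (5, 8 + U.val)) ∈ siteEdges f l t s0 s1) ∧
    (t = true → ((0, 4), (5, 0)) ∈ siteEdges f l t s0 s1 ∧ ((0, 3), (5, 3)) ∈ siteEdges f l t s0 s1) ∧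
    (t = false → ((0, 8), (5, 0)) ∈ siteEdges f l t s0 s1 ∧ ((0, 6), (5, 3)) ∈ siteEdges f l t s0 s1) := by
  cases f <;> cases l <;> cases t <;> cases s0 <;> cases s1 <;> decide

set_option synthInstance.maxSize 8192 in
set_option synthInstance.maxHeartbeats 800000 in
/-- The set ladder: rails, rungs, ports. [folklore] -/
theorem mem_siteEdges_set (f l t s0 s1 : Bool) :
    (s0 = true → (∀ U : Fin 3, ((6, U.val), (6, U.val + 1)) ∈ siteEdges f l t s0 s1) ∧
      (∀ U : Fin 4, ((6, U.val), (6, 8 + U.val)) ∈ siteEdges f l t s0 s1) ∧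
      ((0, 6), (6, 0)) ∈ siteEdges f l t s0 s1 ∧ ((0, 8), (6, 3)) ∈ siteEdges f l t s0 s1) ∧
    ((s1 || (s0 && l)) = true → (∀ U : Fin 3, ((6, 4 + U.val), (6, 4 + U.val + 1)) ∈ siteEdges f l t s0 s1) ∧
      (∀ U : Fin 4, ((6, 4 + U.val), (6, 8 + U.val)) ∈ siteEdges f l t s0 s1)) ∧
    (s1 = true → ((0, 3), (6, 4)) ∈ siteEdges f l t s0 s1 ∧ ((0, 1), (6, 7)) ∈ siteEdges f l t s0 s1) ∧
    ((s0 && l) = true → ((0, 13), (6, 4)) ∈ siteEdges f l t s0 s1 ∧ ((0, 11), (6, 7)) ∈ siteEdges f l t s0 s1) := by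
  cases f <;> cases l <;> cases t <;> cases s0 <;> cases s1 <;> decide

set_option synthInstance.maxSize 8192 in
set_option synthInstance.maxHeartbeats 800000 in
/-- The diamond ladder with its ports, the previous ladder's second rail, the last site. [folklore] -/
theorem mem_siteEdges_dl (f l t s0 s1 : Bool) :
    (∀ U : Fin 3, ((2, U.val), (2, U.val + 1)) ∈ siteEdges f l t s0 s1) ∧
    (∀ K : Fin 4, ((2, K.val), (2, 8 + 4 * K.val)) ∈ siteEdges f l t s0 s1 ∧
      ((2, 9 + 4 * K.val), (2, 10 + 4 * K.val)) ∈ siteEdges f l t s0 s1 ∧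
      ((2, 9 + 4 * K.val), (2, 11 + 4 * K.val)) ∈ siteEdges f l t s0 s1 ∧
      ((2, 10 + 4 * K.val), (2, 11 + 4 * K.val)) ∈ siteEdges f l t s0 s1) ∧
    ((0, 2), (2, 0)) ∈ siteEdges f l t s0 s1 ∧ ((0, 4), (2, 3)) ∈ siteEdges f l t s0 s1 ∧
    (f = false → (∀ U : Fin 3, ((3, 4 + U.val), (3, 4 + U.val + 1)) ∈ siteEdges f l t s0 s1) ∧
      (∀ K : Fin 4, ((3, 4 + K.val), (3, 11 + 4 * K.val)) ∈ siteEdges f l t s0 s1) ∧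
      ((0, 1), (3, 7)) ∈ siteEdges f l t s0 s1 ∧ ((0, 2), (3, 4)) ∈ siteEdges f l t s0 s1) ∧
    (l = true → (∀ U : Fin 3, ((2, 4 + U.val), (2, 4 + U.val + 1)) ∈ siteEdges f l t s0 s1) ∧
      (∀ K : Fin 4, ((2, 4 + K.val), (2, 11 + 4 * K.val)) ∈ siteEdges f l t s0 s1) ∧
      ((0, 11), (2, 7)) ∈ siteEdges f l t s0 s1 ∧ ((0, 12), (2, 4)) ∈ siteEdges f l t s0 s1 ∧
      ((0, 10), (0, 11)) ∈ siteEdges f l t s0 s1 ∧ ((0, 12), (0, 13)) ∈ siteEdges f l t s0 s1 ∧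
      ((0, 12), (0, 14)) ∈ siteEdges f l t s0 s1 ∧ ((0, 13), (0, 14)) ∈ siteEdges f l t s0 s1 ∧
      ((0, 14), (1, 0)) ∈ siteEdges f l t s0 s1 ∧ (s0 = false → ((0, 11), (0, 13)) ∈ siteEdges f l t s0 s1)) := by
  cases f <;> cases l <;> cases t <;> cases s0 <;> cases s1 <;> decide

set_option synthInstance.maxSize 8192 in
set_option synthInstance.maxHeartbeats 800000 in
/-- The chain edges of `Bl` and `W`. [folklore] -/
theorem mem_siteEdges_chain (f l t s0 s1 : Bool) :
    ((0, 0), (0, 1)) ∈ siteEdges f l t s0 s1 ∧ ((0, 2), (0, 3)) ∈ siteEdges f l t s0 s1 ∧ ((0, 4), (0, 5)) ∈ siteEdges f l t s0 s1 ∧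
    ((0, 5), (0, 6)) ∈ siteEdges f l t s0 s1 ∧ ((0, 7), (0, 8)) ∈ siteEdges f l t s0 s1 ∧ ((0, 7), (0, 9)) ∈ siteEdges f l t s0 s1 ∧
    ((0, 8), (0, 9)) ∈ siteEdges f l t s0 s1 ∧ ((0, 9), (0, 10)) ∈ siteEdges f l t s0 s1 ∧
    (f = true → ((0, 1), (0, 2)) ∈ siteEdges f l t s0 s1) ∧ (s1 = false → ((0, 1), (0, 3)) ∈ siteEdges f l t s0 s1) ∧
    (t = false → ((0, 3), (0, 4)) ∈ siteEdges f l t s0 s1) ∧ ((t && !s0) = true → ((0, 6), (0, 8)) ∈ siteEdges f l t s0 s1) := by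
  cases f <;> cases l <;> cases t <;> cases s0 <;> cases s1 <;> decide

set_option synthInstance.maxSize 8192 in
set_option synthInstance.maxHeartbeats 800000 in
/-- The dummy-pair tile's expected key pairs, by family. [folklore] -/
theorem mem_dummyEdges (l v : Bool) :
    ((0, 0), (0, 1)) ∈ dummyEdges l v ∧ ((0, 2), (0, 3)) ∈ dummyEdges l v ∧ ((0, 2), (0, 4)) ∈ dummyEdges l v ∧
    ((0, 4), (0, 5)) ∈ dummyEdges l v ∧ ((0, 5), (0, 6)) ∈ dummyEdges l v ∧ ((0, 7), (0, 8)) ∈ dummyEdges l v ∧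
    ((0, 7), (0, 9)) ∈ dummyEdges l v ∧ ((0, 8), (0, 9)) ∈ dummyEdges l v ∧
    (v = false → ((0, 3), (0, 4)) ∈ dummyEdges l v ∧ ((0, 6), (0, 8)) ∈ dummyEdges l v) ∧
    (l = true → ((0, 9), (1, 0)) ∈ dummyEdges l v) ∧ (l = false → ((0, 9), (0, 10)) ∈ dummyEdges l v) ∧
    ((2, 0), (2, 1)) ∈ dummyEdges l v ∧ ((2, 0), (2, 2)) ∈ dummyEdges l v ∧ ((2, 1), (2, 2)) ∈ dummyEdges l v ∧
    ((2, 3), (2, 4)) ∈ dummyEdges l v ∧ ((2, 3), (2, 5)) ∈ dummyEdges l v ∧ ((2, 4), (2, 5)) ∈ dummyEdges l v ∧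
    ((0, 1), (2, 0)) ∈ dummyEdges l v ∧ ((0, 2), (2, 1)) ∈ dummyEdges l v ∧ ((0, 6), (2, 3)) ∈ dummyEdges l v ∧
    ((0, 7), (2, 4)) ∈ dummyEdges l v ∧
    (∀ U : Fin 3, ((3, U.val), (3, U.val + 1)) ∈ dummyEdges l v) ∧ (∀ U : Fin 4, ((3, U.val), (3, 8 + U.val)) ∈ dummyEdges l v) ∧
    ((0, 3), (3, 0)) ∈ dummyEdges l v ∧ ((0, 1), (3, 3)) ∈ dummyEdges l v ∧
    (v = true → (∀ R : Fin 2, ∀ U : Fin 3, ((4, 4 * R.val + U.val), (4, 4 * R.val + U.val + 1)) ∈ dummyEdges l v) ∧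
      (∀ R : Fin 2, ∀ U : Fin 4, ((4, 4 * R.val + U.val), (4, 8 + U.val)) ∈ dummyEdges l v) ∧
      ((0, 3), (4, 0)) ∈ dummyEdges l v ∧ ((0, 4), (4, 3)) ∈ dummyEdges l v ∧ ((0, 8), (4, 4)) ∈ dummyEdges l v ∧
      ((0, 6), (4, 7)) ∈ dummyEdges l v) := by
  cases l <;> cases v <;> decide

set_option synthInstance.maxSize 8192 in
set_option synthInstance.maxHeartbeats 800000 in
/-- The families of the tile of `K_0`. [folklore] -/
theorem mem_k0Edges (p : Bool) :
    ((0, 0), (0, 1)) ∈ k0Edges p ∧ ((0, 2), (0, 3)) ∈ k0Edges p ∧ ((0, 2), (0, 4)) ∈ k0Edges p ∧ ((0, 4), (0, 5)) ∈ k0Edges p ∧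
    (p = true → ((0, 3), (0, 4)) ∈ k0Edges p ∧ ((0, 1), (2, 0)) ∈ k0Edges p ∧ ((0, 3), (2, 1)) ∈ k0Edges p) ∧
    (p = false → ((0, 1), (0, 3)) ∈ k0Edges p ∧ ((0, 3), (2, 0)) ∈ k0Edges p ∧ ((0, 4), (2, 1)) ∈ k0Edges p) ∧
    (∀ U : Fin 3, ((1, 4 + U.val), (1, 4 + U.val + 1)) ∈ k0Edges p) ∧ (∀ U : Fin 4, ((1, 4 + U.val), (1, 8 + U.val)) ∈ k0Edges p) ∧
    ((0, 1), (1, 4)) ∈ k0Edges p ∧ ((0, 2), (1, 7)) ∈ k0Edges p ∧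
    ((2, 0), (2, 1)) ∈ k0Edges p ∧ ((2, 0), (2, 2)) ∈ k0Edges p ∧ ((2, 1), (2, 2)) ∈ k0Edges p := by
  cases p <;> decide

set_option synthInstance.maxSize 8192 in
set_option synthInstance.maxHeartbeats 800000 in
/-- The families of the clause tiles: the three cells with their links and OR-gadget rails. [folklore] -/
theorem mem_clauseEdges_cell (p0 p1 p2 : Bool) : ∀ V : Fin 3,
    ((0, 5 * V.val), (0, 5 * V.val + 1)) ∈ clauseEdges p0 p1 p2 ∧ ((0, 5 * V.val + 2), (0, 5 * V.val + 3)) ∈ clauseEdges p0 p1 p2 ∧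
    ((0, 5 * V.val + 2), (0, 5 * V.val + 4)) ∈ clauseEdges p0 p1 p2 ∧ ((0, 5 * V.val + 4), (0, 5 * V.val + 5)) ∈ clauseEdges p0 p1 p2 ∧
    ((if V.val = 0 then p0 else if V.val = 1 then p1 else p2) = true → ((0, 5 * V.val + 3), (0, 5 * V.val + 4)) ∈ clauseEdges p0 p1 p2 ∧
      ((0, 5 * V.val + 1), (2, 6 * V.val)) ∈ clauseEdges p0 p1 p2 ∧ ((0, 5 * V.val + 3), (2, 6 * V.val + 5)) ∈ clauseEdges p0 p1 p2) ∧
    ((if V.val = 0 then p0 else if V.val = 1 then p1 else p2) = false → ((0, 5 * V.val + 1), (0, 5 * V.val + 3)) ∈ clauseEdges p0 p1 p2 ∧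
      ((0, 5 * V.val + 3), (2, 6 * V.val)) ∈ clauseEdges p0 p1 p2 ∧ ((0, 5 * V.val + 4), (2, 6 * V.val + 5)) ∈ clauseEdges p0 p1 p2) ∧
    (∀ U : Fin 3, ((1, 12 * V.val + 4 + U.val), (1, 12 * V.val + 4 + U.val + 1)) ∈ clauseEdges p0 p1 p2) ∧
    (∀ U : Fin 4, ((1, 12 * V.val + 4 + U.val), (1, 12 * V.val + 8 + U.val)) ∈ clauseEdges p0 p1 p2) ∧
    ((0, 5 * V.val + 1), (1, 12 * V.val + 4)) ∈ clauseEdges p0 p1 p2 ∧ ((0, 5 * V.val + 2), (1, 12 * V.val + 7)) ∈ clauseEdges p0 p1 p2 ∧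
    (∀ U : Fin 5, ((2, 6 * V.val + U.val), (2, 6 * V.val + U.val + 1)) ∈ clauseEdges p0 p1 p2) := by
  cases p0 <;> cases p1 <;> cases p2 <;> decide

set_option synthInstance.maxSize 8192 in
set_option synthInstance.maxHeartbeats 800000 in
/-- The families of the clause tiles: the rungs of the OR-gadget; and the end tile. [folklore] -/
theorem mem_clauseEdges_rungs (p0 p1 p2 : Bool) :
    (∀ P : Fin 9, ((2, (or3Rungs.getD P.val (0, 0)).1), (2, 18 + P.val)) ∈ clauseEdges p0 p1 p2 ∧
      ((2, (or3Rungs.getD P.val (0, 0)).2), (2, 18 + P.val)) ∈ clauseEdges p0 p1 p2) ∧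
    (((0, 0), (0, 1)) ∈ zEdges ∧ ((0, 1), (0, 2)) ∈ zEdges ∧ ((0, 1), (0, 3)) ∈ zEdges ∧ ((0, 2), (0, 3)) ∈ zEdges ∧
      ((0, 2), (0, 4)) ∈ zEdges ∧ ((0, 3), (0, 4)) ∈ zEdges) := by
  cases p0 <;> cases p1 <;> cases p2 <;> decide

end LOTTiles

namespace LOTDrawing

open Literature.Computability.Complexity Literature.Combinatorics.SimpleGraph
open Literature.Combinatorics.SimpleGraph.LOTReduction LOTTiles

variable (φ : CNF ℕ)

/-! ### Flags, tiles, anchors and placements -/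

/-- Site flag: first site of its row. [folklore] -/
def sF1 (s : ℕ) : Bool := decide (s = 0)

/-- Site flag: last site of its row. [folklore] -/
def sF2 (s : ℕ) : Bool := decide (s + 1 = N φ)

/-- Site flag: the column through the site taps the bus here. [folklore] -/
def sF3 (r s : ℕ) : Bool := decide (IsTap φ r (J φ r s))

/-- Site flag: the set ladder of column `r` has its first rail here. [folklore] -/
def sF4 (r s : ℕ) : Bool := decide (s = J φ r r) && (prev? φ r).isSome

/-- Site flag: the set ladder of column `r` has its second rail here. [folklore] -/
def sF5 (r s : ℕ) : Bool := decide (1 ≤ s ∧ s - 1 = J φ r r) && (prev? φ r).isSome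

/-- Site flag: the row runs right to left (mirrored tile). [folklore] -/
def sMir (r : ℕ) : Bool := decide (r % 2 = 0)

/-- The tile of site `(r, s)`. [folklore] -/
def sTile (r s : ℕ) : Tile := siteTile (sF1 s) (sF2 φ s) (sF3 φ r s) (sF4 φ r s) (sF5 φ r s) (sMir r)

/-- The numbering keys of the tile of site `(r, s)`. [folklore] -/
def sNum (r s : ℕ) : List (ℕ × ℕ) := siteNum (sF1 s) (sF2 φ s) (sF3 φ r s) (sF4 φ r s) (sF5 φ r s)

/-- **The anchors of site `(r, s)`**: `0` the bus cell `Bl_s` (chain vertices `5 · cell + _`), `1` the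
first cell of the next row (or `K_0`), `2` the diamond ladder of the site, `3` that of the previous
site, `4` the hop ladders of the column through the site, `5` the exit ladder (first hop ladder of
the next row on that column, or its clause link), `6` the set ladder of column `r`. [folklore] -/
def siteAnchor (r s a : ℕ) : ℕ :=
  match a with
  | 0 => 5 * blIdx φ r s
  | 1 => if r + 1 < N φ then 5 * blIdx φ (r + 1) 0 else 5 * kIdx φ 0
  | 2 => dlBase φ r s
  | 3 => dlBase φ r (s - 1)
  | 4 => base2 φ + 60 * (J φ r s * N φ + r)
  | 5 => if r + 1 < N φ then base2 φ + 60 * (J φ r s * N φ + (r + 1)) else base2 φ + 12 * (5 * (N φ * N φ) + N φ + J φ r s)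
  | _ => setBase φ r

/-- The global vertex of local vertex `i` of the tile of site `(r, s)`. [folklore] -/
def sν (r s i : ℕ) : ℕ :=
  siteAnchor φ r s ((sNum φ r s).getD i (0, 0)).1 + ((sNum φ r s).getD i (0, 0)).2

/-- The origin of the tile of site `(r, s)`. [folklore] -/
def sOrg (r s : ℕ) : GridPoint := (((56 * J φ r s : ℕ) : ℤ), -((100 * (r + 1) : ℕ) : ℤ))

/-- **The placement of site `(r, s)`.** [folklore] -/
def sitePl (r s : ℕ) : Placement := ⟨sTile φ r s, sOrg φ r s, sν φ r s⟩

/-- The tile of the dummy pair of column `c`. [folklore] -/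
def dTile (c : ℕ) : Tile := dummyTile (decide (c = 0)) (decide (c + 1 = N φ)) (prev? φ c).isNone

/-- The numbering keys of the tile of the dummy pair of column `c`. [folklore] -/
def dNum (c : ℕ) : List (ℕ × ℕ) := dummyNum (decide (c = 0)) (decide (c + 1 = N φ)) (prev? φ c).isNone

/-- **The anchors of the dummy pair of column `c`**: `0` the cell `D_c`, `1` the first cell of row `0`,
`2` the pins, `3` the first hop ladder of the column, `4` the (vacuous) set ladder. [folklore] -/
def dummyAnchor (c a : ℕ) : ℕ :=
  match a with
  | 0 => 5 * (2 * c)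
  | 1 => 5 * blIdx φ 0 0
  | 2 => pinBase φ (2 * c)
  | 3 => base2 φ + 60 * (c * N φ)
  | _ => setBase φ c

/-- The global vertex of local vertex `i` of the dummy-pair tile of column `c`. [folklore] -/
def dν (c i : ℕ) : ℕ :=
  dummyAnchor φ c ((dNum φ c).getD i (0, 0)).1 + ((dNum φ c).getD i (0, 0)).2

/-- **The placement of the dummy pair of column `c`.** [folklore] -/
def dummyPl (c : ℕ) : Placement := ⟨dTile φ c, (((56 * c : ℕ) : ℤ), 0), dν φ c⟩

/-- The `y`-coordinate of the origin of the clause row. [folklore] -/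
def yK : ℤ := -((100 * N φ + 60 : ℕ) : ℤ)

/-- The anchors of the tile of `K_0`: `0` the cell, `1` its clause link, `2` the unit-clause gadget. [folklore] -/
def k0Anchor (a : ℕ) : ℕ :=
  match a with
  | 0 => 5 * kIdx φ 0
  | 1 => klinkBase φ 0
  | _ => clause1Base φ

/-- The global vertex of local vertex `i` of the tile of `K_0`. [folklore] -/
def kν (i : ℕ) : ℕ :=
  k0Anchor φ ((k0Num (FormulaCells.polOf φ 0)).getD i (0, 0)).1 + ((k0Num (FormulaCells.polOf φ 0)).getD i (0, 0)).2

/-- **The placement of the tile of `K_0`.** [folklore] -/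
def k0Pl : Placement := ⟨k0Tile (FormulaCells.polOf φ 0), (0, yK φ), kν φ⟩

/-- The anchors of clause tile `t`: `0` its first cell, `1` the clause link of its first cell, `2` the
three-input OR-gadget. [folklore] -/
def clauseAnchor (t a : ℕ) : ℕ :=
  match a with
  | 0 => 5 * kIdx φ (3 * t + 1)
  | 1 => klinkBase φ (3 * t + 1)
  | _ => or3Base φ t

/-- The polarities of clause tile `t`. [folklore] -/
def cPols (t : ℕ) : Bool × Bool × Bool :=
  (FormulaCells.polOf φ (3 * t + 1), FormulaCells.polOf φ (3 * t + 2), FormulaCells.polOf φ (3 * t + 3))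

/-- The global vertex of local vertex `i` of clause tile `t`. [folklore] -/
def cν (t i : ℕ) : ℕ :=
  let nm := clauseNum (cPols φ t).1 (cPols φ t).2.1 (cPols φ t).2.2
  clauseAnchor φ t ((nm.getD i (0, 0)).1) + (nm.getD i (0, 0)).2

/-- **The placement of clause tile `t`.** [folklore] -/
def clausePl (t : ℕ) : Placement :=
  ⟨clauseTile (cPols φ t).1 (cPols φ t).2.1 (cPols φ t).2.2, (((56 * (3 * t + 1) : ℕ) : ℤ), yK φ), cν φ t⟩

/-- **The placement of the end tile.** [folklore] -/
def zPl : Placement := ⟨zTile, (((56 * N φ : ℕ) : ℤ), yK φ), fun i => 5 * zIdx φ + (zNum.getD i (0, 0)).2⟩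

/-- **All the placements**: dummies, sites row by row, the clause row. [folklore] -/
def placements : List Placement :=
  (List.range (N φ)).map (dummyPl φ) ++ (List.range (N φ * N φ)).map (fun i => sitePl φ (i / N φ) (i % N φ)) ++
    ([k0Pl φ] ++ (List.range (T φ)).map (clausePl φ) ++ [zPl φ])

variable {φ}

/-! ### Membership, validity, distinctness -/

/-- Membership in the list of placements. [folklore] -/
theorem mem_placements {P : Placement} :
    P ∈ placements φ ↔ (∃ c < N φ, P = dummyPl φ c) ∨ (∃ r < N φ, ∃ s < N φ, P = sitePl φ r s) ∨
      P = k0Pl φ ∨ (∃ t < T φ, P = clausePl φ t) ∨ P = zPl φ := by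
  have hsite : ∀ {r s : ℕ}, s < N φ → (r * N φ + s) / N φ = r ∧ (r * N φ + s) % N φ = s := fun {r s} hs =>
    ⟨by rw [Nat.add_comm, Nat.add_mul_div_right _ _ (by omega), Nat.div_eq_of_lt hs]; simp,
      by rw [Nat.add_comm, Nat.add_mul_mod_self_right, Nat.mod_eq_of_lt hs]⟩
  unfold placements
  rw [List.mem_append, List.mem_append, List.mem_append, List.mem_append, List.mem_map, List.mem_map, List.mem_map,
    List.mem_singleton, List.mem_singleton]
  constructor
  · rintro ((⟨c, hc, rfl⟩ | ⟨i, hi, rfl⟩) | (rfl | ⟨t, ht, rfl⟩) | rfl)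
    · exact Or.inl ⟨c, List.mem_range.1 hc, rfl⟩
    · obtain ⟨hr, hs⟩ := dl_site_lt φ (List.mem_range.1 hi)
      exact Or.inr (Or.inl ⟨_, hr, _, hs, rfl⟩)
    · exact Or.inr (Or.inr (Or.inl rfl))
    · exact Or.inr (Or.inr (Or.inr (Or.inl ⟨t, List.mem_range.1 ht, rfl⟩)))
    · exact Or.inr (Or.inr (Or.inr (Or.inr rfl)))
  · rintro (⟨c, hc, rfl⟩ | ⟨r, hr, s, hs, rfl⟩ | rfl | ⟨t, ht, rfl⟩ | rfl)
    · exact Or.inl (Or.inl ⟨c, List.mem_range.2 hc, rfl⟩)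
    · refine Or.inl (Or.inr ⟨r * N φ + s, List.mem_range.2 ?_, ?_⟩)
      · calc r * N φ + s < r * N φ + N φ := by omega
          _ = (r + 1) * N φ := by ring
          _ ≤ N φ * N φ := Nat.mul_le_mul_right _ hr
      · rw [(hsite hs).1, (hsite hs).2]
    · exact Or.inr (Or.inl (Or.inl rfl))
    · exact Or.inr (Or.inl (Or.inr ⟨t, List.mem_range.2 ht, rfl⟩))
    · exact Or.inr (Or.inr rfl)

/-- **Every placed tile is valid.** [folklore] -/
theorem valid_of_mem {P : Placement} (hP : P ∈ placements φ) : P.T.Valid := by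
  rcases mem_placements.1 hP with ⟨c, -, rfl⟩ | ⟨r, -, s, -, rfl⟩ | rfl | ⟨t, -, rfl⟩ | rfl
  · exact dummyTile_valid (decide (c = 0)) (decide (c + 1 = N φ)) (prev? φ c).isNone
  · exact siteTile_valid (sF1 s) (sF2 φ s) (sF3 φ r s) (sF4 φ r s) (sF5 φ r s) (sMir r)
  · exact k0Tile_valid (FormulaCells.polOf φ 0)
  · exact clauseTile_valid (cPols φ t).1 (cPols φ t).2.1 (cPols φ t).2.2
  · exact zTile_valid

/-- Dimensions of the placed tiles. [folklore] -/
theorem dims_site (r s : ℕ) : (sitePl φ r s).T.w = 56 ∧ (sitePl φ r s).T.h = 100 ∧ (sitePl φ r s).T.mirrored = sMir r :=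
  siteTile_dims (sF1 s) (sF2 φ s) (sF3 φ r s) (sF4 φ r s) (sF5 φ r s) (sMir r)

/-- Dimensions of the placed tiles. [folklore] -/
theorem dims_dummy (c : ℕ) : (dummyPl φ c).T.w = 56 ∧ (dummyPl φ c).T.h = 44 ∧ (dummyPl φ c).T.mirrored = false :=
  dummyTile_dims (decide (c = 0)) (decide (c + 1 = N φ)) (prev? φ c).isNone

/-- Dimensions of the placed tiles. [folklore] -/
theorem dims_k0 : (k0Pl φ).T.w = 56 ∧ (k0Pl φ).T.h = 60 ∧ (k0Pl φ).T.mirrored = false :=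
  k0Tile_dims (FormulaCells.polOf φ 0)

/-- Dimensions of the placed tiles. [folklore] -/
theorem dims_clause (t : ℕ) : (clausePl φ t).T.w = 168 ∧ (clausePl φ t).T.h = 60 ∧ (clausePl φ t).T.mirrored = false :=
  clauseTile_dims (cPols φ t).1 (cPols φ t).2.1 (cPols φ t).2.2

/-- Dimensions of the placed tiles. [folklore] -/
theorem dims_z : (zPl φ).T.w = 56 ∧ (zPl φ).T.h = 60 ∧ (zPl φ).T.mirrored = false := zTile_dims

/-- Origins of the placed tiles. [folklore] -/
theorem o_site (r s : ℕ) : (sitePl φ r s).o = (((56 * J φ r s : ℕ) : ℤ), -((100 * (r + 1) : ℕ) : ℤ)) := rfl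

/-- Origins of the placed tiles. [folklore] -/
theorem o_dummy (c : ℕ) : (dummyPl φ c).o = (((56 * c : ℕ) : ℤ), 0) := rfl

/-- Origins of the placed tiles. [folklore] -/
theorem o_k0 : (k0Pl φ).o = (0, yK φ) := rfl

/-- Origins of the placed tiles. [folklore] -/
theorem o_clause (t : ℕ) : (clausePl φ t).o = (((56 * (3 * t + 1) : ℕ) : ℤ), yK φ) := rfl

/-- Origins of the placed tiles. [folklore] -/
theorem o_z : (zPl φ).o = (((56 * N φ : ℕ) : ℤ), yK φ) := rfl

/-- Sites are numbered injectively by `r N + s`. [folklore] -/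
theorem sitePl_inj {a b : ℕ} (ha : a < N φ * N φ) (hb : b < N φ * N φ)
    (h : sitePl φ (a / N φ) (a % N φ) = sitePl φ (b / N φ) (b % N φ)) : a = b := by
  have h1 := congrArg (fun P => P.o) h
  simp only [o_site, Prod.mk.injEq] at h1
  obtain ⟨hr, hs⟩ := dl_site_lt φ ha
  obtain ⟨hr', hs'⟩ := dl_site_lt φ hb
  have hrr : a / N φ = b / N φ := by omega
  have hJ : J φ (a / N φ) (a % N φ) = J φ (b / N φ) (b % N φ) := by omega
  rw [hrr] at hJ
  have hss := J_inj hs hs' hJ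
  rw [← Nat.div_add_mod a (N φ), ← Nat.div_add_mod b (N φ), hrr, hss]

/-- **No placement is listed twice** (their origins differ). [folklore] -/
theorem nodup_placements (hN : 0 < N φ) : (placements φ).Nodup := by
  have hyK : yK φ < -((100 * N φ : ℕ) : ℤ) := by show -((100 * N φ + 60 : ℕ) : ℤ) < _; push_cast; omega
  have h1 : ((List.range (N φ)).map (dummyPl φ)).Nodup :=
    List.nodup_range.map_on fun a _ b _ h => by
      have := congrArg (fun P => P.o.1) h; simp only [o_dummy] at this; omega
  have h2 : ((List.range (N φ * N φ)).map fun i => sitePl φ (i / N φ) (i % N φ)).Nodup :=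
    List.nodup_range.map_on fun a ha b hb h => sitePl_inj (List.mem_range.1 ha) (List.mem_range.1 hb) h
  have h3 : ((List.range (T φ)).map (clausePl φ)).Nodup :=
    List.nodup_range.map_on fun a _ b _ h => by
      have := congrArg (fun P => P.o.1) h; simp only [o_clause] at this; omega
  have d12 : ∀ P ∈ (List.range (N φ)).map (dummyPl φ), ∀ Q ∈ (List.range (N φ * N φ)).map (fun i => sitePl φ (i / N φ) (i % N φ)), P ≠ Q := by
    intro P hP Q hQ hPQ
    rw [List.mem_map] at hP hQ
    obtain ⟨c, -, rfl⟩ := hP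
    obtain ⟨i, -, rfl⟩ := hQ
    have h1 : ((dummyPl φ c).o).2 = ((sitePl φ (i / N φ) (i % N φ)).o).2 := by rw [hPQ]
    rw [o_dummy, o_site] at h1
    dsimp only at h1
    generalize i / N φ = q at h1
    omega
  have d34 : ∀ P ∈ [k0Pl φ], ∀ Q ∈ (List.range (T φ)).map (clausePl φ), P ≠ Q := by
    intro P hP Q hQ hPQ
    rw [List.mem_singleton] at hP
    rw [List.mem_map] at hQ
    obtain ⟨t, -, rfl⟩ := hQ
    subst hP
    have := congrArg (fun P => P.o.1) hPQ; simp only [o_clause, o_k0] at this; omega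
  have d345 : ∀ P ∈ [k0Pl φ] ++ (List.range (T φ)).map (clausePl φ), ∀ Q ∈ [zPl φ], P ≠ Q := by
    intro P hP Q hQ hPQ
    rw [List.mem_singleton] at hQ
    subst hQ
    rw [List.mem_append, List.mem_singleton, List.mem_map] at hP
    rcases hP with rfl | ⟨t, ht, rfl⟩
    · have := congrArg (fun P => P.o.1) hPQ; simp only [o_k0, o_z] at this; omega
    · rw [List.mem_range] at ht
      have := congrArg (fun P => P.o.1) hPQ; simp only [o_clause, o_z] at this
      unfold T at ht; omega
  have dlow : ∀ P ∈ (List.range (N φ)).map (dummyPl φ) ++ (List.range (N φ * N φ)).map (fun i => sitePl φ (i / N φ) (i % N φ)),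
      ∀ Q ∈ [k0Pl φ] ++ (List.range (T φ)).map (clausePl φ) ++ [zPl φ], P ≠ Q := by
    intro P hP Q hQ hPQ
    subst hPQ
    have h2 : P.o.2 = yK φ := by
      simp only [List.mem_append, List.mem_singleton, List.mem_map] at hQ
      rcases hQ with (rfl | ⟨t, -, rfl⟩) | rfl <;> rfl
    rw [List.mem_append, List.mem_map, List.mem_map] at hP
    rcases hP with ⟨c, -, rfl⟩ | ⟨i, hi, rfl⟩
    · simp only [o_dummy] at h2; omega
    · have := (dl_site_lt φ (List.mem_range.1 hi)).1
      simp only [o_site] at h2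
      revert this h2
      generalize i / N φ = q
      intro this h2
      omega
  unfold placements
  exact List.nodup_append.2 ⟨List.nodup_append.2 ⟨h1, h2, d12⟩,
    List.nodup_append.2 ⟨List.nodup_append.2 ⟨List.nodup_singleton _, h3, d34⟩, List.nodup_singleton _, d345⟩, dlow⟩

/-! ### The boxes: neighbours meet along their boundaries, one side restricted -/

section boxes

variable {P Q : Placement}

/-- Two tiles side by side (same orientation, `P` left of `Q`): a common point lies on the right side
of `P` and the left side of `Q`, one of which is restricted. [folklore] -/
theorem boxes_horiz (hm : P.T.mirrored = Q.T.mirrored)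
    (hx : P.o.1 + P.T.w ≤ Q.o.1) (q : GridPoint) (hP : P.Box q) (hQ : Q.Box q) :
    (P.Bdry q ∧ Q.Bdry q) ∧ (P.RestrG q ∨ Q.RestrG q) := by
  unfold Placement.Box Tile.InBox at hP hQ
  unfold Placement.Bdry Placement.RestrG Tile.OnBdry Tile.Restr
  simp only at hP hQ ⊢
  refine ⟨⟨Or.inr (Or.inl (by omega)), Or.inl (by omega)⟩, ?_⟩
  cases hmq : Q.T.mirrored
  · right; right; rw [if_neg (by simp)]; omega
  · left; right; rw [hm, hmq, if_pos rfl]; omega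

/-- Two tiles in consecutive bands (`P` above `Q`): a common point lies on the bottom of `P` and the
top of `Q`, which is restricted. [folklore] -/
theorem boxes_vert (hyx : Q.o.2 + Q.T.h ≤ P.o.2) (q : GridPoint) (hP : P.Box q) (hQ : Q.Box q) :
    (P.Bdry q ∧ Q.Bdry q) ∧ (P.RestrG q ∨ Q.RestrG q) := by
  unfold Placement.Box Tile.InBox at hP hQ
  unfold Placement.Bdry Placement.RestrG Tile.OnBdry Tile.Restr
  simp only at hP hQ ⊢
  exact ⟨⟨Or.inr (Or.inr (Or.inl (by omega))), Or.inr (Or.inr (Or.inr (by omega)))⟩, Or.inr (Or.inl (by omega))⟩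

/-- Two tiles in bands further apart have no common point. [folklore] -/
theorem boxes_apart_y (hyx : Q.o.2 + Q.T.h < P.o.2) (q : GridPoint) (hP : P.Box q) (hQ : Q.Box q) : False := by
  unfold Placement.Box Tile.InBox at hP hQ
  simp only at hP hQ
  omega

/-- Two tiles of a band further apart have no common point. [folklore] -/
theorem boxes_apart_x (hx : P.o.1 + P.T.w < Q.o.1) (q : GridPoint) (hP : P.Box q) (hQ : Q.Box q) : False := by
  unfold Placement.Box Tile.InBox at hP hQ
  simp only at hP hQ
  omega

end boxes

/-- The conclusion of `boxes` is symmetric. [folklore] -/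
theorem boxes_symm {P Q : Placement} {q : GridPoint} (h : (Q.Bdry q ∧ P.Bdry q) ∧ (Q.RestrG q ∨ P.RestrG q)) :
    (P.Bdry q ∧ Q.Bdry q) ∧ (P.RestrG q ∨ Q.RestrG q) :=
  ⟨⟨h.1.2, h.1.1⟩, h.2.symm⟩

/-- **Distinct placed tiles meet only along their boundaries, and there one of the two is restricted.**
[folklore] -/
theorem boxes_placements (hN : 0 < N φ) {P : Placement} (hP : P ∈ placements φ) {Q : Placement} (hQ : Q ∈ placements φ)
    (hPQ : P ≠ Q) (q : GridPoint) (hPq : P.Box q) (hQq : Q.Box q) :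
    (P.Bdry q ∧ Q.Bdry q) ∧ (P.RestrG q ∨ Q.RestrG q) := by
  have hyK : yK φ + 60 = -((100 * N φ : ℕ) : ℤ) := by show -((100 * N φ + 60 : ℕ) : ℤ) + 60 = _; push_cast; ring
  -- dimensions and origins of both
  rcases mem_placements.1 hP with ⟨c, hc, rfl⟩ | ⟨r, hr, s, hs, rfl⟩ | rfl | ⟨t, ht, rfl⟩ | rfl <;>
    rcases mem_placements.1 hQ with ⟨c', hc', rfl⟩ | ⟨r', hr', s', hs', rfl⟩ | rfl | ⟨t', ht', rfl⟩ | rfl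
  -- dummy / dummy
  · obtain ⟨hw, hh, hm⟩ := dims_dummy (φ := φ) c
    obtain ⟨hw', hh', hm'⟩ := dims_dummy (φ := φ) c'
    rcases Nat.lt_trichotomy c c' with h | rfl | h
    · exact boxes_horiz (by rw [hm, hm']) (by simp only [o_dummy, hw]; push_cast; first | done | omega) q hPq hQq
    · exact absurd rfl hPQ
    · exact boxes_symm (boxes_horiz (by rw [hm, hm']) (by simp only [o_dummy, hw']; push_cast; first | done | omega) q hQq hPq)
  -- dummy / site
  · obtain ⟨hw, hh, hm⟩ := dims_dummy (φ := φ) c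
    obtain ⟨hw', hh', hm'⟩ := dims_site (φ := φ) r' s'
    rcases Nat.eq_zero_or_pos r' with rfl | hr0
    · exact boxes_vert (by simp only [o_dummy, o_site, hh']; push_cast) q hPq hQq
    · exact (boxes_apart_y (by simp only [o_dummy, o_site, hh']; push_cast; omega) q hPq hQq).elim
  -- dummy / k0, clause, z: apart
  · exact (boxes_apart_y (by simp only [o_dummy, o_k0, (dims_k0 (φ := φ)).2.1]; omega) q hPq hQq).elim
  · exact (boxes_apart_y (by simp only [o_dummy, o_clause, (dims_clause (φ := φ) t').2.1]; omega) q hPq hQq).elim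
  · exact (boxes_apart_y (by simp only [o_dummy, o_z, (dims_z (φ := φ)).2.1]; omega) q hPq hQq).elim
  -- site / dummy
  · obtain ⟨hw, hh, hm⟩ := dims_site (φ := φ) r s
    rcases Nat.eq_zero_or_pos r with rfl | hr0
    · exact boxes_symm (boxes_vert (by simp only [o_dummy, o_site, hh]; push_cast) q hQq hPq)
    · exact (boxes_apart_y (by simp only [o_dummy, o_site, hh]; push_cast; omega) q hQq hPq).elim
  -- site / site
  · obtain ⟨hw, hh, hm⟩ := dims_site (φ := φ) r s
    obtain ⟨hw', hh', hm'⟩ := dims_site (φ := φ) r' s'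
    have hJ := J_lt (r := r) hs
    have hJ' := J_lt (r := r') hs'
    rcases Nat.lt_trichotomy r r' with h | rfl | h
    · -- `P` above `Q`
      by_cases h1 : r + 1 = r'
      · subst h1
        exact boxes_vert (by simp only [o_site, hh']; push_cast; first | done | omega) q hPq hQq
      · exact (boxes_apart_y (by simp only [o_site, hh']; push_cast; first | done | omega) q hPq hQq).elim
    · -- same row: side by side
      have hne : J φ r s ≠ J φ r s' := fun h => hPQ (by rw [J_inj hs hs' h])
      rcases Nat.lt_or_gt_of_ne hne with h | h
      · exact boxes_horiz (by rw [hm, hm']) (by simp only [o_site, hw]; push_cast; first | done | omega) q hPq hQq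
      · exact boxes_symm (boxes_horiz (by rw [hm, hm']) (by simp only [o_site, hw']; push_cast; first | done | omega) q hQq hPq)
    · by_cases h1 : r' + 1 = r
      · subst h1
        exact boxes_symm (boxes_vert (by simp only [o_site, hh]; push_cast; first | done | omega) q hQq hPq)
      · exact (boxes_apart_y (by simp only [o_site, hh]; push_cast; first | done | omega) q hQq hPq).elim
  -- site / k0, clause, z
  · obtain ⟨hw, hh, hm⟩ := dims_site (φ := φ) r s
    by_cases h1 : r + 1 = N φ
    · exact boxes_vert (by simp only [o_site, o_k0, (dims_k0 (φ := φ)).2.1]; push_cast; first | done | omega) q hPq hQq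
    · exact (boxes_apart_y (by simp only [o_site, o_k0, (dims_k0 (φ := φ)).2.1]; push_cast; first | done | omega) q hPq hQq).elim
  · obtain ⟨hw, hh, hm⟩ := dims_site (φ := φ) r s
    by_cases h1 : r + 1 = N φ
    · exact boxes_vert (by simp only [o_site, o_clause, (dims_clause (φ := φ) t').2.1]; push_cast; first | done | omega) q hPq hQq
    · exact (boxes_apart_y (by simp only [o_site, o_clause, (dims_clause (φ := φ) t').2.1]; push_cast; first | done | omega) q hPq hQq).elim
  · obtain ⟨hw, hh, hm⟩ := dims_site (φ := φ) r s
    by_cases h1 : r + 1 = N φ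
    · exact boxes_vert (by simp only [o_site, o_z, (dims_z (φ := φ)).2.1]; push_cast; first | done | omega) q hPq hQq
    · exact (boxes_apart_y (by simp only [o_site, o_z, (dims_z (φ := φ)).2.1]; push_cast; first | done | omega) q hPq hQq).elim
  -- k0 / dummy, site
  · exact (boxes_apart_y (by simp only [o_dummy, o_k0, (dims_k0 (φ := φ)).2.1]; omega) q hQq hPq).elim
  · obtain ⟨hw', hh', hm'⟩ := dims_site (φ := φ) r' s'
    by_cases h1 : r' + 1 = N φ
    · exact boxes_symm (boxes_vert (by simp only [o_site, o_k0, (dims_k0 (φ := φ)).2.1]; push_cast; first | done | omega) q hQq hPq)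
    · exact (boxes_apart_y (by simp only [o_site, o_k0, (dims_k0 (φ := φ)).2.1]; push_cast; first | done | omega) q hQq hPq).elim
  · exact absurd rfl hPQ
  -- k0 / clause, z: side by side
  · exact boxes_horiz (by rw [(dims_k0 (φ := φ)).2.2, (dims_clause (φ := φ) t').2.2]) (by simp only [o_k0, o_clause, (dims_k0 (φ := φ)).1]; push_cast; first | done | omega) q hPq hQq
  · exact boxes_horiz (by rw [(dims_k0 (φ := φ)).2.2, (dims_z (φ := φ)).2.2]) (by simp only [o_k0, o_z, (dims_k0 (φ := φ)).1]; push_cast; first | done | omega) q hPq hQq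
  -- clause / *
  · exact (boxes_apart_y (by simp only [o_dummy, o_clause, (dims_clause (φ := φ) t).2.1]; omega) q hQq hPq).elim
  · obtain ⟨hw', hh', hm'⟩ := dims_site (φ := φ) r' s'
    by_cases h1 : r' + 1 = N φ
    · exact boxes_symm (boxes_vert (by simp only [o_site, o_clause, (dims_clause (φ := φ) t).2.1]; push_cast; first | done | omega) q hQq hPq)
    · exact (boxes_apart_y (by simp only [o_site, o_clause, (dims_clause (φ := φ) t).2.1]; push_cast; first | done | omega) q hQq hPq).elim
  · exact boxes_symm (boxes_horiz (by rw [(dims_k0 (φ := φ)).2.2, (dims_clause (φ := φ) t).2.2]) (by simp only [o_k0, o_clause, (dims_k0 (φ := φ)).1]; push_cast; first | done | omega) q hQq hPq)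
  · rcases Nat.lt_trichotomy t t' with h | rfl | h
    · exact boxes_horiz (by rw [(dims_clause (φ := φ) t).2.2, (dims_clause (φ := φ) t').2.2]) (by simp only [o_clause, (dims_clause (φ := φ) t).1]; push_cast; first | done | omega) q hPq hQq
    · exact absurd rfl hPQ
    · exact boxes_symm (boxes_horiz (by rw [(dims_clause (φ := φ) t).2.2, (dims_clause (φ := φ) t').2.2]) (by simp only [o_clause, (dims_clause (φ := φ) t').1]; push_cast; first | done | omega) q hQq hPq)
  · exact boxes_horiz (by rw [(dims_clause (φ := φ) t).2.2, (dims_z (φ := φ)).2.2])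
      (by simp only [o_clause, o_z, (dims_clause (φ := φ) t).1]; unfold T at ht; push_cast; first | done | omega) q hPq hQq
  -- z / *
  · exact (boxes_apart_y (by simp only [o_dummy, o_z, (dims_z (φ := φ)).2.1]; omega) q hQq hPq).elim
  · obtain ⟨hw', hh', hm'⟩ := dims_site (φ := φ) r' s'
    by_cases h1 : r' + 1 = N φ
    · exact boxes_symm (boxes_vert (by simp only [o_site, o_z, (dims_z (φ := φ)).2.1]; push_cast; first | done | omega) q hQq hPq)
    · exact (boxes_apart_y (by simp only [o_site, o_z, (dims_z (φ := φ)).2.1]; push_cast; first | done | omega) q hQq hPq).elim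
  · exact boxes_symm (boxes_horiz (by rw [(dims_k0 (φ := φ)).2.2, (dims_z (φ := φ)).2.2]) (by simp only [o_k0, o_z, (dims_k0 (φ := φ)).1]; push_cast; first | done | omega) q hQq hPq)
  · exact boxes_symm (boxes_horiz (by rw [(dims_clause (φ := φ) t').2.2, (dims_z (φ := φ)).2.2])
      (by simp only [o_clause, o_z, (dims_clause (φ := φ) t').1]; unfold T at ht'; push_cast; first | done | omega) q hQq hPq)
  · exact absurd rfl hPQ

/-! ### Placement descriptors -/

/-- **Descriptors of the placements** (which tile of the arrangement). [folklore] -/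
inductive PD
  | dummy (c : ℕ)
  | site (r s : ℕ)
  | k0
  | clause (t : ℕ)
  | z
  deriving DecidableEq

variable (φ)

/-- The placement of a descriptor. [folklore] -/
def PD.pl : PD → Placement
  | .dummy c => dummyPl φ c
  | .site r s => sitePl φ r s
  | .k0 => k0Pl φ
  | .clause t => clausePl φ t
  | .z => zPl φ

/-- The numbering keys of a descriptor's tile. [folklore] -/
def PD.num : PD → List (ℕ × ℕ)
  | .dummy c => dNum φ c
  | .site r s => sNum φ r s
  | .k0 => k0Num (FormulaCells.polOf φ 0)
  | .clause t => clauseNum (cPols φ t).1 (cPols φ t).2.1 (cPols φ t).2.2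
  | .z => zNum

/-- The global vertex of a key in a descriptor's tile (anchor `+` offset). [folklore] -/
def PD.ν : PD → ℕ × ℕ → ℕ
  | .dummy c, k => dummyAnchor φ c k.1 + k.2
  | .site r s, k => siteAnchor φ r s k.1 + k.2
  | .k0, k => k0Anchor φ k.1 + k.2
  | .clause t, k => clauseAnchor φ t k.1 + k.2
  | .z, k => 5 * zIdx φ + k.2

/-- Well-formed descriptors (indices in range). [folklore] -/
def PD.WF : PD → Prop
  | .dummy c => c < N φ
  | .site r s => r < N φ ∧ s < N φ
  | .k0 => True
  | .clause t => t < T φ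
  | .z => True

variable {φ}

/-- The numbering of a placement is its descriptor's, key by key. [folklore] -/
theorem PD.pl_ν (pd : PD) (i : ℕ) : (pd.pl φ).ν i = pd.ν φ ((pd.num φ).getD i (0, 0)) := by
  cases pd <;> rfl

/-- Well-formed descriptors are placed. [folklore] -/
theorem PD.pl_mem {pd : PD} (h : pd.WF φ) : pd.pl φ ∈ placements φ := by
  cases pd with
  | dummy c => exact mem_placements.2 (Or.inl ⟨c, h, rfl⟩)
  | site r s => exact mem_placements.2 (Or.inr (Or.inl ⟨r, h.1, s, h.2, rfl⟩))
  | k0 => exact mem_placements.2 (Or.inr (Or.inr (Or.inl rfl)))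
  | clause t => exact mem_placements.2 (Or.inr (Or.inr (Or.inr (Or.inl ⟨t, h, rfl⟩))))
  | z => exact mem_placements.2 (Or.inr (Or.inr (Or.inr (Or.inr rfl))))

/-- Every placement has a well-formed descriptor. [folklore] -/
theorem exists_pd {P : Placement} (hP : P ∈ placements φ) : ∃ pd : PD, pd.WF φ ∧ P = pd.pl φ := by
  rcases mem_placements.1 hP with ⟨c, hc, rfl⟩ | ⟨r, hr, s, hs, rfl⟩ | rfl | ⟨t, ht, rfl⟩ | rfl
  exacts [⟨.dummy c, hc, rfl⟩, ⟨.site r s, ⟨hr, hs⟩, rfl⟩, ⟨.k0, trivial, rfl⟩, ⟨.clause t, ht, rfl⟩, ⟨.z, trivial, rfl⟩]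

/-! ### The home of a global vertex -/

variable (φ)

/-- The home of chain vertex `5 · cell + off`. [folklore] -/
def chainHome (cell off : ℕ) : PD × (ℕ × ℕ) :=
  if cell < 2 * N φ then (.dummy (cell / 2), (0, 5 * (cell % 2) + off))
  else if cell < 2 * N φ + N φ * (2 * N φ + 1) then
    (let r := (cell - 2 * N φ) / (2 * N φ + 1)
     let k := (cell - 2 * N φ) % (2 * N φ + 1)
     if k = 2 * N φ then (.site r (N φ - 1), (0, 10 + off)) else (.site r (k / 2), (0, 5 * (k % 2) + off)))
  else if cell < zIdx φ then
    (if cell = kIdx φ 0 then (.k0, (0, off))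
     else (.clause ((cell - kIdx φ 0 - 1) / 3), (0, 5 * ((cell - kIdx φ 0 - 1) % 3) + off)))
  else (.z, (0, off))

/-- The home of vertex `d` of diamond ladder `t = r N + s`. [folklore] -/
def dlHome (t d : ℕ) : PD × (ℕ × ℕ) :=
  if 4 ≤ d ∧ d < 8 ∧ t % N φ + 1 < N φ then (.site (t / N φ) (t % N φ + 1), (3, d)) else (.site (t / N φ) (t % N φ), (2, d))

/-- The home of vertex `d` of the hop ladders of column/row `q = c N + r`. [folklore] -/
def hopHome (q d : ℕ) : PD × (ℕ × ℕ) :=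
  if d < 4 then
    (if q % N φ = 0 then (.dummy (q / N φ), (3, d)) else (.site (q % N φ - 1) (J φ (q % N φ - 1) (q / N φ)), (5, d)))
  else (.site (q % N φ) (J φ (q % N φ) (q / N φ)), (4, d))

/-- The home of vertex `d` of the set ladder of column `c`. [folklore] -/
def setHome (c d : ℕ) : PD × (ℕ × ℕ) :=
  if (prev? φ c).isSome then
    (if d < 4 ∨ 8 ≤ d then (.site c (J φ c c), (6, d))
     else if J φ c c + 1 < N φ then (.site c (J φ c c + 1), (6, d)) else (.site c (J φ c c), (6, d)))
  else (.dummy c, (4, d))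

/-- The home of vertex `d` of the clause link of column `c`. [folklore] -/
def klinkHome (c d : ℕ) : PD × (ℕ × ℕ) :=
  if d < 4 then (.site (N φ - 1) (J φ (N φ - 1) c), (5, d))
  else if c = 0 then (.k0, (1, d)) else (.clause ((c - 1) / 3), (1, 12 * ((c - 1) % 3) + d))

/-- **The home of a global vertex**: the descriptor of the tile that draws it and its key there. [folklore] -/
def homeOf (v : ℕ) : PD × (ℕ × ℕ) :=
  if v < base1 φ then chainHome φ (v / 5) (v % 5)
  else if v < base1 φ + 24 * (N φ * N φ) then dlHome φ ((v - base1 φ) / 24) ((v - base1 φ) % 24)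
  else if v < clause1Base φ then
    (.dummy ((v - (base1 φ + 24 * (N φ * N φ))) / 3 / 2),
      (2, 3 * ((v - (base1 φ + 24 * (N φ * N φ))) / 3 % 2) + (v - (base1 φ + 24 * (N φ * N φ))) % 3))
  else if v < clause1Base φ + 3 then (.k0, (2, v - clause1Base φ))
  else if v < base2 φ then (.clause ((v - (clause1Base φ + 3)) / 27), (2, (v - (clause1Base φ + 3)) % 27))
  else if v < base2 φ + 60 * (N φ * N φ) then hopHome φ ((v - base2 φ) / 60) ((v - base2 φ) % 60)
  else if v < base2 φ + 60 * (N φ * N φ) + 12 * N φ then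
    setHome φ ((v - (base2 φ + 60 * (N φ * N φ))) / 12) ((v - (base2 φ + 60 * (N φ * N φ))) % 12)
  else klinkHome φ ((v - (base2 φ + 60 * (N φ * N φ) + 12 * N φ)) / 12) ((v - (base2 φ + 60 * (N φ * N φ) + 12 * N φ)) % 12)

/-- **The global position of a vertex**: where its home tile draws its key. [folklore] -/
def gpos (v : ℕ) : GridPoint :=
  ((homeOf φ v).1.pl φ).shift (((homeOf φ v).1.pl φ).T.pos.getD (((homeOf φ v).1.num φ).idxOf (homeOf φ v).2) (0, 0))

variable {φ}

/-! ### Arithmetic of the numbering -/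

/-- Division with remainder. [folklore] -/
theorem divmod {a b n : ℕ} (hb : b < n) : (a * n + b) / n = a ∧ (a * n + b) % n = b :=
  ⟨by rw [Nat.add_comm, Nat.add_mul_div_right _ _ (by omega), Nat.div_eq_of_lt hb, Nat.zero_add],
    by rw [Nat.add_comm, Nat.add_mul_mod_self_right, Nat.mod_eq_of_lt hb]⟩

/-- Division with remainder (constant first). [folklore] -/
theorem divmod' {a b n : ℕ} (hb : b < n) : (n * a + b) / n = a ∧ (n * a + b) % n = b := by
  rw [Nat.mul_comm]; exact divmod hb

/-- `homeOf` on chain vertices. [folklore] -/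
theorem homeOf_chain {cell off : ℕ} (hcell : cell < M φ) (hoff : off < 5) :
    homeOf φ (5 * cell + off) = chainHome φ cell off := by
  have := five_cell_lt_base1 φ hcell
  unfold homeOf
  rw [if_pos (by omega), (divmod' hoff).1, (divmod' hoff).2]

/-- `homeOf` on diamond-ladder vertices. [folklore] -/
theorem homeOf_dl {r s d : ℕ} (hr : r < N φ) (hs : s < N φ) (hd : d < 24) :
    homeOf φ (dlBase φ r s + d) = dlHome φ (r * N φ + s) d := by
  have h1 := dlBase_add_lt_base2 (φ := φ) hr hs
  have hlt : r * N φ + s < N φ * N φ := by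
    calc r * N φ + s < r * N φ + N φ := by omega
      _ = (r + 1) * N φ := by ring
      _ ≤ N φ * N φ := Nat.mul_le_mul_right _ hr
  unfold homeOf
  rw [if_neg (by unfold dlBase; omega), if_pos (by unfold dlBase; omega)]
  unfold dlBase
  rw [show base1 φ + 24 * (r * N φ + s) + d - base1 φ = 24 * (r * N φ + s) + d by omega, (divmod' hd).1, (divmod' hd).2]

/-- `homeOf` on pin vertices. [folklore] -/
theorem homeOf_pin {i d : ℕ} (hi : i < 2 * N φ) (hd : d < 3) :
    homeOf φ (pinBase φ i + d) = (.dummy (i / 2), (2, 3 * (i % 2) + d)) := by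
  unfold homeOf
  rw [if_neg (by unfold pinBase; omega), if_neg (by unfold pinBase; omega), if_pos (by unfold pinBase clause1Base; omega)]
  unfold pinBase
  rw [show base1 φ + 24 * (N φ * N φ) + 3 * i + d - (base1 φ + 24 * (N φ * N φ)) = 3 * i + d by omega,
    (divmod' hd).1, (divmod' hd).2]

/-- `homeOf` on the unit-clause gadget. [folklore] -/
theorem homeOf_cl1 {d : ℕ} (hd : d < 3) : homeOf φ (clause1Base φ + d) = (.k0, (2, d)) := by
  unfold homeOf
  rw [if_neg (by unfold clause1Base; omega), if_neg (by unfold clause1Base; omega), if_neg (by omega), if_pos (by omega),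
    Nat.add_sub_cancel_left]

/-- `homeOf` on three-input OR-gadgets. [folklore] -/
theorem homeOf_or3 {t d : ℕ} (ht : t < T φ) (hd : d < 27) : homeOf φ (or3Base φ t + d) = (.clause t, (2, d)) := by
  unfold homeOf
  rw [if_neg (by unfold or3Base clause1Base; omega), if_neg (by unfold or3Base clause1Base; omega),
    if_neg (by unfold or3Base; omega), if_neg (by unfold or3Base; omega), if_pos (by unfold or3Base base2; omega)]
  unfold or3Base
  rw [show clause1Base φ + 3 + 27 * t + d - (clause1Base φ + 3) = 27 * t + d by omega, (divmod' hd).1, (divmod' hd).2]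

/-- `base2` lies above `clause1Base + 3`. [folklore] -/
theorem clause1Base_le_base2 : clause1Base φ + 3 ≤ base2 φ := by unfold base2; omega

/-- `homeOf` on hop-ladder vertices. [folklore] -/
theorem homeOf_hop {c r d : ℕ} (hc : c < N φ) (hr : r < N φ) (hd : d < 60) :
    homeOf φ (base2 φ + 60 * (c * N φ + r) + d) = hopHome φ (c * N φ + r) d := by
  have hlt : c * N φ + r < N φ * N φ := by
    calc c * N φ + r < c * N φ + N φ := by omega
      _ = (c + 1) * N φ := by ring
      _ ≤ N φ * N φ := Nat.mul_le_mul_right _ hc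
  have := clause1Base_le_base2 (φ := φ)
  unfold homeOf
  rw [if_neg (by unfold base2 clause1Base; omega), if_neg (by unfold base2 clause1Base; omega),
    if_neg (by unfold base2; omega), if_neg (by unfold base2; omega), if_neg (by omega), if_pos (by omega),
    show base2 φ + 60 * (c * N φ + r) + d - base2 φ = 60 * (c * N φ + r) + d by omega, (divmod' hd).1, (divmod' hd).2]

/-- `homeOf` on set-ladder vertices. [folklore] -/
theorem homeOf_set {c d : ℕ} (hc : c < N φ) (hd : d < 12) : homeOf φ (setBase φ c + d) = setHome φ c d := by
  have := clause1Base_le_base2 (φ := φ)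
  unfold homeOf
  rw [if_neg (by unfold setBase base2 clause1Base; omega), if_neg (by unfold setBase base2 clause1Base; omega),
    if_neg (by unfold setBase base2; omega), if_neg (by unfold setBase base2; omega), if_neg (by unfold setBase; omega),
    if_neg (by unfold setBase; omega), if_pos (by unfold setBase; omega)]
  unfold setBase
  rw [show base2 φ + 60 * (N φ * N φ) + 12 * c + d - (base2 φ + 60 * (N φ * N φ)) = 12 * c + d by omega,
    (divmod' hd).1, (divmod' hd).2]

/-- `homeOf` on clause-link vertices. [folklore] -/
theorem homeOf_klink {c d : ℕ} (hd : d < 12) : homeOf φ (klinkBase φ c + d) = klinkHome φ c d := by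
  have := clause1Base_le_base2 (φ := φ)
  unfold homeOf
  rw [if_neg (by unfold klinkBase base2 clause1Base; omega), if_neg (by unfold klinkBase base2 clause1Base; omega),
    if_neg (by unfold klinkBase base2; omega), if_neg (by unfold klinkBase base2; omega), if_neg (by unfold klinkBase; omega),
    if_neg (by unfold klinkBase; omega), if_neg (by unfold klinkBase; omega)]
  unfold klinkBase
  rw [show base2 φ + 60 * (N φ * N φ) + 12 * N φ + 12 * c + d - (base2 φ + 60 * (N φ * N φ) + 12 * N φ) = 12 * c + d by omega,
    (divmod' hd).1, (divmod' hd).2]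

/-- `chainHome` on the cells of a row. [folklore] -/
theorem chainHome_row {r k off : ℕ} (hr : r < N φ) (hk : k ≤ 2 * N φ) :
    chainHome φ (rowCell φ r k) off =
      if k = 2 * N φ then (.site r (N φ - 1), (0, 10 + off)) else (.site r (k / 2), (0, 5 * (k % 2) + off)) := by
  have hlt : r * (2 * N φ + 1) + k < N φ * (2 * N φ + 1) := by
    calc r * (2 * N φ + 1) + k < r * (2 * N φ + 1) + (2 * N φ + 1) := by omega
      _ = (r + 1) * (2 * N φ + 1) := by ring
      _ ≤ N φ * (2 * N φ + 1) := Nat.mul_le_mul_right _ hr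
  unfold chainHome rowCell rowStart
  rw [if_neg (by omega), if_pos (by omega)]
  simp only [show 2 * N φ + r * (2 * N φ + 1) + k - 2 * N φ = r * (2 * N φ + 1) + k by omega,
    (divmod (show k < 2 * N φ + 1 by omega)).1, (divmod (show k < 2 * N φ + 1 by omega)).2]

/-- `chainHome` on dummy cells. [folklore] -/
theorem chainHome_dummy {i off : ℕ} (hi : i < 2 * N φ) : chainHome φ i off = (.dummy (i / 2), (0, 5 * (i % 2) + off)) := by
  unfold chainHome; rw [if_pos hi]

/-- `chainHome` on clause cells. [folklore] -/
theorem chainHome_k {c off : ℕ} (hc : c < N φ) :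
    chainHome φ (kIdx φ c) off = if c = 0 then (.k0, (0, off)) else (.clause ((c - 1) / 3), (0, 5 * ((c - 1) % 3) + off)) := by
  unfold chainHome
  rw [if_neg (by unfold kIdx; omega), if_neg (by unfold kIdx; omega), if_pos (by unfold kIdx zIdx; omega)]
  by_cases h0 : c = 0
  · subst h0; rw [if_pos rfl, if_pos rfl]
  · rw [if_neg (by unfold kIdx; omega), if_neg h0]
    unfold kIdx
    simp only [show 2 * N φ + N φ * (2 * N φ + 1) + c - (2 * N φ + N φ * (2 * N φ + 1) + 0) - 1 = c - 1 by omega]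

/-- `chainHome` on the end cell. [folklore] -/
theorem chainHome_z {off : ℕ} : chainHome φ (zIdx φ) off = (.z, (0, off)) := by
  unfold chainHome
  rw [if_neg (by unfold zIdx; omega), if_neg (by unfold zIdx; omega), if_neg (lt_irrefl _)]

/-! ### Home keys decode to their tile -/

variable (φ)

/-- The home keys of a descriptor's tile. [folklore] -/
def PD.home : PD → List (ℕ × ℕ)
  | .dummy c => dummyHome (prev? φ c).isNone
  | .site r s => siteHome (sF1 s) (sF2 φ s) (sF4 φ r s) (sF5 φ r s)
  | .k0 => k0Home
  | .clause _ => clauseHome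
  | .z => (List.range 5).map fun d => (0, d)

/-- The away keys of a descriptor's tile (at home in a neighbour). [folklore] -/
def PD.away : PD → List (ℕ × ℕ)
  | .dummy c => dummyAway (decide (c + 1 = N φ))
  | .site r s => siteAway (sF1 s) (sF2 φ s) (sF5 φ r s)
  | .k0 => [(0, 5)]
  | .clause _ => [(0, 15)]
  | .z => []

variable {φ}

section decode

/-- Consecutive cells: `5 · cell + (5 + d) = 5 · (cell + 1) + d`. [folklore] -/
theorem five_succ (cell d : ℕ) : 5 * cell + (5 + d) = 5 * (cell + 1) + d := by ring

/-- Home keys of a site decode to the site. [folklore] -/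
theorem homeOf_site {r s : ℕ} (hr : r < N φ) (hs : s < N φ) {k : ℕ × ℕ} (hk : k ∈ (PD.site r s).home φ) :
    homeOf φ ((PD.site r s).ν φ k) = (.site r s, k) := by
  have hJ := J_lt (r := r) hs
  have hM0 : rowCell φ r (2 * s) < M φ := rowCell_lt_M hr (by omega)
  have hM1 : rowCell φ r (2 * s + 1) < M φ := rowCell_lt_M hr (by omega)
  simp only [PD.home, siteHome, List.mem_append, List.mem_map, List.mem_range, List.mem_filter, List.mem_ite_nil_left,
    List.mem_ite_nil_right, decide_eq_true_eq, Bool.or_eq_true, Bool.and_eq_true] at hk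
  simp only [PD.ν]
  rcases hk with (((((((⟨d, hd, rfl⟩ | ⟨hl, d, hd, rfl⟩) | ⟨d, ⟨hd, hd'⟩, rfl⟩) | ⟨hl, d, hd, rfl⟩) | ⟨hf, d, hd, rfl⟩) |
    ⟨d, ⟨hd, hd'⟩, rfl⟩) | ⟨d, hd, rfl⟩) | ⟨hs0, d, ⟨hd, hd'⟩, rfl⟩) | ⟨hs1, d, hd, rfl⟩
  · -- `(0, d)`, `d < 10`: the cells `Bl_s`, `W_s`
    simp only [siteAnchor]
    by_cases h5 : d < 5
    · unfold blIdx
      rw [homeOf_chain hM0 h5, chainHome_row hr (by omega), if_neg (by omega),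
        show 2 * s / 2 = s by omega, show 2 * s % 2 = 0 by omega, Nat.mul_zero, Nat.zero_add]
    · obtain ⟨d', rfl⟩ : ∃ d', d = 5 + d' := ⟨d - 5, by omega⟩
      unfold blIdx
      rw [five_succ, show rowCell φ r (2 * s) + 1 = rowCell φ r (2 * s + 1) by unfold rowCell; omega,
        homeOf_chain hM1 (by omega), chainHome_row hr (by omega), if_neg (by omega),
        show (2 * s + 1) / 2 = s by omega, show (2 * s + 1) % 2 = 1 by omega, Nat.mul_one]
  · -- `(0, 10 + d)`, last: `Bl_N`
    simp only [sF2, decide_eq_true_eq] at hl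
    simp only [siteAnchor]
    unfold blIdx
    rw [show 5 * rowCell φ r (2 * s) + (10 + d) = 5 * rowCell φ r (2 * N φ) + d by unfold rowCell; omega,
      homeOf_chain (rowCell_lt_M hr le_rfl) hd, chainHome_row hr le_rfl, if_pos rfl, show N φ - 1 = s by omega]
  · -- `(2, d)`, own diamond ladder
    simp only [siteAnchor]
    rw [homeOf_dl hr hs hd]
    unfold dlHome
    rw [if_neg (by omega), (divmod hs).1, (divmod hs).2]
  · simp only [sF2, decide_eq_true_eq] at hl
    simp only [siteAnchor]
    rw [homeOf_dl hr hs (by omega)]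
    unfold dlHome
    rw [(divmod hs).1, (divmod hs).2, if_neg (by omega)]
  · -- `(3, 4 + d)`: the second rail of the previous ladder
    simp only [sF1, decide_eq_true_eq] at hf
    simp only [siteAnchor]
    rw [homeOf_dl hr (show s - 1 < N φ by omega) (by omega)]
    unfold dlHome
    rw [(divmod (show s - 1 < N φ by omega)).1, (divmod (show s - 1 < N φ by omega)).2, if_pos (by omega),
      show s - 1 + 1 = s by omega]
  · -- `(4, d)`: hop ladders through the site
    simp only [siteAnchor]
    rw [homeOf_hop hJ hr hd]
    unfold hopHome
    rw [if_neg (by omega), (divmod hr).1, (divmod hr).2, J_J hs]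
  · -- `(5, d)`, `d < 4`: first rail of the exit ladder
    simp only [siteAnchor]
    split_ifs with h1
    · rw [homeOf_hop hJ h1 (by omega)]
      unfold hopHome
      rw [if_pos hd, (divmod h1).1, (divmod h1).2, if_neg (by omega), Nat.add_sub_cancel, J_J hs]
    · rw [show base2 φ + 12 * (5 * (N φ * N φ) + N φ + J φ r s) + d = klinkBase φ (J φ r s) + d by unfold klinkBase; ring,
        homeOf_klink (by omega)]
      unfold klinkHome
      rw [if_pos hd, show N φ - 1 = r by omega, J_J hs]
  · -- `(6, d)`: first rail and rungs of the set ladder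
    simp only [sF4, Bool.and_eq_true, decide_eq_true_eq] at hs0
    simp only [siteAnchor]
    rw [homeOf_set hr hd]
    unfold setHome
    rw [if_pos hs0.2, if_pos (by omega), ← hs0.1]
  · -- `(6, 4 + d)`: second rail of the set ladder
    simp only [sF4, sF5, sF2, Bool.and_eq_true, decide_eq_true_eq] at hs1
    simp only [siteAnchor]
    rw [homeOf_set hr (by omega)]
    unfold setHome
    rcases hs1 with ⟨⟨h1, h2⟩, hp⟩ | ⟨⟨h1, hp⟩, h2⟩
    · rw [if_pos hp, if_neg (by omega), if_pos (by omega), show J φ r r + 1 = s by omega]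
    · rw [if_pos hp, if_neg (by omega), if_neg (by omega), ← h1]

/-- Home keys of a dummy pair decode to it. [folklore] -/
theorem homeOf_dummy {c : ℕ} (hc : c < N φ) {k : ℕ × ℕ} (hk : k ∈ (PD.dummy c).home φ) :
    homeOf φ ((PD.dummy c).ν φ k) = (.dummy c, k) := by
  simp only [PD.home, dummyHome, List.mem_append, List.mem_map, List.mem_range, List.mem_ite_nil_right] at hk
  simp only [PD.ν]
  have hM : dIdx c < M φ := dIdx_lt_M hc
  have hM' : 2 * c + 1 < M φ := by unfold M; omega
  unfold dIdx at hM
  rcases hk with ((⟨d, hd, rfl⟩ | ⟨d, hd, rfl⟩) | ⟨d, hd, rfl⟩) | ⟨hv, d, hd, rfl⟩ <;> simp only [dummyAnchor]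
  · by_cases h5 : d < 5
    · rw [homeOf_chain hM h5, chainHome_dummy (by omega), show 2 * c / 2 = c by omega, show 2 * c % 2 = 0 by omega,
        Nat.mul_zero, Nat.zero_add]
    · obtain ⟨d', rfl⟩ : ∃ d', d = 5 + d' := ⟨d - 5, by omega⟩
      rw [five_succ, homeOf_chain hM' (by omega), chainHome_dummy (by omega), show (2 * c + 1) / 2 = c by omega,
        show (2 * c + 1) % 2 = 1 by omega, Nat.mul_one]
  · by_cases h3 : d < 3
    · rw [homeOf_pin (by omega) h3, show 2 * c / 2 = c by omega, show 2 * c % 2 = 0 by omega, Nat.mul_zero, Nat.zero_add]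
    · rw [show pinBase φ (2 * c) + d = pinBase φ (2 * c + 1) + (d - 3) by unfold pinBase; omega, homeOf_pin (by omega) (by omega),
        show (2 * c + 1) / 2 = c by omega, show (2 * c + 1) % 2 = 1 by omega, show 3 * 1 + (d - 3) = d by omega]
  · rw [show base2 φ + 60 * (c * N φ) + d = base2 φ + 60 * (c * N φ + 0) + d by rfl, homeOf_hop hc (by omega) (by omega)]
    unfold hopHome
    rw [if_pos hd, (divmod (show 0 < N φ by omega)).1, (divmod (show 0 < N φ by omega)).2, if_pos rfl]
  · rw [homeOf_set hc hd]
    unfold setHome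
    rw [if_neg (by simpa using hv)]

/-- Home keys of the tile of `K_0` decode to it. [folklore] -/
theorem homeOf_k0 (hN : 0 < N φ) {k : ℕ × ℕ} (hk : k ∈ PD.k0.home φ) : homeOf φ (PD.k0.ν φ k) = (.k0, k) := by
  simp only [PD.home, k0Home, List.mem_append, List.mem_map, List.mem_range] at hk
  simp only [PD.ν]
  rcases hk with (⟨d, hd, rfl⟩ | ⟨d, hd, rfl⟩) | ⟨d, hd, rfl⟩ <;> simp only [k0Anchor]
  · rw [homeOf_chain (kIdx_lt_M hN) hd, chainHome_k hN, if_pos rfl]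
  · rw [homeOf_klink (by omega)]
    unfold klinkHome
    rw [if_neg (by omega), if_pos rfl]
  · exact homeOf_cl1 hd

/-- Home keys of a clause tile decode to it (the clause row has `3 T + 1 = N` cells). [folklore] -/
theorem homeOf_clause (hN3 : N φ = 3 * T φ + 1) {t : ℕ} (ht : t < T φ) {k : ℕ × ℕ} (hk : k ∈ (PD.clause t).home φ) :
    homeOf φ ((PD.clause t).ν φ k) = (.clause t, k) := by
  simp only [PD.home, clauseHome, List.mem_append, List.mem_map, List.mem_range, List.mem_filter, decide_eq_true_eq] at hk
  simp only [PD.ν]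
  rcases hk with (⟨d, hd, rfl⟩ | ⟨d, ⟨hd, hd'⟩, rfl⟩) | ⟨d, hd, rfl⟩ <;> simp only [clauseAnchor]
  · have hc : 3 * t + 1 + d / 5 < N φ := by omega
    rw [show 5 * kIdx φ (3 * t + 1) + d = 5 * kIdx φ (3 * t + 1 + d / 5) + d % 5 by unfold kIdx; omega,
      homeOf_chain (kIdx_lt_M hc) (Nat.mod_lt _ (by omega)), chainHome_k hc, if_neg (by omega),
      show (3 * t + 1 + d / 5 - 1) / 3 = t by omega, show (3 * t + 1 + d / 5 - 1) % 3 = d / 5 by omega, Nat.div_add_mod]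
  · rw [show klinkBase φ (3 * t + 1) + d = klinkBase φ (3 * t + 1 + d / 12) + d % 12 by unfold klinkBase; omega,
      homeOf_klink (Nat.mod_lt _ (by omega))]
    unfold klinkHome
    rw [if_neg (by omega), if_neg (by omega), show (3 * t + 1 + d / 12 - 1) / 3 = t by omega,
      show (3 * t + 1 + d / 12 - 1) % 3 = d / 12 by omega, Nat.div_add_mod]
  · exact homeOf_or3 ht hd

/-- Keys of the end tile decode to it. [folklore] -/
theorem homeOf_z {k : ℕ × ℕ} (hk : k ∈ PD.z.home φ) : homeOf φ (PD.z.ν φ k) = (.z, k) := by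
  simp only [PD.home, List.mem_map, List.mem_range] at hk
  obtain ⟨d, hd, rfl⟩ := hk
  simp only [PD.ν]
  rw [homeOf_chain zIdx_lt hd, chainHome_z]

/-- **Home keys decode to their tile.** [folklore] -/
theorem homeOf_home (hN3 : N φ = 3 * T φ + 1) {pd : PD} (hwf : pd.WF φ) {k : ℕ × ℕ} (hk : k ∈ pd.home φ) :
    homeOf φ (pd.ν φ k) = (pd, k) := by
  cases pd with
  | dummy c => exact homeOf_dummy hwf hk
  | site r s => exact homeOf_site hwf.1 hwf.2 hk
  | k0 => exact homeOf_k0 (by omega) hk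
  | clause t => exact homeOf_clause hN3 hwf hk
  | z => exact homeOf_z hk

end decode

/-! ### Meeting tiles: shared vertices through ports -/

section meet

variable {P Q : Placement}

/-- **What two meeting tiles must satisfy**: coinciding vertex positions are the same global vertex,
and a vertex of one inside the other's box is a vertex of the other. [folklore] -/
def MeetOK (P Q : Placement) : Prop :=
  (∀ i (hi : i < P.T.nv) j (hj : j < Q.T.nv), P.shift P.T.pos[i] = Q.shift Q.T.pos[j] → P.ν i = Q.ν j) ∧
  (∀ j (hj : j < Q.T.nv), P.Box (Q.shift Q.T.pos[j]) → ∃ i, ∃ hi : i < P.T.nv, P.shift P.T.pos[i] = Q.shift Q.T.pos[j]) ∧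
  (∀ i (hi : i < P.T.nv), Q.Box (P.shift P.T.pos[i]) → ∃ j, ∃ hj : j < Q.T.nv, Q.shift Q.T.pos[j] = P.shift P.T.pos[i])

/-- `MeetOK` is symmetric. [folklore] -/
theorem MeetOK.symm (h : MeetOK P Q) : MeetOK Q P :=
  ⟨fun j hj i hi e => (h.1 i hi j hj e.symm).symm, h.2.2, h.2.1⟩

/-- Membership in a boundary inventory. [folklore] -/
theorem mem_bdryInv {T : Tile} {num : List (ℕ × ℕ)} {e : (ℕ × ℕ) × GridPoint} :
    e ∈ bdryInv T num ↔ ∃ i < T.nv, T.OnBdry (T.pos.getD i (0, 0)) ∧ e = (num.getD i (0, 0), T.pos.getD i (0, 0)) := by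
  unfold bdryInv
  simp only [List.mem_map, List.mem_filter, List.mem_range, decide_eq_true_eq]
  constructor
  · rintro ⟨i, ⟨hi, hb⟩, rfl⟩; exact ⟨i, hi, hb, rfl⟩
  · rintro ⟨i, hi, hb, rfl⟩; exact ⟨i, ⟨hi, hb⟩, rfl⟩

/-- The Boolean port condition, unfolded. [folklore] -/
theorem portOK_spec {ps : List Port} {TP TQ : List ((ℕ × ℕ) × GridPoint)} {faceP faceQ : GridPoint → Bool} {shift : GridPoint → GridPoint}
    {homeP awayP homeQ awayQ : List (ℕ × ℕ)} (h : portOK ps TP TQ faceP faceQ shift homeP awayP homeQ awayQ = true) :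
    (∀ e ∈ TP, faceP e.2 = true → ∃ π ∈ ps, e = (π.1, π.2.2.1)) ∧
    (∀ e ∈ TQ, faceQ e.2 = true → ∃ π ∈ ps, e = (π.2.1, π.2.2.2)) ∧
    (∀ π ∈ ps, (π.1, π.2.2.1) ∈ TP ∧ (π.2.1, π.2.2.2) ∈ TQ ∧ π.2.2.2 = shift π.2.2.1 ∧
      ((π.1 ∈ homeP ∧ π.2.1 ∈ awayQ) ∨ (π.1 ∈ awayP ∧ π.2.1 ∈ homeQ))) ∧
    (∀ π ∈ ps, ∀ π' ∈ ps, π.2.2.1 = π'.2.2.1 → π = π') := by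
  unfold portOK at h
  simp only [Bool.and_eq_true, List.all_eq_true, Bool.or_eq_true, Bool.not_eq_true', List.any_eq_true, beq_iff_eq,
    Bool.eq_false_iff, ne_eq] at h
  obtain ⟨⟨⟨h1, h2⟩, h3⟩, h4⟩ := h
  refine ⟨fun e he hf => ?_, fun e he hf => ?_, fun π hπ => ?_, fun π hπ π' hπ' hp => ?_⟩
  · rcases h1 e he with h | ⟨π, hπ, h⟩
    · exact absurd hf h
    · exact ⟨π, hπ, h⟩
  · rcases h2 e he with h | ⟨π, hπ, h⟩
    · exact absurd hf h
    · exact ⟨π, hπ, h⟩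
  · obtain ⟨⟨⟨⟨x, hx, rfl⟩, ⟨y, hy, rfl⟩⟩, hs⟩, hh⟩ := h3 π hπ
    refine ⟨hx, hy, hs, ?_⟩
    rcases hh with ⟨⟨a, ha, rfl⟩, ⟨b, hb, rfl⟩⟩ | ⟨⟨a, ha, rfl⟩, ⟨b, hb, rfl⟩⟩
    · exact Or.inl ⟨ha, hb⟩
    · exact Or.inr ⟨ha, hb⟩
  · rcases h4 π hπ π' hπ' with h | h
    · exact absurd hp h
    · exact h

/-- **Meeting through ports.** Two valid tiles whose boxes meet along boundaries, whose boundary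
inventories are given tables, and whose facing entries are matched by a correct port list with equal
global numbers, meet correctly. [folklore] -/
theorem meet_of_ports (ps : List Port) {numP numQ : List (ℕ × ℕ)} {TP TQ : List ((ℕ × ℕ) × GridPoint)}
    {faceP faceQ : GridPoint → Bool} {shift : GridPoint → GridPoint} {homeP awayP homeQ awayQ : List (ℕ × ℕ)}
    {νP νQ : ℕ × ℕ → ℕ}
    (hok : portOK ps TP TQ faceP faceQ shift homeP awayP homeQ awayQ = true)
    (hνP : ∀ i, P.ν i = νP (numP.getD i (0, 0))) (hνQ : ∀ j, Q.ν j = νQ (numQ.getD j (0, 0)))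
    (bdP : ∀ e ∈ bdryInv P.T numP, e ∈ TP) (bdP' : ∀ e ∈ TP, e ∈ bdryInv P.T numP)
    (bdQ : ∀ e ∈ bdryInv Q.T numQ, e ∈ TQ) (bdQ' : ∀ e ∈ TQ, e ∈ bdryInv Q.T numQ)
    (vP : P.T.Valid) (vQ : Q.T.Valid)
    (hbd : ∀ q, P.Box q → Q.Box q → P.Bdry q ∧ Q.Bdry q)
    (hfP : ∀ p, P.T.InBox p → P.T.OnBdry p → Q.Box (P.shift p) → faceP p = true)
    (hfQ : ∀ p, Q.T.InBox p → Q.T.OnBdry p → P.Box (Q.shift p) → faceQ p = true)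
    (hport : ∀ π ∈ ps, νP π.1 = νQ π.2.1 ∧ P.shift π.2.2.1 = Q.shift π.2.2.2) :
    MeetOK P Q := by
  obtain ⟨s1, s2, s3, s4⟩ := portOK_spec hok
  have gdP : ∀ i (hi : i < P.T.nv), P.T.pos.getD i (0, 0) = P.T.pos[i] := fun i hi => List.getD_eq_getElem _ _ hi
  have gdQ : ∀ j (hj : j < Q.T.nv), Q.T.pos.getD j (0, 0) = Q.T.pos[j] := fun j hj => List.getD_eq_getElem _ _ hj
  -- a vertex of `P` at a point of `Q`'s box is a port
  have keyP : ∀ i (hi : i < P.T.nv), Q.Box (P.shift P.T.pos[i]) →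
      ∃ π ∈ ps, numP.getD i (0, 0) = π.1 ∧ P.T.pos[i] = π.2.2.1 := by
    intro i hi hq
    have hin := (vP.1 _ (List.getElem_mem hi)).1
    have hb : P.T.OnBdry P.T.pos[i] := P.bdry_shift.1 (hbd _ (P.box_shift.2 hin) hq).1
    have hmem : (numP.getD i (0, 0), P.T.pos[i]) ∈ TP :=
      bdP _ (mem_bdryInv.2 ⟨i, hi, by rw [gdP i hi]; exact hb, by rw [gdP i hi]⟩)
    obtain ⟨π, hπ, he⟩ := s1 _ hmem (hfP _ hin hb hq)
    simp only [Prod.mk.injEq] at he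
    exact ⟨π, hπ, he.1, he.2⟩
  have keyQ : ∀ j (hj : j < Q.T.nv), P.Box (Q.shift Q.T.pos[j]) →
      ∃ π ∈ ps, numQ.getD j (0, 0) = π.2.1 ∧ Q.T.pos[j] = π.2.2.2 := by
    intro j hj hq
    have hin := (vQ.1 _ (List.getElem_mem hj)).1
    have hb : Q.T.OnBdry Q.T.pos[j] := Q.bdry_shift.1 (hbd _ hq (Q.box_shift.2 hin)).2
    have hmem : (numQ.getD j (0, 0), Q.T.pos[j]) ∈ TQ :=
      bdQ _ (mem_bdryInv.2 ⟨j, hj, by rw [gdQ j hj]; exact hb, by rw [gdQ j hj]⟩)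
    obtain ⟨π, hπ, he⟩ := s2 _ hmem (hfQ _ hin hb hq)
    simp only [Prod.mk.injEq] at he
    exact ⟨π, hπ, he.1, he.2⟩
  refine ⟨fun i hi j hj heq => ?_, fun j hj hq => ?_, fun i hi hq => ?_⟩
  · obtain ⟨π, hπ, hk, hp⟩ := keyP i hi (by rw [heq]; exact Q.box_shift.2 (vQ.1 _ (List.getElem_mem hj)).1)
    obtain ⟨π', hπ', hk', hp'⟩ := keyQ j hj (by rw [← heq]; exact P.box_shift.2 (vP.1 _ (List.getElem_mem hi)).1)
    have : π.2.2.1 = π'.2.2.1 := by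
      apply P.shift_injective
      rw [← hp, heq, hp', ← (hport π' hπ').2]
    have hππ := s4 π hπ π' hπ' this
    rw [hνP, hνQ, hk, hk', hππ]
    exact (hport π' hπ').1
  · obtain ⟨π, hπ, hk, hp⟩ := keyQ j hj hq
    obtain ⟨hTP, -, -, -⟩ := s3 π hπ
    obtain ⟨i, hi, -, he⟩ := mem_bdryInv.1 (bdP' _ hTP)
    simp only [Prod.mk.injEq] at he
    refine ⟨i, hi, ?_⟩
    rw [← gdP i hi, ← he.2, (hport π hπ).2, hp]
  · obtain ⟨π, hπ, hk, hp⟩ := keyP i hi hq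
    obtain ⟨-, hTQ, -, -⟩ := s3 π hπ
    obtain ⟨j, hj, -, he⟩ := mem_bdryInv.1 (bdQ' _ hTQ)
    simp only [Prod.mk.injEq] at he
    refine ⟨j, hj, ?_⟩
    rw [← gdQ j hj, ← he.2, ← (hport π hπ).2, hp]

end meet

/-! ### The ten ways placed tiles meet -/

section instances

/-- Flags of consecutive sites: the second is not first, the first is not last, and the second
carries the second set rail iff the first carries the first. [folklore] -/
theorem flags_succ {r s : ℕ} (hs : s + 1 < N φ) :
    sF1 (s + 1) = false ∧ sF2 φ s = false ∧ sF5 φ r (s + 1) = sF4 φ r s := by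
  refine ⟨by simp [sF1], by simp [sF2]; omega, ?_⟩
  unfold sF5 sF4
  rw [show decide (1 ≤ s + 1 ∧ s + 1 - 1 = J φ r r) = decide (s = J φ r r) from decide_eq_decide.2 (by omega)]

/-- Numbering of a site's keys through `PD.ν`. [folklore] -/
theorem sitePl_ν (r s i : ℕ) : (sitePl φ r s).ν i = (PD.site r s).ν φ ((sNum φ r s).getD i (0, 0)) := rfl

/-- Numbering of a dummy pair's keys through `PD.ν`. [folklore] -/
theorem dummyPl_ν (c i : ℕ) : (dummyPl φ c).ν i = (PD.dummy c).ν φ ((dNum φ c).getD i (0, 0)) := rfl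

/-- Numbering of the keys of the tile of `K_0` through `PD.ν`. [folklore] -/
theorem k0Pl_ν (i : ℕ) : (k0Pl φ).ν i = PD.k0.ν φ ((k0Num (FormulaCells.polOf φ 0)).getD i (0, 0)) := rfl

/-- Numbering of a clause tile's keys through `PD.ν`. [folklore] -/
theorem clausePl_ν (t i : ℕ) :
    (clausePl φ t).ν i = (PD.clause t).ν φ ((clauseNum (cPols φ t).1 (cPols φ t).2.1 (cPols φ t).2.2).getD i (0, 0)) := rfl

/-- Numbering of the end tile's keys through `PD.ν`. [folklore] -/
theorem zPl_ν (i : ℕ) : (zPl φ).ν i = PD.z.ν φ (zNum.getD i (0, 0)) := rfl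

/-- The flags of an actual site are admissible. [folklore] -/
theorem siteOK_flags {r s : ℕ} (hr : r < N φ) : siteOK (sF1 s) (sF2 φ s) (sF3 φ r s) (sF4 φ r s) (sF5 φ r s) = true := by
  have n45 : ¬(sF4 φ r s = true ∧ sF5 φ r s = true) := by
    simp only [sF4, sF5, Bool.and_eq_true, decide_eq_true_eq]; omega
  have i43 : sF4 φ r s = true → sF3 φ r s = true := by
    simp only [sF4, sF3, Bool.and_eq_true, decide_eq_true_eq]
    rintro ⟨h, -⟩; rw [h, J_J hr]; exact Or.inl rfl
  have i51 : sF5 φ r s = true → sF1 s = false := by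
    simp only [sF5, sF1, Bool.and_eq_true, decide_eq_true_eq, decide_eq_false_iff_not]; omega
  unfold siteOK
  cases h4 : sF4 φ r s <;> cases h5 : sF5 φ r s <;> cases h1 : sF1 s <;> cases h3 : sF3 φ r s <;> simp_all

/-- Boundary inventory of a placed site. [folklore] -/
theorem site_bd {r s : ℕ} (hr : r < N φ) :
    (∀ e ∈ bdryInv (sitePl φ r s).T (sNum φ r s), e ∈ siteBdry (sF1 s) (sF2 φ s) (sF3 φ r s) (sF4 φ r s) (sF5 φ r s) (sMir r)) ∧
      ∀ e ∈ siteBdry (sF1 s) (sF2 φ s) (sF3 φ r s) (sF4 φ r s) (sF5 φ r s) (sMir r), e ∈ bdryInv (sitePl φ r s).T (sNum φ r s) :=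
  site_bdry _ _ _ _ _ _ (siteOK_flags hr)

/-- The boundary inventory of a placed dummy pair, with the tile folded (so that rewriting the
expected flags does not touch the tile). [folklore] -/
theorem dummy_bd (c : ℕ) :
    (∀ e ∈ bdryInv (dummyPl φ c).T (dNum φ c), e ∈ dummyBdry (decide (c = 0)) (decide (c + 1 = N φ))) ∧
      ∀ e ∈ dummyBdry (decide (c = 0)) (decide (c + 1 = N φ)), e ∈ bdryInv (dummyPl φ c).T (dNum φ c) :=
  dummy_bdry _ _ _

/-- Columns of consecutive sites of a row. [folklore] -/
theorem J_succ {r s : ℕ} (hs : s + 1 < N φ) :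
    (sMir r = false → (J φ r (s + 1) : ℤ) = J φ r s + 1) ∧ (sMir r = true → (J φ r (s + 1) : ℤ) = J φ r s - 1) := by
  constructor <;> intro h
  · have h2 : r % 2 = 1 := by simpa [sMir] using h
    unfold J; rw [if_pos h2, if_pos h2]; push_cast; ring
  · have h2 : ¬ r % 2 = 1 := by simp [sMir] at h; omega
    unfold J; rw [if_neg h2, if_neg h2]; omega

/-- **The ports between a site and the next site of its row**: same global vertex, same point. [folklore] -/
theorem port_hs {r s : ℕ} (hs : s + 1 < N φ) : ∀ π ∈ hsPorts (sF4 φ r s) (sMir r),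
    (PD.site r s).ν φ π.1 = (PD.site r (s + 1)).ν φ π.2.1 ∧ (sitePl φ r s).shift π.2.2.1 = (sitePl φ r (s + 1)).shift π.2.2.2 := by
  obtain ⟨hJ0, hJ1⟩ := J_succ (φ := φ) (r := r) hs
  have hpos : ∀ p : GridPoint, (sitePl φ r s).shift (mx (sMir r) p) = (sitePl φ r (s + 1)).shift (mx (sMir r) (p.1 - 56, p.2)) := by
    intro p
    cases hmr : sMir r
    · have := hJ0 hmr
      simp only [Placement.shift, o_site, mx, Bool.false_eq_true, if_false, Prod.mk.injEq, and_true]; push_cast; omega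
    · have := hJ1 hmr
      simp only [Placement.shift, o_site, mx, if_true, Prod.mk.injEq, and_true]; push_cast; omega
  intro π hπ
  unfold hsPorts at hπ
  rw [List.mem_map] at hπ
  obtain ⟨e, he, rfl⟩ := hπ
  refine ⟨?_, hpos _⟩
  simp only [List.mem_append, List.mem_cons, List.mem_map, List.mem_range, List.mem_ite_nil_right] at he
  simp only [PD.ν]
  rcases he with (rfl | ⟨k, -, rfl⟩) | ⟨-, i, -, rfl⟩ <;> simp only [siteAnchor]
  · unfold blIdx rowCell; omega
  · rw [Nat.add_sub_cancel]

/-- **A site and the next site of its row meet correctly.** [folklore] -/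
theorem meet_hs (hN : 0 < N φ) {r s : ℕ} (hr : r < N φ) (hs : s + 1 < N φ) : MeetOK (sitePl φ r s) (sitePl φ r (s + 1)) := by
  obtain ⟨hf', hl, h51⟩ := flags_succ (φ := φ) (r := r) hs
  have hs' : s < N φ := by omega
  obtain ⟨bdP, bdP'⟩ := site_bd (φ := φ) (s := s) hr
  obtain ⟨bdQ, bdQ'⟩ := site_bd (φ := φ) (s := s + 1) hr
  rw [hl] at bdP bdP'
  rw [hf', h51] at bdQ bdQ'
  obtain ⟨hw, hh, hm⟩ := dims_site (φ := φ) r s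
  obtain ⟨hw', hh', hm'⟩ := dims_site (φ := φ) r (s + 1)
  have hPm : sitePl φ r s ∈ placements φ := mem_placements.2 (Or.inr (Or.inl ⟨r, hr, s, hs', rfl⟩))
  have hQm : sitePl φ r (s + 1) ∈ placements φ := mem_placements.2 (Or.inr (Or.inl ⟨r, hr, s + 1, hs, rfl⟩))
  have hne : sitePl φ r s ≠ sitePl φ r (s + 1) := fun h => by
    have := congrArg (fun P => P.o.1) h
    simp only [o_site] at this
    have := J_inj hs' hs (by omega : J φ r s = J φ r (s + 1)); omega
  -- the origins differ by one strip, to the right or (mirrored rows) to the left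
  obtain ⟨hJ0, hJ1⟩ := J_succ (φ := φ) (r := r) hs
  refine meet_of_ports (hsPorts (sF4 φ r s) (sMir r))
    (hs_ports (sF1 s) (sF3 φ r s) (sF4 φ r s) (sF5 φ r s) (sF2 φ (s + 1)) (sF3 φ r (s + 1)) (sF4 φ r (s + 1)) (sMir r))
    (sitePl_ν r s) (sitePl_ν r (s + 1))
    bdP bdP' bdQ bdQ' (valid_of_mem hPm) (valid_of_mem hQm)
    (fun q h1 h2 => (boxes_placements hN hPm hQm hne q h1 h2).1)
    (fun p hin hb hq => ?_) (fun p hin hb hq => ?_) (port_hs hs)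
  · unfold Placement.Box Tile.InBox at hq
    unfold Tile.InBox at hin
    simp only [Placement.shift, o_site, hw, hw'] at hq hin
    cases hmr : sMir r
    · have := hJ0 hmr
      simp only [Bool.false_eq_true, if_false, beq_iff_eq]; push_cast at hq hin ⊢; omega
    · have := hJ1 hmr
      simp only [if_true, beq_iff_eq]; push_cast at hq hin ⊢; omega
  · unfold Placement.Box Tile.InBox at hq
    unfold Tile.InBox at hin
    simp only [Placement.shift, o_site, hw, hw'] at hq hin
    cases hmr : sMir r
    · have := hJ0 hmr
      simp only [Bool.false_eq_true, if_false, beq_iff_eq]; push_cast at hq hin ⊢; omega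
    · have := hJ1 hmr
      simp only [if_true, beq_iff_eq]; push_cast at hq hin ⊢; omega

/-- Flags of a site and the site below on the same column: the lower is first iff the upper is last. [folklore] -/
theorem flags_vert {r c : ℕ} (hc : c < N φ) : sF1 (J φ (r + 1) c) = sF2 φ (J φ r c) ∧ sMir (r + 1) = !sMir r := by
  unfold sF1 sF2 sMir J
  refine ⟨decide_eq_decide.2 ?_, ?_⟩
  · rcases Nat.mod_two_eq_zero_or_one r with h | h <;> simp [h, Nat.add_mod] <;> omega
  · rcases Nat.mod_two_eq_zero_or_one r with h | h <;> simp [h, Nat.add_mod]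

/-- **The ports between a site and the site below it**: same global vertex, same point. [folklore] -/
theorem port_vs {r c : ℕ} (hr : r + 1 < N φ) (hc : c < N φ) : ∀ π ∈ vsPorts (sF2 φ (J φ r c)) (sMir r),
    (PD.site r (J φ r c)).ν φ π.1 = (PD.site (r + 1) (J φ (r + 1) c)).ν φ π.2.1 ∧
      (sitePl φ r (J φ r c)).shift π.2.2.1 = (sitePl φ (r + 1) (J φ (r + 1) c)).shift π.2.2.2 := by
  have hJ1 := J_J (φ := φ) (r := r) hc
  have hJ2 := J_J (φ := φ) (r := r + 1) hc
  have hpos : ∀ x : ℤ, (sitePl φ r (J φ r c)).shift (x, 0) = (sitePl φ (r + 1) (J φ (r + 1) c)).shift (x, 100) := by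
    intro x
    simp only [Placement.shift, o_site, Prod.mk.injEq, hJ1, hJ2, true_and]
    push_cast; omega
  intro π hπ
  unfold vsPorts at hπ
  simp only [List.mem_append, List.mem_map, List.mem_range, List.mem_ite_nil_right, List.mem_singleton] at hπ
  simp only [PD.ν]
  rcases hπ with ⟨i, -, rfl⟩ | ⟨hl, rfl⟩
  · refine ⟨?_, hpos _⟩
    simp only [siteAnchor]
    rw [if_pos hr, hJ1, hJ2]
  · refine ⟨?_, hpos _⟩
    simp only [sF2, decide_eq_true_eq] at hl
    simp only [siteAnchor]
    rw [if_pos hr, show J φ (r + 1) c = 0 by unfold J at hl ⊢; split_ifs at hl ⊢ <;> omega]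

/-- **A site and the site below it on the same column meet correctly.** [folklore] -/
theorem meet_vs (hN : 0 < N φ) {r c : ℕ} (hr : r + 1 < N φ) (hc : c < N φ) :
    MeetOK (sitePl φ r (J φ r c)) (sitePl φ (r + 1) (J φ (r + 1) c)) := by
  have hr' : r < N φ := by omega
  have hs := J_lt (φ := φ) (r := r) hc
  have hs' := J_lt (φ := φ) (r := r + 1) hc
  obtain ⟨hf, hmm⟩ := flags_vert (φ := φ) (r := r) hc
  obtain ⟨bdP, bdP'⟩ := site_bd (φ := φ) (s := J φ r c) hr'
  obtain ⟨bdQ, bdQ'⟩ := site_bd (φ := φ) (s := J φ (r + 1) c) hr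
  rw [hf, hmm] at bdQ bdQ'
  obtain ⟨hw, hh, hm⟩ := dims_site (φ := φ) r (J φ r c)
  obtain ⟨hw', hh', hm'⟩ := dims_site (φ := φ) (r + 1) (J φ (r + 1) c)
  have hPm : sitePl φ r (J φ r c) ∈ placements φ := mem_placements.2 (Or.inr (Or.inl ⟨r, hr', _, hs, rfl⟩))
  have hQm : sitePl φ (r + 1) (J φ (r + 1) c) ∈ placements φ := mem_placements.2 (Or.inr (Or.inl ⟨r + 1, hr, _, hs', rfl⟩))
  have hne : sitePl φ r (J φ r c) ≠ sitePl φ (r + 1) (J φ (r + 1) c) := fun h => by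
    have := congrArg (fun P => P.o.2) h; simp only [o_site] at this; omega
  refine meet_of_ports (vsPorts (sF2 φ (J φ r c)) (sMir r))
    (vs_ports (sF1 (J φ r c)) (sF2 φ (J φ r c)) (sF3 φ r (J φ r c)) (sF4 φ r (J φ r c)) (sF5 φ r (J φ r c))
      (sF2 φ (J φ (r + 1) c)) (sF3 φ (r + 1) (J φ (r + 1) c)) (sF4 φ (r + 1) (J φ (r + 1) c)) (sF5 φ (r + 1) (J φ (r + 1) c)) (sMir r))
    (sitePl_ν r _) (sitePl_ν (r + 1) _)
    bdP bdP' bdQ bdQ' (valid_of_mem hPm) (valid_of_mem hQm)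
    (fun q h1 h2 => (boxes_placements hN hPm hQm hne q h1 h2).1)
    (fun p hin hb hq => ?_) (fun p hin hb hq => ?_) (port_vs hr hc)
  · unfold Placement.Box Tile.InBox at hq
    unfold Tile.InBox at hin
    simp only [Placement.shift, o_site, hh, hh', beq_iff_eq] at hq hin ⊢
    push_cast at hq hin ⊢; omega
  · unfold Placement.Box Tile.InBox at hq
    unfold Tile.InBox at hin
    simp only [Placement.shift, o_site, hh, hh', beq_iff_eq] at hq hin ⊢
    push_cast at hq hin ⊢; omega

/-- Row `0` runs right to left. [folklore] -/
theorem sMir_zero : sMir 0 = true := by simp [sMir]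

/-- **The ports between a dummy pair and the site below it**: same global vertex, same point. [folklore] -/
theorem port_dv {c : ℕ} (hc : c < N φ) : ∀ π ∈ dvPorts (decide (c + 1 = N φ)),
    (PD.dummy c).ν φ π.1 = (PD.site 0 (J φ 0 c)).ν φ π.2.1 ∧ (dummyPl φ c).shift π.2.2.1 = (sitePl φ 0 (J φ 0 c)).shift π.2.2.2 := by
  have hJJ := J_J (φ := φ) (r := 0) hc
  have hpos : ∀ x : ℤ, (dummyPl φ c).shift (x, 0) = (sitePl φ 0 (J φ 0 c)).shift (x, 100) := by
    intro x
    simp only [Placement.shift, o_site, o_dummy, Prod.mk.injEq, hJJ, true_and]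
    norm_num
  intro π hπ
  unfold dvPorts at hπ
  simp only [List.mem_append, List.mem_map, List.mem_range, List.mem_ite_nil_right, List.mem_singleton,
    decide_eq_true_eq] at hπ
  simp only [PD.ν]
  rcases hπ with ⟨i, -, rfl⟩ | ⟨hl, rfl⟩
  · refine ⟨?_, hpos _⟩
    simp only [siteAnchor, dummyAnchor]
    rw [hJJ]; ring
  · refine ⟨?_, hpos _⟩
    simp only [siteAnchor, dummyAnchor]
    rw [show J φ 0 c = 0 by unfold J; simp; omega]

/-- **A dummy pair and the site of row `0` below it meet correctly.** [folklore] -/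
theorem meet_dv (hN : 0 < N φ) {c : ℕ} (hc : c < N φ) : MeetOK (dummyPl φ c) (sitePl φ 0 (J φ 0 c)) := by
  have hs := J_lt (φ := φ) (r := 0) hc
  have hJ0 : J φ 0 c = N φ - 1 - c := by unfold J; simp
  have hf : sF1 (J φ 0 c) = decide (c + 1 = N φ) := by unfold sF1; rw [hJ0]; exact decide_eq_decide.2 (by omega)
  obtain ⟨bdQ, bdQ'⟩ := site_bd (φ := φ) (s := J φ 0 c) hN
  rw [hf, sMir_zero] at bdQ bdQ'
  obtain ⟨bdP, bdP'⟩ := dummy_bdry (decide (c = 0)) (decide (c + 1 = N φ)) (prev? φ c).isNone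
  obtain ⟨hw, hh, hm⟩ := dims_dummy (φ := φ) c
  obtain ⟨hw', hh', hm'⟩ := dims_site (φ := φ) 0 (J φ 0 c)
  have hPm : dummyPl φ c ∈ placements φ := mem_placements.2 (Or.inl ⟨c, hc, rfl⟩)
  have hQm : sitePl φ 0 (J φ 0 c) ∈ placements φ := mem_placements.2 (Or.inr (Or.inl ⟨0, hN, _, hs, rfl⟩))
  have hne : dummyPl φ c ≠ sitePl φ 0 (J φ 0 c) := fun h => by
    have := congrArg (fun P => P.o.2) h; simp only [o_site, o_dummy] at this; omega
  refine meet_of_ports (dvPorts (decide (c + 1 = N φ)))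
    (dv_ports (decide (c = 0)) (decide (c + 1 = N φ)) (prev? φ c).isNone (sF2 φ (J φ 0 c)) (sF3 φ 0 (J φ 0 c))
      (sF4 φ 0 (J φ 0 c)) (sF5 φ 0 (J φ 0 c)))
    (dummyPl_ν c) (sitePl_ν 0 _)
    bdP bdP' bdQ bdQ' (valid_of_mem hPm) (valid_of_mem hQm)
    (fun q h1 h2 => (boxes_placements hN hPm hQm hne q h1 h2).1)
    (fun p hin hb hq => ?_) (fun p hin hb hq => ?_) (port_dv hc)
  · unfold Placement.Box Tile.InBox at hq
    unfold Tile.InBox at hin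
    simp only [Placement.shift, o_site, o_dummy, hh, hh', beq_iff_eq] at hq hin ⊢
    push_cast at hq hin ⊢; omega
  · unfold Placement.Box Tile.InBox at hq
    unfold Tile.InBox at hin
    simp only [Placement.shift, o_site, o_dummy, hh, hh', beq_iff_eq] at hq hin ⊢
    push_cast at hq hin ⊢; omega

/-- The last row runs right to left (there is an odd number of rows). [folklore] -/
theorem sMir_last (hodd : N φ % 2 = 1) : sMir (N φ - 1) = true := by simp [sMir]; omega

/-- In the last row, column `c` is at site `N - 1 - c`. [folklore] -/
theorem J_last (hodd : N φ % 2 = 1) (c : ℕ) : J φ (N φ - 1) c = N φ - 1 - c := by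
  unfold J; rw [if_neg (by omega)]

/-- **The ports between the last site and the tile of `K_0`**: same global vertex, same point. [folklore] -/
theorem port_sk0 (hN : 0 < N φ) (hodd : N φ % 2 = 1) : ∀ π ∈ sk0Ports,
    (PD.site (N φ - 1) (N φ - 1)).ν φ π.1 = PD.k0.ν φ π.2.1 ∧ (sitePl φ (N φ - 1) (N φ - 1)).shift π.2.2.1 = (k0Pl φ).shift π.2.2.2 := by
  have hJ : J φ (N φ - 1) (N φ - 1) = 0 := by rw [J_last hodd]; omega
  have hpos : ∀ x : ℤ, (sitePl φ (N φ - 1) (N φ - 1)).shift (x, 0) = (k0Pl φ).shift (x, 60) := by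
    intro x
    simp only [Placement.shift, o_site, o_k0, Prod.mk.injEq, hJ, yK]
    push_cast; omega
  intro π hπ
  unfold sk0Ports at hπ
  simp only [List.mem_append, List.mem_map, List.mem_range, List.mem_singleton] at hπ
  simp only [PD.ν]
  rcases hπ with ⟨i, -, rfl⟩ | rfl
  · refine ⟨?_, hpos _⟩
    simp only [siteAnchor, k0Anchor]
    rw [if_neg (by omega), hJ]; unfold klinkBase; ring
  · refine ⟨?_, hpos _⟩
    simp only [siteAnchor, k0Anchor]
    rw [if_neg (by omega)]

/-- **The last site of the last row and the tile of `K_0` meet correctly.** [folklore] -/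
theorem meet_sk0 (hN : 0 < N φ) (hodd : N φ % 2 = 1) : MeetOK (sitePl φ (N φ - 1) (N φ - 1)) (k0Pl φ) := by
  have hr : N φ - 1 < N φ := by omega
  have hl : sF2 φ (N φ - 1) = true := by simp [sF2]; omega
  obtain ⟨bdP, bdP'⟩ := site_bd (φ := φ) (s := N φ - 1) hr
  rw [hl, sMir_last hodd] at bdP bdP'
  obtain ⟨⟨bdQ, bdQ'⟩, -⟩ := k0_facts (FormulaCells.polOf φ 0)
  obtain ⟨hw, hh, hm⟩ := dims_site (φ := φ) (N φ - 1) (N φ - 1)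
  obtain ⟨hw', hh', hm'⟩ := dims_k0 (φ := φ)
  have hPm : sitePl φ (N φ - 1) (N φ - 1) ∈ placements φ := mem_placements.2 (Or.inr (Or.inl ⟨_, hr, _, hr, rfl⟩))
  have hQm : k0Pl φ ∈ placements φ := mem_placements.2 (Or.inr (Or.inr (Or.inl rfl)))
  have hne : sitePl φ (N φ - 1) (N φ - 1) ≠ k0Pl φ := fun h => by
    have := congrArg (fun P => P.o.2) h; simp only [o_site, o_k0, yK] at this; omega
  have hJ : J φ (N φ - 1) (N φ - 1) = 0 := by rw [J_last hodd]; omega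
  refine meet_of_ports sk0Ports (sk0_ports (sF1 (N φ - 1)) (sF3 φ (N φ - 1) (N φ - 1)) (sF4 φ (N φ - 1) (N φ - 1)) (sF5 φ (N φ - 1) (N φ - 1)))
    (sitePl_ν _ _) k0Pl_ν
    bdP bdP' bdQ bdQ' (valid_of_mem hPm) (valid_of_mem hQm)
    (fun q h1 h2 => (boxes_placements hN hPm hQm hne q h1 h2).1)
    (fun p hin hb hq => ?_) (fun p hin hb hq => ?_) (port_sk0 hN hodd)
  · unfold Placement.Box Tile.InBox at hq
    unfold Tile.InBox at hin
    simp only [Placement.shift, o_site, o_k0, hh, hh', beq_iff_eq, yK] at hq hin ⊢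
    push_cast at hq hin ⊢; omega
  · unfold Placement.Box Tile.InBox at hq
    unfold Tile.InBox at hin
    simp only [Placement.shift, o_site, o_k0, hh, hh', beq_iff_eq, yK] at hq hin ⊢
    push_cast at hq hin ⊢; omega

/-- **The ports between a site of the last row and the clause tile below it**: same global vertex, same point. [folklore] -/
theorem port_scl (hN : 0 < N φ) {t u : ℕ} (hc : 3 * t + 1 + u < N φ) : ∀ π ∈ sclPorts u,
    (PD.site (N φ - 1) (J φ (N φ - 1) (3 * t + 1 + u))).ν φ π.1 = (PD.clause t).ν φ π.2.1 ∧
      (sitePl φ (N φ - 1) (J φ (N φ - 1) (3 * t + 1 + u))).shift π.2.2.1 = (clausePl φ t).shift π.2.2.2 := by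
  have hJJ := J_J (φ := φ) (r := N φ - 1) hc
  have hpos : ∀ i : ℕ, (sitePl φ (N φ - 1) (J φ (N φ - 1) (3 * t + 1 + u))).shift ((20 : ℤ) + 2 * (i : ℤ), 0) =
      (clausePl φ t).shift ((56 : ℤ) * (u : ℤ) + 20 + 2 * (i : ℤ), 60) := by
    intro i
    simp only [Placement.shift, o_site, o_clause, Prod.mk.injEq, hJJ, yK]
    push_cast; omega
  intro π hπ
  unfold sclPorts at hπ
  simp only [List.mem_map, List.mem_range] at hπ
  simp only [PD.ν]
  obtain ⟨i, -, rfl⟩ := hπ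
  refine ⟨?_, hpos i⟩
  simp only [siteAnchor, clauseAnchor]
  rw [if_neg (by omega), hJJ]; unfold klinkBase; ring

/-- **A site of the last row and the clause tile below it meet correctly.** [folklore] -/
theorem meet_scl (hN : 0 < N φ) (hodd : N φ % 2 = 1) {t u : ℕ} (hu : u < 3) (hc : 3 * t + 1 + u < N φ) (ht : t < T φ) :
    MeetOK (sitePl φ (N φ - 1) (J φ (N φ - 1) (3 * t + 1 + u))) (clausePl φ t) := by
  set c := 3 * t + 1 + u with hcdef
  have hr : N φ - 1 < N φ := by omega
  have hs := J_lt (φ := φ) (r := N φ - 1) hc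
  have hJc := J_last (φ := φ) hodd c
  have hl : sF2 φ (J φ (N φ - 1) c) = false := by simp [sF2]; omega
  obtain ⟨bdP, bdP'⟩ := site_bd (φ := φ) (s := J φ (N φ - 1) c) hr
  rw [hl, sMir_last hodd] at bdP bdP'
  obtain ⟨⟨bdQ, bdQ'⟩, -⟩ := clause_facts (cPols φ t).1 (cPols φ t).2.1 (cPols φ t).2.2
  obtain ⟨hw, hh, hm⟩ := dims_site (φ := φ) (N φ - 1) (J φ (N φ - 1) c)
  obtain ⟨hw', hh', hm'⟩ := dims_clause (φ := φ) t
  have hPm : sitePl φ (N φ - 1) (J φ (N φ - 1) c) ∈ placements φ := mem_placements.2 (Or.inr (Or.inl ⟨_, hr, _, hs, rfl⟩))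
  have hQm : clausePl φ t ∈ placements φ := mem_placements.2 (Or.inr (Or.inr (Or.inr (Or.inl ⟨t, ht, rfl⟩))))
  have hne : sitePl φ (N φ - 1) (J φ (N φ - 1) c) ≠ clausePl φ t := fun h => by
    have := congrArg (fun P => P.o.2) h; simp only [o_site, o_clause, yK] at this; omega
  have hJJ := J_J (φ := φ) (r := N φ - 1) hc
  refine meet_of_ports (sclPorts u)
    (scl_ports (sF1 (J φ (N φ - 1) c)) (sF3 φ (N φ - 1) (J φ (N φ - 1) c)) (sF4 φ (N φ - 1) (J φ (N φ - 1) c))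
      (sF5 φ (N φ - 1) (J φ (N φ - 1) c)) u hu)
    (sitePl_ν _ _) (clausePl_ν t)
    bdP bdP' bdQ bdQ' (valid_of_mem hPm) (valid_of_mem hQm)
    (fun q h1 h2 => (boxes_placements hN hPm hQm hne q h1 h2).1)
    (fun p hin hb hq => ?_) (fun p hin hb hq => ?_) (port_scl hN hc)
  · unfold Placement.Box Tile.InBox at hq
    unfold Tile.InBox at hin
    simp only [Placement.shift, o_site, o_clause, hh, hh', beq_iff_eq, yK] at hq hin ⊢
    push_cast at hq hin ⊢; omega
  · unfold Placement.Box Tile.InBox at hq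
    unfold Tile.InBox at hin
    unfold Tile.OnBdry at hb
    simp only [Placement.shift, o_site, o_clause, hh, hh', hw, hw', hJJ, Bool.and_eq_true, beq_iff_eq, decide_eq_true_eq, yK]
      at hq hin hb ⊢
    push_cast at hq hin hb ⊢; omega

/-- The port between consecutive dummy pairs: same global vertex, same point. [folklore] -/
theorem port_dh (c : ℕ) : ∀ π ∈ dhPorts,
    (PD.dummy c).ν φ π.1 = (PD.dummy (c + 1)).ν φ π.2.1 ∧ (dummyPl φ c).shift π.2.2.1 = (dummyPl φ (c + 1)).shift π.2.2.2 := by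
  intro π hπ
  unfold dhPorts at hπ
  rw [List.mem_singleton] at hπ
  subst hπ
  simp only [PD.ν, dummyAnchor, Placement.shift, o_dummy, Prod.mk.injEq, and_true]
  omega

/-- The port between the tile of `K_0` and the first clause tile: same global vertex, same point. [folklore] -/
theorem port_kc : ∀ π ∈ khPorts,
    PD.k0.ν φ π.1 = (PD.clause 0).ν φ π.2.1 ∧ (k0Pl φ).shift π.2.2.1 = (clausePl φ 0).shift π.2.2.2 := by
  intro π hπ
  unfold khPorts at hπ
  rw [List.mem_singleton] at hπ
  subst hπ
  simp only [PD.ν, k0Anchor, clauseAnchor, Placement.shift, o_k0, o_clause, Prod.mk.injEq, and_true]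
  unfold kIdx; omega

/-- The port between the tile of `K_0` and the end tile (one clause): same global vertex, same point. [folklore] -/
theorem port_kz (hN1 : N φ = 1) : ∀ π ∈ khPorts,
    PD.k0.ν φ π.1 = PD.z.ν φ π.2.1 ∧ (k0Pl φ).shift π.2.2.1 = (zPl φ).shift π.2.2.2 := by
  intro π hπ
  unfold khPorts at hπ
  rw [List.mem_singleton] at hπ
  subst hπ
  simp only [PD.ν, k0Anchor, Placement.shift, o_k0, o_z, Prod.mk.injEq, hN1, and_true]
  unfold kIdx zIdx; omega

/-- The port between consecutive clause tiles: same global vertex, same point. [folklore] -/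
theorem port_cc (t : ℕ) : ∀ π ∈ chPorts,
    (PD.clause t).ν φ π.1 = (PD.clause (t + 1)).ν φ π.2.1 ∧ (clausePl φ t).shift π.2.2.1 = (clausePl φ (t + 1)).shift π.2.2.2 := by
  intro π hπ
  unfold chPorts at hπ
  rw [List.mem_singleton] at hπ
  subst hπ
  simp only [PD.ν, clauseAnchor, Placement.shift, o_clause, Prod.mk.injEq, and_true]
  unfold kIdx; omega

/-- The port between the last clause tile and the end tile: same global vertex, same point. [folklore] -/
theorem port_cz (hN3 : N φ = 3 * T φ + 1) (hT : 0 < T φ) : ∀ π ∈ chPorts,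
    (PD.clause (T φ - 1)).ν φ π.1 = PD.z.ν φ π.2.1 ∧ (clausePl φ (T φ - 1)).shift π.2.2.1 = (zPl φ).shift π.2.2.2 := by
  intro π hπ
  unfold chPorts at hπ
  rw [List.mem_singleton] at hπ
  subst hπ
  simp only [PD.ν, clauseAnchor, Placement.shift, o_clause, o_z, Prod.mk.injEq, hN3, and_true]
  unfold kIdx zIdx; rw [hN3]; omega

/-- **Consecutive dummy pairs meet correctly.** [folklore] -/
theorem meet_dh (hN : 0 < N φ) {c : ℕ} (hc : c + 1 < N φ) : MeetOK (dummyPl φ c) (dummyPl φ (c + 1)) := by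
  have hl : decide (c + 1 = N φ) = false := by simp; omega
  have hf : decide (c + 1 = 0) = false := by simp
  obtain ⟨bdP, bdP'⟩ := dummy_bd (φ := φ) c
  obtain ⟨bdQ, bdQ'⟩ := dummy_bd (φ := φ) (c + 1)
  rw [hl] at bdP bdP'
  rw [hf] at bdQ bdQ'
  obtain ⟨hw, hh, hm⟩ := dims_dummy (φ := φ) c
  obtain ⟨hw', hh', hm'⟩ := dims_dummy (φ := φ) (c + 1)
  have hPm : dummyPl φ c ∈ placements φ := mem_placements.2 (Or.inl ⟨c, by omega, rfl⟩)
  have hQm : dummyPl φ (c + 1) ∈ placements φ := mem_placements.2 (Or.inl ⟨c + 1, hc, rfl⟩)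
  have hne : dummyPl φ c ≠ dummyPl φ (c + 1) := fun h => by
    have := congrArg (fun P => P.o.1) h; simp only [o_dummy] at this; omega
  refine meet_of_ports dhPorts (dh_ports (decide (c = 0)) (prev? φ c).isNone (decide (c + 1 + 1 = N φ)) (prev? φ (c + 1)).isNone)
    (dummyPl_ν c) (dummyPl_ν (c + 1))
    bdP bdP' bdQ bdQ' (valid_of_mem hPm) (valid_of_mem hQm)
    (fun q h1 h2 => (boxes_placements hN hPm hQm hne q h1 h2).1)
    (fun p hin hb hq => ?_) (fun p hin hb hq => ?_) (port_dh c)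
  · unfold Placement.Box Tile.InBox at hq
    unfold Tile.InBox at hin
    simp only [Placement.shift, o_dummy, hw, hw', beq_iff_eq] at hq hin ⊢
    push_cast at hq hin ⊢; omega
  · unfold Placement.Box Tile.InBox at hq
    unfold Tile.InBox at hin
    simp only [Placement.shift, o_dummy, hw, hw', beq_iff_eq] at hq hin ⊢
    push_cast at hq hin ⊢; omega

/-- **The tile of `K_0` and the first clause tile meet correctly.** [folklore] -/
theorem meet_kc (hN : 0 < N φ) (hT : 0 < T φ) : MeetOK (k0Pl φ) (clausePl φ 0) := by
  obtain ⟨⟨bdP, bdP'⟩, -⟩ := k0_facts (FormulaCells.polOf φ 0)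
  obtain ⟨⟨bdQ, bdQ'⟩, -⟩ := clause_facts (cPols φ 0).1 (cPols φ 0).2.1 (cPols φ 0).2.2
  obtain ⟨hw, hh, hm⟩ := dims_k0 (φ := φ)
  obtain ⟨hw', hh', hm'⟩ := dims_clause (φ := φ) 0
  have hPm : k0Pl φ ∈ placements φ := mem_placements.2 (Or.inr (Or.inr (Or.inl rfl)))
  have hQm : clausePl φ 0 ∈ placements φ := mem_placements.2 (Or.inr (Or.inr (Or.inr (Or.inl ⟨0, hT, rfl⟩))))
  have hne : k0Pl φ ≠ clausePl φ 0 := fun h => by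
    have := congrArg (fun P => P.o.1) h; simp only [o_k0, o_clause] at this; omega
  refine meet_of_ports khPorts krow_ports.1 k0Pl_ν (clausePl_ν 0)
    bdP bdP' bdQ bdQ' (valid_of_mem hPm) (valid_of_mem hQm)
    (fun q h1 h2 => (boxes_placements hN hPm hQm hne q h1 h2).1)
    (fun p hin hb hq => ?_) (fun p hin hb hq => ?_) port_kc
  · unfold Placement.Box Tile.InBox at hq
    unfold Tile.InBox at hin
    simp only [Placement.shift, o_k0, o_clause, hw, hw', beq_iff_eq] at hq hin ⊢
    push_cast at hq hin ⊢; omega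
  · unfold Placement.Box Tile.InBox at hq
    unfold Tile.InBox at hin
    simp only [Placement.shift, o_k0, o_clause, hw, hw', beq_iff_eq] at hq hin ⊢
    push_cast at hq hin ⊢; omega

/-- **The tile of `K_0` and the end tile meet correctly (no three-literal clauses).** [folklore] -/
theorem meet_kz (hN1 : N φ = 1) : MeetOK (k0Pl φ) (zPl φ) := by
  have hN : 0 < N φ := by omega
  obtain ⟨⟨bdP, bdP'⟩, -⟩ := k0_facts (FormulaCells.polOf φ 0)
  obtain ⟨⟨bdQ, bdQ'⟩, -⟩ := z_facts
  obtain ⟨hw, hh, hm⟩ := dims_k0 (φ := φ)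
  obtain ⟨hw', hh', hm'⟩ := dims_z (φ := φ)
  have hPm : k0Pl φ ∈ placements φ := mem_placements.2 (Or.inr (Or.inr (Or.inl rfl)))
  have hQm : zPl φ ∈ placements φ := mem_placements.2 (Or.inr (Or.inr (Or.inr (Or.inr rfl))))
  have hne : k0Pl φ ≠ zPl φ := fun h => by
    have := congrArg (fun P => P.o.1) h; simp only [o_k0, o_z] at this; omega
  refine meet_of_ports khPorts krow_ports.2.1 k0Pl_ν zPl_ν
    bdP bdP' bdQ bdQ' (valid_of_mem hPm) (valid_of_mem hQm)
    (fun q h1 h2 => (boxes_placements hN hPm hQm hne q h1 h2).1)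
    (fun p hin hb hq => ?_) (fun p hin hb hq => ?_) (port_kz hN1)
  · unfold Placement.Box Tile.InBox at hq
    unfold Tile.InBox at hin
    simp only [Placement.shift, o_k0, o_z, hw, hw', beq_iff_eq, hN1] at hq hin ⊢
    push_cast at hq hin ⊢; omega
  · unfold Placement.Box Tile.InBox at hq
    unfold Tile.InBox at hin
    simp only [Placement.shift, o_k0, o_z, hw, hw', beq_iff_eq, hN1] at hq hin ⊢
    push_cast at hq hin ⊢; omega

/-- **Consecutive clause tiles meet correctly.** [folklore] -/
theorem meet_cc (hN : 0 < N φ) {t : ℕ} (ht : t + 1 < T φ) : MeetOK (clausePl φ t) (clausePl φ (t + 1)) := by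
  obtain ⟨⟨bdP, bdP'⟩, -⟩ := clause_facts (cPols φ t).1 (cPols φ t).2.1 (cPols φ t).2.2
  obtain ⟨⟨bdQ, bdQ'⟩, -⟩ := clause_facts (cPols φ (t + 1)).1 (cPols φ (t + 1)).2.1 (cPols φ (t + 1)).2.2
  obtain ⟨hw, hh, hm⟩ := dims_clause (φ := φ) t
  obtain ⟨hw', hh', hm'⟩ := dims_clause (φ := φ) (t + 1)
  have hPm : clausePl φ t ∈ placements φ := mem_placements.2 (Or.inr (Or.inr (Or.inr (Or.inl ⟨t, by omega, rfl⟩))))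
  have hQm : clausePl φ (t + 1) ∈ placements φ := mem_placements.2 (Or.inr (Or.inr (Or.inr (Or.inl ⟨t + 1, ht, rfl⟩))))
  have hne : clausePl φ t ≠ clausePl φ (t + 1) := fun h => by
    have := congrArg (fun P => P.o.1) h; simp only [o_clause] at this; omega
  refine meet_of_ports chPorts krow_ports.2.2.1 (clausePl_ν t) (clausePl_ν (t + 1))
    bdP bdP' bdQ bdQ' (valid_of_mem hPm) (valid_of_mem hQm)
    (fun q h1 h2 => (boxes_placements hN hPm hQm hne q h1 h2).1)
    (fun p hin hb hq => ?_) (fun p hin hb hq => ?_) (port_cc t)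
  · unfold Placement.Box Tile.InBox at hq
    unfold Tile.InBox at hin
    simp only [Placement.shift, o_clause, hw, hw', beq_iff_eq] at hq hin ⊢
    push_cast at hq hin ⊢; omega
  · unfold Placement.Box Tile.InBox at hq
    unfold Tile.InBox at hin
    simp only [Placement.shift, o_clause, hw, hw', beq_iff_eq] at hq hin ⊢
    push_cast at hq hin ⊢; omega

/-- **The last clause tile and the end tile meet correctly.** [folklore] -/
theorem meet_cz (hN3 : N φ = 3 * T φ + 1) (hT : 0 < T φ) : MeetOK (clausePl φ (T φ - 1)) (zPl φ) := by
  have hN : 0 < N φ := by omega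
  obtain ⟨⟨bdP, bdP'⟩, -⟩ := clause_facts (cPols φ (T φ - 1)).1 (cPols φ (T φ - 1)).2.1 (cPols φ (T φ - 1)).2.2
  obtain ⟨⟨bdQ, bdQ'⟩, -⟩ := z_facts
  obtain ⟨hw, hh, hm⟩ := dims_clause (φ := φ) (T φ - 1)
  obtain ⟨hw', hh', hm'⟩ := dims_z (φ := φ)
  have hPm : clausePl φ (T φ - 1) ∈ placements φ := mem_placements.2 (Or.inr (Or.inr (Or.inr (Or.inl ⟨T φ - 1, by omega, rfl⟩))))
  have hQm : zPl φ ∈ placements φ := mem_placements.2 (Or.inr (Or.inr (Or.inr (Or.inr rfl))))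
  have hne : clausePl φ (T φ - 1) ≠ zPl φ := fun h => by
    have := congrArg (fun P => P.o.1) h; simp only [o_clause, o_z] at this; omega
  refine meet_of_ports chPorts krow_ports.2.2.2 (clausePl_ν (T φ - 1)) zPl_ν
    bdP bdP' bdQ bdQ' (valid_of_mem hPm) (valid_of_mem hQm)
    (fun q h1 h2 => (boxes_placements hN hPm hQm hne q h1 h2).1)
    (fun p hin hb hq => ?_) (fun p hin hb hq => ?_) (port_cz hN3 hT)
  · unfold Placement.Box Tile.InBox at hq
    unfold Tile.InBox at hin
    simp only [Placement.shift, o_clause, o_z, hw, hw', beq_iff_eq, hN3] at hq hin ⊢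
    push_cast at hq hin ⊢; omega
  · unfold Placement.Box Tile.InBox at hq
    unfold Tile.InBox at hin
    simp only [Placement.shift, o_clause, o_z, hw, hw', beq_iff_eq, hN3] at hq hin ⊢
    push_cast at hq hin ⊢; omega

/-- A site placement named by its column. [folklore] -/
theorem sitePl_eq_of_J {r s : ℕ} (hs : s < N φ) : sitePl φ r s = sitePl φ r (J φ r (J φ r s)) := by rw [J_J hs]

/-- **How two distinct placed tiles with a common point that is not a corner of the second meet**:
always correctly (one of the ten ways, or no common point at all). [folklore] -/
theorem meet_placements (hN : 0 < N φ) (hN3 : N φ = 3 * T φ + 1) (hodd : N φ % 2 = 1)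
    {P : Placement} (hP : P ∈ placements φ) {Q : Placement} (hQ : Q ∈ placements φ) (hPQ : P ≠ Q)
    (q : GridPoint) (hPq : P.Box q) (hQq : Q.Box q) (hcor : ¬ Q.T.IsCorner (q.1 - Q.o.1, q.2 - Q.o.2)) : MeetOK P Q := by
  have hyK : yK φ + 60 = -((100 * N φ : ℕ) : ℤ) := by unfold yK; push_cast; ring
  unfold Placement.Box Tile.InBox at hPq hQq
  unfold Tile.IsCorner at hcor
  rcases mem_placements.1 hP with ⟨c, hc, rfl⟩ | ⟨r, hr, s, hs, rfl⟩ | rfl | ⟨t, ht, rfl⟩ | rfl <;>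
    rcases mem_placements.1 hQ with ⟨c', hc', rfl⟩ | ⟨r', hr', s', hs', rfl⟩ | rfl | ⟨t', ht', rfl⟩ | rfl
  -- dummy / dummy
  · obtain ⟨hw, hh, -⟩ := dims_dummy (φ := φ) c
    obtain ⟨hw', hh', -⟩ := dims_dummy (φ := φ) c'
    simp only [o_dummy, hw, hh, hw', hh'] at hPq hQq hcor
    push_cast at hPq hQq hcor
    have hcc : c ≠ c' := fun h => hPQ (by rw [h])
    by_cases h1 : c' = c + 1
    · subst h1; exact meet_dh hN hc'
    · by_cases h2 : c = c' + 1
      · subst h2; exact (meet_dh hN hc).symm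
      · exfalso; omega
  -- dummy / site
  · obtain ⟨hw, hh, -⟩ := dims_dummy (φ := φ) c
    obtain ⟨hw', hh', -⟩ := dims_site (φ := φ) r' s'
    simp only [o_dummy, o_site, hw, hh, hw', hh'] at hPq hQq hcor
    push_cast at hPq hQq hcor
    have hJ' := J_lt (φ := φ) (r := r') hs'
    obtain rfl : r' = 0 := by by_contra h; omega
    have hcc : J φ 0 s' = c := by by_contra h; omega
    rw [sitePl_eq_of_J hs', hcc]
    exact meet_dv hN hc
  -- dummy / k0, clause, z: apart
  · simp only [o_dummy, o_k0, (dims_k0 (φ := φ)).2.1, (dims_dummy (φ := φ) c).2.1] at hPq hQq; omega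
  · simp only [o_dummy, o_clause, (dims_clause (φ := φ) t').2.1, (dims_dummy (φ := φ) c).2.1] at hPq hQq; omega
  · simp only [o_dummy, o_z, (dims_z (φ := φ)).2.1, (dims_dummy (φ := φ) c).2.1] at hPq hQq; omega
  -- site / dummy
  · obtain ⟨hw, hh, -⟩ := dims_site (φ := φ) r s
    obtain ⟨hw', hh', -⟩ := dims_dummy (φ := φ) c'
    simp only [o_dummy, o_site, hw, hh, hw', hh'] at hPq hQq hcor
    push_cast at hPq hQq hcor
    have hJ := J_lt (φ := φ) (r := r) hs
    obtain rfl : r = 0 := by by_contra h; omega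
    have hcc : J φ 0 s = c' := by by_contra h; omega
    rw [sitePl_eq_of_J hs, hcc]
    exact (meet_dv hN hc').symm
  -- site / site
  · obtain ⟨hw, hh, -⟩ := dims_site (φ := φ) r s
    obtain ⟨hw', hh', -⟩ := dims_site (φ := φ) r' s'
    simp only [o_site, hw, hh, hw', hh'] at hPq hQq hcor
    push_cast at hPq hQq hcor
    have hJ := J_lt (φ := φ) (r := r) hs
    have hJ' := J_lt (φ := φ) (r := r') hs'
    rcases Nat.lt_trichotomy r r' with h | rfl | h
    · obtain rfl : r' = r + 1 := by by_contra h'; omega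
      have hcc : J φ (r + 1) s' = J φ r s := by by_contra h'; omega
      rw [sitePl_eq_of_J hs, sitePl_eq_of_J hs', hcc]
      exact meet_vs hN hr' hJ
    · -- same row
      have hne : J φ r s ≠ J φ r s' := fun h => hPQ (by rw [J_inj hs hs' h])
      rcases Nat.lt_or_gt_of_ne hne with h | h
      · have h1 : J φ r s' = J φ r s + 1 := by omega
        by_cases hm : r % 2 = 1
        · have : s' = s + 1 := by unfold J at h1; rw [if_pos hm, if_pos hm] at h1; exact h1
          subst this; exact meet_hs hN hr hs'
        · have : s = s' + 1 := by unfold J at h1; rw [if_neg hm, if_neg hm] at h1; omega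
          subst this; exact (meet_hs hN hr hs).symm
      · have h1 : J φ r s = J φ r s' + 1 := by omega
        by_cases hm : r % 2 = 1
        · have : s = s' + 1 := by unfold J at h1; rw [if_pos hm, if_pos hm] at h1; exact h1
          subst this; exact (meet_hs hN hr hs).symm
        · have : s' = s + 1 := by unfold J at h1; rw [if_neg hm, if_neg hm] at h1; omega
          subst this; exact meet_hs hN hr hs'
    · obtain rfl : r = r' + 1 := by by_contra h'; omega
      have hcc : J φ (r' + 1) s = J φ r' s' := by by_contra h'; omega
      rw [sitePl_eq_of_J hs, sitePl_eq_of_J hs', hcc]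
      exact (meet_vs hN hr hJ').symm
  -- site / k0
  · obtain ⟨hw, hh, -⟩ := dims_site (φ := φ) r s
    obtain ⟨hw', hh', -⟩ := dims_k0 (φ := φ)
    simp only [o_site, o_k0, hw, hh, hw', hh'] at hPq hQq hcor
    push_cast at hPq hQq hcor
    have hJ := J_lt (φ := φ) (r := r) hs
    obtain rfl : r = N φ - 1 := by by_contra h'; omega
    have hcc : J φ (N φ - 1) s = 0 := by by_contra h'; omega
    have hss : s = N φ - 1 := by rw [J_last hodd] at hcc; omega
    subst hss
    exact meet_sk0 hN hodd
  -- site / clause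
  · obtain ⟨hw, hh, -⟩ := dims_site (φ := φ) r s
    obtain ⟨hw', hh', -⟩ := dims_clause (φ := φ) t'
    simp only [o_site, o_clause, hw, hh, hw', hh'] at hPq hQq hcor
    push_cast at hPq hQq hcor
    have hJ := J_lt (φ := φ) (r := r) hs
    obtain rfl : r = N φ - 1 := by by_contra h'; omega
    obtain ⟨u, hu, hcu⟩ : ∃ u < 3, J φ (N φ - 1) s = 3 * t' + 1 + u := ⟨J φ (N φ - 1) s - (3 * t' + 1), by omega, by omega⟩
    rw [sitePl_eq_of_J hs, hcu]
    exact meet_scl hN hodd hu (by omega) ht'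
  -- site / z: only a corner in common
  · obtain ⟨hw, hh, -⟩ := dims_site (φ := φ) r s
    obtain ⟨hw', hh', -⟩ := dims_z (φ := φ)
    simp only [o_site, o_z, hw, hh, hw', hh'] at hPq hQq hcor
    push_cast at hPq hQq hcor
    have hJ := J_lt (φ := φ) (r := r) hs
    exfalso; omega
  -- k0 / dummy
  · simp only [o_dummy, o_k0, (dims_k0 (φ := φ)).2.1, (dims_dummy (φ := φ) c').2.1] at hPq hQq; omega
  -- k0 / site
  · obtain ⟨hw, hh, -⟩ := dims_k0 (φ := φ)
    obtain ⟨hw', hh', -⟩ := dims_site (φ := φ) r' s'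
    simp only [o_site, o_k0, hw, hh, hw', hh'] at hPq hQq hcor
    push_cast at hPq hQq hcor
    have hJ' := J_lt (φ := φ) (r := r') hs'
    obtain rfl : r' = N φ - 1 := by by_contra h'; omega
    have hcc : J φ (N φ - 1) s' = 0 := by by_contra h'; omega
    have hss : s' = N φ - 1 := by rw [J_last hodd] at hcc; omega
    subst hss
    exact (meet_sk0 hN hodd).symm
  · exact absurd rfl hPQ
  -- k0 / clause
  · obtain ⟨hw, hh, -⟩ := dims_k0 (φ := φ)
    obtain ⟨hw', hh', -⟩ := dims_clause (φ := φ) t'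
    simp only [o_k0, o_clause, hw, hh, hw', hh'] at hPq hQq hcor
    push_cast at hPq hQq hcor
    obtain rfl : t' = 0 := by by_contra h'; omega
    exact meet_kc hN ht'
  -- k0 / z
  · obtain ⟨hw, hh, -⟩ := dims_k0 (φ := φ)
    obtain ⟨hw', hh', -⟩ := dims_z (φ := φ)
    simp only [o_k0, o_z, hw, hh, hw', hh'] at hPq hQq hcor
    push_cast at hPq hQq hcor
    exact meet_kz (by omega)
  -- clause / dummy
  · simp only [o_dummy, o_clause, (dims_clause (φ := φ) t).2.1, (dims_dummy (φ := φ) c').2.1] at hPq hQq; omega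
  -- clause / site
  · obtain ⟨hw, hh, -⟩ := dims_clause (φ := φ) t
    obtain ⟨hw', hh', -⟩ := dims_site (φ := φ) r' s'
    simp only [o_site, o_clause, hw, hh, hw', hh'] at hPq hQq hcor
    push_cast at hPq hQq hcor
    have hJ' := J_lt (φ := φ) (r := r') hs'
    obtain rfl : r' = N φ - 1 := by by_contra h'; omega
    obtain ⟨u, hu, hcu⟩ : ∃ u < 3, J φ (N φ - 1) s' = 3 * t + 1 + u := ⟨J φ (N φ - 1) s' - (3 * t + 1), by omega, by omega⟩
    rw [sitePl_eq_of_J hs', hcu]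
    exact (meet_scl hN hodd hu (by omega) ht).symm
  -- clause / k0
  · obtain ⟨hw, hh, -⟩ := dims_clause (φ := φ) t
    obtain ⟨hw', hh', -⟩ := dims_k0 (φ := φ)
    simp only [o_k0, o_clause, hw, hh, hw', hh'] at hPq hQq hcor
    push_cast at hPq hQq hcor
    obtain rfl : t = 0 := by by_contra h'; omega
    exact (meet_kc hN ht).symm
  -- clause / clause
  · obtain ⟨hw, hh, -⟩ := dims_clause (φ := φ) t
    obtain ⟨hw', hh', -⟩ := dims_clause (φ := φ) t'
    simp only [o_clause, hw, hh, hw', hh'] at hPq hQq hcor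
    push_cast at hPq hQq hcor
    have htt : t ≠ t' := fun h => hPQ (by rw [h])
    by_cases h1 : t' = t + 1
    · subst h1; exact meet_cc hN ht'
    · by_cases h2 : t = t' + 1
      · subst h2; exact (meet_cc hN ht).symm
      · exfalso; omega
  -- clause / z
  · obtain ⟨hw, hh, -⟩ := dims_clause (φ := φ) t
    obtain ⟨hw', hh', -⟩ := dims_z (φ := φ)
    simp only [o_clause, o_z, hw, hh, hw', hh'] at hPq hQq hcor
    push_cast at hPq hQq hcor
    obtain rfl : t = T φ - 1 := by by_contra h'; omega
    exact meet_cz hN3 (by omega)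
  -- z / *
  · simp only [o_dummy, o_z, (dims_z (φ := φ)).2.1, (dims_dummy (φ := φ) c').2.1] at hPq hQq; omega
  · obtain ⟨hw, hh, -⟩ := dims_z (φ := φ)
    obtain ⟨hw', hh', -⟩ := dims_site (φ := φ) r' s'
    simp only [o_site, o_z, hw, hh, hw', hh'] at hPq hQq hcor
    push_cast at hPq hQq hcor
    have hJ' := J_lt (φ := φ) (r := r') hs'
    exfalso; omega
  · obtain ⟨hw, hh, -⟩ := dims_z (φ := φ)
    obtain ⟨hw', hh', -⟩ := dims_k0 (φ := φ)
    simp only [o_k0, o_z, hw, hh, hw', hh'] at hPq hQq hcor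
    push_cast at hPq hQq hcor
    exact (meet_kz (by omega)).symm
  · obtain ⟨hw, hh, -⟩ := dims_z (φ := φ)
    obtain ⟨hw', hh', -⟩ := dims_clause (φ := φ) t'
    simp only [o_clause, o_z, hw, hh, hw', hh'] at hPq hQq hcor
    push_cast at hPq hQq hcor
    obtain rfl : t' = T φ - 1 := by by_contra h'; omega
    exact (meet_cz hN3 (by omega)).symm
  · exact absurd rfl hPQ

end instances

/-! ### Shared vertices and cross-listing -/

/-- **Coinciding vertex positions of placed tiles are the same global vertex.** [folklore] -/
theorem shared_placements (hN : 0 < N φ) (hN3 : N φ = 3 * T φ + 1) (hodd : N φ % 2 = 1) :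
    ∀ P ∈ placements φ, ∀ Q ∈ placements φ, ∀ i (hi : i < P.T.nv), ∀ j (hj : j < Q.T.nv),
      P.shift P.T.pos[i] = Q.shift Q.T.pos[j] → P.ν i = Q.ν j := by
  intro P hP Q hQ i hi j hj heq
  by_cases hPQ : P = Q
  · subst hPQ
    have := (List.Nodup.getElem_inj_iff (valid_of_mem hP).2.1).1 (P.shift_injective heq)
    subst this; rfl
  · obtain ⟨hin, hnc⟩ := (valid_of_mem hQ).1 _ (List.getElem_mem hj)
    refine (meet_placements hN hN3 hodd hP hQ hPQ (Q.shift Q.T.pos[j]) ?_ (Q.box_shift.2 hin) ?_).1 i hi j hj heq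
    · rw [← heq]; exact P.box_shift.2 ((valid_of_mem hP).1 _ (List.getElem_mem hi)).1
    · simpa [Placement.shift] using hnc

/-- **A vertex of a placed tile inside another placed tile's box is a vertex of that tile too.** [folklore] -/
theorem crosslist_placements (hN : 0 < N φ) (hN3 : N φ = 3 * T φ + 1) (hodd : N φ % 2 = 1) :
    ∀ P ∈ placements φ, ∀ Q ∈ placements φ, ∀ j (hj : j < Q.T.nv), P.Box (Q.shift Q.T.pos[j]) →
      ∃ i, ∃ hi : i < P.T.nv, P.shift P.T.pos[i] = Q.shift Q.T.pos[j] := by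
  intro P hP Q hQ j hj hbox
  by_cases hPQ : P = Q
  · subst hPQ; exact ⟨j, hj, rfl⟩
  · obtain ⟨hin, hnc⟩ := (valid_of_mem hQ).1 _ (List.getElem_mem hj)
    exact (meet_placements hN hN3 hodd hP hQ hPQ (Q.shift Q.T.pos[j]) hbox (Q.box_shift.2 hin)
      (by simpa [Placement.shift] using hnc)).2.1 j hj hbox

/-! ### Keys of the descriptors: bookkeeping -/

/-- The tile of a descriptor's placement. [folklore] -/
theorem PD.pl_T (pd : PD) : (pd.pl φ).T = (match pd with
    | .dummy c => dTile φ c | .site r s => sTile φ r s | .k0 => k0Tile (FormulaCells.polOf φ 0)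
    | .clause t => clauseTile (cPols φ t).1 (cPols φ t).2.1 (cPols φ t).2.2 | .z => zTile) := by
  cases pd <;> rfl

/-- **The key facts of a well-formed descriptor**: keys distinct and as many as vertices, every key
home or away (not both), all home and away keys present. [folklore] -/
theorem PD.keys {pd : PD} (hwf : pd.WF φ) :
    (pd.num φ).Nodup ∧ (pd.num φ).length = (pd.pl φ).T.nv ∧ (∀ k ∈ pd.num φ, k ∈ pd.home φ ∨ k ∈ pd.away φ) ∧
      (∀ k ∈ pd.home φ, k ∈ pd.num φ) ∧ (∀ k ∈ pd.away φ, k ∈ pd.num φ) ∧ (∀ k ∈ pd.home φ, k ∉ pd.away φ) := by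
  cases pd with
  | dummy c =>
    obtain ⟨h1, h2, h3, h4, h5, h6⟩ := dummy_keys (decide (c = 0)) (decide (c + 1 = N φ)) (prev? φ c).isNone
    exact ⟨h1, h2, h3, h4, h5, h6⟩
  | site r s =>
    obtain ⟨h1, h3, h4, h5, h6⟩ := site_keys _ _ _ _ _ (siteOK_flags (s := s) hwf.1)
    exact ⟨h1, siteNum_length (sF1 s) (sF2 φ s) (sF3 φ r s) (sF4 φ r s) (sF5 φ r s) (sMir r), h3, h4, h5, h6⟩
  | k0 =>
    obtain ⟨-, h1, h2, h3, h4, h5, h6⟩ := k0_facts (FormulaCells.polOf φ 0)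
    refine ⟨h1, h2, fun k hk => (h3 k hk).imp id (fun h => List.mem_singleton.2 h), h4,
      fun k hk => by rw [PD.away, List.mem_singleton] at hk; subst hk; exact h5,
      fun k hk ha => by rw [PD.away, List.mem_singleton] at ha; subst ha; exact h6 hk⟩
  | clause t =>
    obtain ⟨-, h1, h2, h3, h4, h5, h6⟩ := clause_facts (cPols φ t).1 (cPols φ t).2.1 (cPols φ t).2.2
    refine ⟨h1, h2, fun k hk => (h3 k hk).imp id (fun h => List.mem_singleton.2 h), h4,
      fun k hk => by rw [PD.away, List.mem_singleton] at hk; subst hk; exact h5,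
      fun k hk ha => by rw [PD.away, List.mem_singleton] at ha; subst ha; exact h6 hk⟩
  | z =>
    obtain ⟨-, h1, h2, h3, h4⟩ := z_facts
    refine ⟨h1, h2, fun k hk => Or.inl ?_, fun k hk => ?_, fun k hk => (List.not_mem_nil hk).elim, fun k _ hk => List.not_mem_nil hk⟩
    · obtain ⟨h0, hd⟩ := h3 k hk
      simp only [PD.home, List.mem_map, List.mem_range]
      exact ⟨k.2, hd, by rw [← h0]⟩
    · simp only [PD.home, List.mem_map, List.mem_range] at hk
      obtain ⟨d, hd, rfl⟩ := hk
      exact h4 d hd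

/-- Index of a listed key. [folklore] -/
theorem idxOf_getD {l : List (ℕ × ℕ)} (hl : l.Nodup) {i : ℕ} (hi : i < l.length) : l.idxOf (l.getD i (0, 0)) = i := by
  rw [List.getD_eq_getElem _ _ hi]
  have hlt : l.idxOf l[i] < l.length := List.idxOf_lt_length_iff.2 (List.getElem_mem hi)
  exact (List.Nodup.getElem_inj_iff hl).1 (List.getElem_idxOf hlt)

/-- Listed keys determine their index. [folklore] -/
theorem getD_inj {l : List (ℕ × ℕ)} (hl : l.Nodup) {i j : ℕ} (hi : i < l.length) (hj : j < l.length)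
    (h : l.getD i (0, 0) = l.getD j (0, 0)) : i = j := by
  rw [List.getD_eq_getElem _ _ hi, List.getD_eq_getElem _ _ hj] at h
  exact (List.Nodup.getElem_inj_iff hl).1 h

/-! ### Global positions of the local vertices -/

/-- **The global position of a home key is where its tile draws it.** [folklore] -/
theorem gpos_home (hN3 : N φ = 3 * T φ + 1) {pd : PD} (hwf : pd.WF φ) {i : ℕ} (hi : i < (pd.pl φ).T.nv)
    (hk : (pd.num φ).getD i (0, 0) ∈ pd.home φ) : gpos φ ((pd.pl φ).ν i) = (pd.pl φ).shift (pd.pl φ).T.pos[i] := by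
  obtain ⟨hnd, hlen, -⟩ := PD.keys (φ := φ) hwf
  rw [PD.pl_ν, gpos, homeOf_home hN3 hwf hk]
  dsimp only
  rw [idxOf_getD hnd (by rw [hlen]; exact hi), List.getD_eq_getElem _ _ hi]

/-- **The global position of an away key through its port**: tile `X` lists key `kX` at `pX`, the
neighbour `Y` lists the home key `kY` at `pY`, same global vertex, same global point. [folklore] -/
theorem gpos_port (hN3 : N φ = 3 * T φ + 1) {pdX pdY : PD} (hwfX : pdX.WF φ) (hwfY : pdY.WF φ)
    {TX TY : List ((ℕ × ℕ) × GridPoint)}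
    (bdX' : ∀ e ∈ TX, e ∈ bdryInv (pdX.pl φ).T (pdX.num φ)) (bdY' : ∀ e ∈ TY, e ∈ bdryInv (pdY.pl φ).T (pdY.num φ))
    {kX kY : ℕ × ℕ} {pX pY : GridPoint} (hTX : (kX, pX) ∈ TX) (hTY : (kY, pY) ∈ TY) (hhome : kY ∈ pdY.home φ)
    (hν : pdX.ν φ kX = pdY.ν φ kY) (hpos : (pdX.pl φ).shift pX = (pdY.pl φ).shift pY)
    {i : ℕ} (hi : i < (pdX.pl φ).T.nv) (hk : (pdX.num φ).getD i (0, 0) = kX) :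
    gpos φ ((pdX.pl φ).ν i) = (pdX.pl φ).shift (pdX.pl φ).T.pos[i] := by
  obtain ⟨ndX, lenX, -⟩ := PD.keys (φ := φ) hwfX
  obtain ⟨ndY, lenY, -⟩ := PD.keys (φ := φ) hwfY
  obtain ⟨j, hj, -, he⟩ := mem_bdryInv.1 (bdY' _ hTY)
  simp only [Prod.mk.injEq] at he
  obtain ⟨i', hi', -, he'⟩ := mem_bdryInv.1 (bdX' _ hTX)
  simp only [Prod.mk.injEq] at he'
  have hii : i = i' := getD_inj ndX (by rw [lenX]; exact hi) (by rw [lenX]; exact hi') (by rw [hk, he'.1])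
  subst hii
  rw [PD.pl_ν, hk, hν, gpos, homeOf_home hN3 hwfY hhome]
  dsimp only
  rw [he.1, idxOf_getD ndY (by rw [lenY]; exact hj), ← he.2, ← hpos, ← List.getD_eq_getElem _ (0, 0) hi, he'.2]

/-- **The global position of an away key listed first in a port.** [folklore] -/
theorem gpos_port_P (hN3 : N φ = 3 * T φ + 1) {pdP pdQ : PD} (hwfP : pdP.WF φ) (hwfQ : pdQ.WF φ)
    {ps : List Port} {TP TQ : List ((ℕ × ℕ) × GridPoint)} {faceP faceQ : GridPoint → Bool} {shift : GridPoint → GridPoint}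
    {homeP awayP homeQ awayQ : List (ℕ × ℕ)}
    (hok : portOK ps TP TQ faceP faceQ shift homeP awayP homeQ awayQ = true)
    (bdP' : ∀ e ∈ TP, e ∈ bdryInv (pdP.pl φ).T (pdP.num φ)) (bdQ' : ∀ e ∈ TQ, e ∈ bdryInv (pdQ.pl φ).T (pdQ.num φ))
    (hport : ∀ π ∈ ps, pdP.ν φ π.1 = pdQ.ν φ π.2.1 ∧ (pdP.pl φ).shift π.2.2.1 = (pdQ.pl φ).shift π.2.2.2)
    (hhP : ∀ k ∈ homeP, k ∈ pdP.home φ) (hhQ : ∀ k ∈ homeQ, k ∈ pdQ.home φ)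
    {π : Port} (hπ : π ∈ ps) (haway : π.1 ∈ pdP.away φ) {i : ℕ} (hi : i < (pdP.pl φ).T.nv) (hk : (pdP.num φ).getD i (0, 0) = π.1) :
    gpos φ ((pdP.pl φ).ν i) = (pdP.pl φ).shift (pdP.pl φ).T.pos[i] := by
  obtain ⟨hTP, hTQ, -, hha⟩ := (portOK_spec hok).2.2.1 π hπ
  rcases hha with ⟨hh, -⟩ | ⟨-, hh⟩
  · exact absurd haway ((PD.keys hwfP).2.2.2.2.2 _ (hhP _ hh))
  · exact gpos_port hN3 hwfP hwfQ bdP' bdQ' hTP hTQ (hhQ _ hh) (hport π hπ).1 (hport π hπ).2 hi hk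

/-- **The global position of an away key listed second in a port.** [folklore] -/
theorem gpos_port_Q (hN3 : N φ = 3 * T φ + 1) {pdP pdQ : PD} (hwfP : pdP.WF φ) (hwfQ : pdQ.WF φ)
    {ps : List Port} {TP TQ : List ((ℕ × ℕ) × GridPoint)} {faceP faceQ : GridPoint → Bool} {shift : GridPoint → GridPoint}
    {homeP awayP homeQ awayQ : List (ℕ × ℕ)}
    (hok : portOK ps TP TQ faceP faceQ shift homeP awayP homeQ awayQ = true)
    (bdP' : ∀ e ∈ TP, e ∈ bdryInv (pdP.pl φ).T (pdP.num φ)) (bdQ' : ∀ e ∈ TQ, e ∈ bdryInv (pdQ.pl φ).T (pdQ.num φ))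
    (hport : ∀ π ∈ ps, pdP.ν φ π.1 = pdQ.ν φ π.2.1 ∧ (pdP.pl φ).shift π.2.2.1 = (pdQ.pl φ).shift π.2.2.2)
    (hhP : ∀ k ∈ homeP, k ∈ pdP.home φ) (hhQ : ∀ k ∈ homeQ, k ∈ pdQ.home φ)
    {π : Port} (hπ : π ∈ ps) (haway : π.2.1 ∈ pdQ.away φ) {j : ℕ} (hj : j < (pdQ.pl φ).T.nv) (hk : (pdQ.num φ).getD j (0, 0) = π.2.1) :
    gpos φ ((pdQ.pl φ).ν j) = (pdQ.pl φ).shift (pdQ.pl φ).T.pos[j] := by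
  obtain ⟨hTP, hTQ, -, hha⟩ := (portOK_spec hok).2.2.1 π hπ
  rcases hha with ⟨hh, -⟩ | ⟨-, hh⟩
  · exact gpos_port hN3 hwfQ hwfP bdQ' bdP' hTQ hTP (hhP _ hh) (hport π hπ).1.symm (hport π hπ).2.symm hj hk
  · exact absurd haway ((PD.keys hwfQ).2.2.2.2.2 _ (hhQ _ hh))

/-! ### Bounds of the numbering -/

/-- `c N + r < N²`. [folklore] -/
theorem cN_lt {c r : ℕ} (hc : c < N φ) (hr : r < N φ) : c * N φ + r + 1 ≤ N φ * N φ := by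
  calc c * N φ + r + 1 ≤ c * N φ + N φ := by omega
    _ = (c + 1) * N φ := by ring
    _ ≤ N φ * N φ := Nat.mul_le_mul_right _ hc

/-- **The global vertices of a site's keys are vertices.** [folklore] -/
theorem ν_lt_site {r s : ℕ} (hr : r < N φ) (hs : s < N φ) {k : ℕ × ℕ} (hk : k ∈ (PD.site r s).num φ) :
    (PD.site r s).ν φ k < totalV φ := by
  have hb12 := base1_le_base2 (φ := φ)
  have hJ := J_lt (φ := φ) (r := r) hs
  have hcN := cN_lt (φ := φ) hJ hr
  obtain ⟨-, -, hha, -⟩ := PD.keys (φ := φ) (pd := .site r s) ⟨hr, hs⟩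
  have htot : base2 φ + 60 * (N φ * N φ) + 24 * N φ = totalV φ := rfl
  rcases hha k hk with hk | hk
  · simp only [PD.home, siteHome, List.mem_append, List.mem_map, List.mem_range, List.mem_filter, List.mem_ite_nil_left,
      List.mem_ite_nil_right, decide_eq_true_eq, Bool.or_eq_true, Bool.and_eq_true] at hk
    simp only [PD.ν]
    rcases hk with (((((((⟨d, hd, rfl⟩ | ⟨-, d, hd, rfl⟩) | ⟨d, ⟨hd, -⟩, rfl⟩) | ⟨-, d, hd, rfl⟩) | ⟨-, d, hd, rfl⟩) |
      ⟨d, ⟨hd, -⟩, rfl⟩) | ⟨d, hd, rfl⟩) | ⟨-, d, ⟨hd, -⟩, rfl⟩) | ⟨-, d, hd, rfl⟩ <;> simp only [siteAnchor]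
    · have := five_cell_lt_base1 φ (rowCell_lt_M hr (k := 2 * s + 1) (by omega)); unfold blIdx rowCell at this ⊢; omega
    · have := five_cell_lt_base1 φ (rowCell_lt_M hr (k := 2 * s + 2) (by omega)); unfold blIdx rowCell at this ⊢; omega
    · have := dlBase_add_lt_base2 (φ := φ) hr hs; omega
    · have := dlBase_add_lt_base2 (φ := φ) hr hs; omega
    · have := dlBase_add_lt_base2 (φ := φ) hr (show s - 1 < N φ by omega); omega
    · omega
    · split_ifs with h1
      · have := cN_lt (φ := φ) hJ h1; omega
      · omega
    · unfold setBase; omega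
    · unfold setBase; omega
  · simp only [PD.away, siteAway, List.mem_append, List.mem_map, List.mem_range, List.mem_ite_nil_left, List.mem_ite_nil_right] at hk
    simp only [PD.ν]
    rcases hk with ((hk | ⟨-, d, hd, rfl⟩) | ⟨d, hd, rfl⟩) | ⟨-, d, hd, rfl⟩
    · by_cases hl : sF2 φ s = true <;> simp only [hl, if_true, if_false, Bool.false_eq_true, List.mem_singleton] at hk <;> subst hk <;>
        simp only [siteAnchor]
      · split_ifs with h1
        · have := five_cell_lt_base1 φ (rowCell_lt_M h1 (k := 2 * 0) (by omega)); unfold blIdx; omega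
        · have := five_cell_lt_base1 φ (kIdx_lt_M (φ := φ) (c := 0) (by omega)); omega
      · have := five_cell_lt_base1 φ (rowCell_lt_M hr (k := 2 * s + 2) (by omega)); unfold blIdx rowCell at this ⊢; omega
    · simp only [siteAnchor]
      have := dlBase_add_lt_base2 (φ := φ) hr (show s - 1 < N φ by omega); omega
    · simp only [siteAnchor]
      split_ifs with h1
      · have := cN_lt (φ := φ) hJ h1; omega
      · omega
    · simp only [siteAnchor]
      unfold setBase; omega

/-- **The global vertices of a dummy pair's keys are vertices.** [folklore] -/
theorem ν_lt_dummy {c : ℕ} (hc : c < N φ) {k : ℕ × ℕ} (hk : k ∈ (PD.dummy c).num φ) : (PD.dummy c).ν φ k < totalV φ := by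
  have hb12 := base1_le_base2 (φ := φ)
  have hcN := cN_lt (φ := φ) hc hc
  obtain ⟨-, -, hha, -⟩ := PD.keys (φ := φ) (pd := .dummy c) hc
  have htot : base2 φ + 60 * (N φ * N φ) + 24 * N φ = totalV φ := rfl
  have hM : 2 * c + 1 < M φ := by unfold M; omega
  have h5 := five_cell_lt_base1 φ hM
  rcases hha k hk with hk | hk
  · simp only [PD.home, dummyHome, List.mem_append, List.mem_map, List.mem_range, List.mem_ite_nil_right] at hk
    simp only [PD.ν]
    rcases hk with ((⟨d, hd, rfl⟩ | ⟨d, hd, rfl⟩) | ⟨d, hd, rfl⟩) | ⟨-, d, hd, rfl⟩ <;> simp only [dummyAnchor]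
    · omega
    · unfold pinBase; omega
    · omega
    · unfold setBase; omega
  · simp only [PD.away, dummyAway, List.mem_append, List.mem_map, List.mem_range] at hk
    simp only [PD.ν]
    rcases hk with hk | ⟨d, hd, rfl⟩
    · by_cases hl : decide (c + 1 = N φ) = true <;>
        simp only [hl, if_true, if_false, Bool.false_eq_true, List.mem_singleton] at hk <;> subst hk <;> simp only [dummyAnchor]
      · have := five_cell_lt_base1 φ (rowCell_lt_M (φ := φ) (r := 0) (k := 2 * 0) (by omega) (by omega)); unfold blIdx; omega
      · omega
    · simp only [dummyAnchor]; omega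

/-- **The global vertices of the keys of the clause row are vertices.** [folklore] -/
theorem ν_lt_krow (hN : 0 < N φ) :
    (∀ k ∈ PD.k0.num φ, PD.k0.ν φ k < totalV φ) ∧ (∀ t < T φ, ∀ k ∈ (PD.clause t).num φ, (PD.clause t).ν φ k < totalV φ) ∧
      ∀ k ∈ PD.z.num φ, PD.z.ν φ k < totalV φ := by
  have hb12 := base1_le_base2 (φ := φ)
  have hc12 := clause1Base_le_base2 (φ := φ)
  have htot : base2 φ + 60 * (N φ * N φ) + 24 * N φ = totalV φ := rfl
  refine ⟨fun k hk => ?_, fun t ht k hk => ?_, fun k hk => ?_⟩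
  · obtain ⟨-, -, hha, -⟩ := PD.keys (φ := φ) (pd := .k0) trivial
    have h5 := five_cell_lt_base1 φ (kIdx_lt_M (φ := φ) (c := 0) hN)
    rcases hha k hk with hk | hk
    · simp only [PD.home, k0Home, List.mem_append, List.mem_map, List.mem_range] at hk
      simp only [PD.ν]
      rcases hk with (⟨d, hd, rfl⟩ | ⟨d, hd, rfl⟩) | ⟨d, hd, rfl⟩ <;> simp only [k0Anchor]
      · omega
      · unfold klinkBase; omega
      · omega
    · simp only [PD.away, List.mem_singleton] at hk
      subst hk
      simp only [PD.ν, k0Anchor]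
      have h5' := five_cell_lt_base1 φ (zIdx_lt (φ := φ))
      unfold kIdx; unfold zIdx at h5'; omega
  · obtain ⟨-, -, hha, -⟩ := PD.keys (φ := φ) (pd := .clause t) ht
    rcases hha k hk with hk | hk
    · simp only [PD.home, clauseHome, List.mem_append, List.mem_map, List.mem_range, List.mem_filter] at hk
      simp only [PD.ν]
      rcases hk with (⟨d, hd, rfl⟩ | ⟨d, ⟨hd, -⟩, rfl⟩) | ⟨d, hd, rfl⟩ <;> simp only [clauseAnchor]
      · have h5 := five_cell_lt_base1 φ (kIdx_lt_M (φ := φ) (c := 3 * t + 3) (by unfold T at ht; omega)); unfold kIdx at h5 ⊢; omega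
      · unfold klinkBase; unfold T at ht; omega
      · unfold or3Base; unfold base2 at htot; omega
    · simp only [PD.away, List.mem_singleton] at hk
      subst hk
      simp only [PD.ν, clauseAnchor]
      have h5 := five_cell_lt_base1 φ (zIdx_lt (φ := φ))
      unfold kIdx; unfold zIdx at h5; unfold T at ht; omega
  · obtain ⟨-, -, hha, -⟩ := PD.keys (φ := φ) (pd := .z) trivial
    rcases hha k hk with hk | hk
    · simp only [PD.home, List.mem_map, List.mem_range] at hk
      obtain ⟨d, hd, rfl⟩ := hk
      simp only [PD.ν]
      have h5 := five_cell_lt_base1 φ (zIdx_lt (φ := φ)); omega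
    · simp [PD.away] at hk

/-- **Every key of a well-formed descriptor names a vertex.** [folklore] -/
theorem PD.ν_lt (hN : 0 < N φ) {pd : PD} (hwf : pd.WF φ) {k : ℕ × ℕ} (hk : k ∈ pd.num φ) : pd.ν φ k < totalV φ := by
  cases pd with
  | dummy c => exact ν_lt_dummy hwf hk
  | site r s => exact ν_lt_site hwf.1 hwf.2 hk
  | k0 => exact (ν_lt_krow hN).1 k hk
  | clause t => exact (ν_lt_krow hN).2.1 t hwf k hk
  | z => exact (ν_lt_krow hN).2.2 k hk

/-! ### Global positions: every local vertex is drawn where `gpos` puts it -/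

section poseq

/-- Port membership: chain exit. [folklore] -/
theorem mem_hsPorts_head (s0 m : Bool) :
    (((0, 10), (0, 0), mx m ((56 : ℤ), (20 : ℤ)), mx m ((56 : ℤ) - 56, (20 : ℤ))) : Port) ∈ hsPorts s0 m := by
  unfold hsPorts; exact List.mem_map.2 ⟨_, List.mem_append_left _ List.mem_cons_self, rfl⟩

/-- Port membership: `q`-vertices. [folklore] -/
theorem mem_hsPorts_q (s0 m : Bool) {k : ℕ} (hk : k < 4) :
    (((2, 11 + 4 * k), (3, 11 + 4 * k), mx m ((56 : ℤ), Yd k), mx m ((56 : ℤ) - 56, Yd k)) : Port) ∈ hsPorts s0 m := by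
  unfold hsPorts
  exact List.mem_map.2 ⟨_, List.mem_append_left _ (List.mem_cons_of_mem _ (List.mem_map.2 ⟨k, List.mem_range.2 hk, rfl⟩)), rfl⟩

/-- Port membership: set midpoints. [folklore] -/
theorem mem_hsPorts_set (m : Bool) {i : ℕ} (hi : i < 4) :
    (((6, 8 + i), (6, 8 + i), mx m ((56 : ℤ), (12 : ℤ) + 2 * (i : ℤ)), mx m ((56 : ℤ) - 56, (12 : ℤ) + 2 * (i : ℤ))) : Port) ∈
      hsPorts true m := by
  unfold hsPorts
  exact List.mem_map.2 ⟨_, List.mem_append_right _ (by rw [if_pos rfl]; exact List.mem_map.2 ⟨i, List.mem_range.2 hi, rfl⟩), rfl⟩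

/-- Port membership: exit-ladder midpoints. [folklore] -/
theorem mem_vsPorts_mid (l m : Bool) {i : ℕ} (hi : i < 4) :
    (((5, 8 + i), (4, 8 + i), ((if m then (20 : ℤ) + 2 * (i : ℤ) else (36 : ℤ) - 2 * (i : ℤ)), (0 : ℤ)),
      ((if m then (20 : ℤ) + 2 * (i : ℤ) else (36 : ℤ) - 2 * (i : ℤ)), (100 : ℤ))) : Port) ∈ vsPorts l m := by
  unfold vsPorts; exact List.mem_append_left _ (List.mem_map.2 ⟨i, List.mem_range.2 hi, rfl⟩)

/-- Port membership: entry of the next row. [folklore] -/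
theorem mem_vsPorts_xc (m : Bool) :
    (((1, 0), (0, 0), ((if m then (6 : ℤ) else 50), (0 : ℤ)), ((if m then (6 : ℤ) else 50), (100 : ℤ))) : Port) ∈ vsPorts true m := by
  unfold vsPorts; exact List.mem_append_right _ (by rw [if_pos rfl]; exact List.mem_singleton_self _)

/-- Port membership: exit-ladder midpoints of a dummy pair. [folklore] -/
theorem mem_dvPorts_mid (l : Bool) {i : ℕ} (hi : i < 4) :
    (((3, 8 + i), (4, 8 + i), ((36 : ℤ) - 2 * (i : ℤ), (0 : ℤ)), ((36 : ℤ) - 2 * (i : ℤ), (100 : ℤ))) : Port) ∈ dvPorts l := by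
  unfold dvPorts; exact List.mem_append_left _ (List.mem_map.2 ⟨i, List.mem_range.2 hi, rfl⟩)

/-- Port membership: entry of row `0`. [folklore] -/
theorem mem_dvPorts_xc : (((1, 0), (0, 0), ((50 : ℤ), (0 : ℤ)), ((50 : ℤ), (100 : ℤ))) : Port) ∈ dvPorts true := by
  unfold dvPorts; exact List.mem_append_right _ (by rw [if_pos rfl]; exact List.mem_singleton_self _)

/-- Port membership: clause-link midpoints of column `0`. [folklore] -/
theorem mem_sk0Ports_mid {i : ℕ} (hi : i < 4) :
    (((5, 8 + i), (1, 8 + i), ((20 : ℤ) + 2 * (i : ℤ), (0 : ℤ)), ((20 : ℤ) + 2 * (i : ℤ), (60 : ℤ))) : Port) ∈ sk0Ports := by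
  unfold sk0Ports; exact List.mem_append_left _ (List.mem_map.2 ⟨i, List.mem_range.2 hi, rfl⟩)

/-- Port membership: entry of the clause row. [folklore] -/
theorem mem_sk0Ports_xc : (((1, 0), (0, 0), ((6 : ℤ), (0 : ℤ)), ((6 : ℤ), (60 : ℤ))) : Port) ∈ sk0Ports := by
  unfold sk0Ports; exact List.mem_append_right _ (List.mem_singleton_self _)

/-- Port membership: clause-link midpoints under a clause tile. [folklore] -/
theorem mem_sclPorts (u : ℕ) {i : ℕ} (hi : i < 4) :
    (((5, 8 + i), (1, 12 * u + 8 + i), ((20 : ℤ) + 2 * (i : ℤ), (0 : ℤ)), ((56 : ℤ) * (u : ℤ) + 20 + 2 * (i : ℤ), (60 : ℤ))) : Port) ∈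
      sclPorts u := by
  unfold sclPorts; exact List.mem_map.2 ⟨i, List.mem_range.2 hi, rfl⟩

/-- The `i`-th key of a well-formed descriptor is a key of it. [folklore] -/
theorem PD.getD_mem {pd : PD} (hwf : pd.WF φ) {i : ℕ} (hi : i < (pd.pl φ).T.nv) : (pd.num φ).getD i (0, 0) ∈ pd.num φ := by
  rw [List.getD_eq_getElem _ _ (by rw [(PD.keys hwf).2.1]; exact hi)]
  exact List.getElem_mem _

/-- Away keys of a site: the entry of the next row. [folklore] -/
theorem away_xc {r s : ℕ} (hl : sF2 φ s = true) : (1, 0) ∈ (PD.site r s).away φ := by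
  simp only [PD.away, siteAway, hl, if_true, List.mem_append, List.mem_singleton, true_or]

/-- Away keys of a site: the chain exit. [folklore] -/
theorem away_exit {r s : ℕ} (hl : sF2 φ s = false) : (0, 10) ∈ (PD.site r s).away φ := by
  simp only [PD.away, siteAway, hl, Bool.false_eq_true, if_false, List.mem_append, List.mem_singleton, true_or]

/-- Away keys of a site: the `q`-vertices of the previous diamond ladder. [folklore] -/
theorem away_q {r s : ℕ} (hf : sF1 s = false) {k : ℕ} (hk : k < 4) : (3, 11 + 4 * k) ∈ (PD.site r s).away φ := by
  simp only [PD.away, siteAway, hf, Bool.false_eq_true, if_false, List.mem_append, List.mem_map, List.mem_range]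
  exact Or.inl (Or.inl (Or.inr ⟨k, hk, rfl⟩))

/-- Away keys of a site: the midpoints of the exit ladder. [folklore] -/
theorem away_mid {r s j : ℕ} (hj : j < 4) : (5, 8 + j) ∈ (PD.site r s).away φ := by
  simp only [PD.away, siteAway, List.mem_append, List.mem_map, List.mem_range]
  exact Or.inl (Or.inr ⟨j, hj, rfl⟩)

/-- Away keys of a site: the midpoints of the set ladder at its second rail. [folklore] -/
theorem away_set {r s j : ℕ} (h5 : sF5 φ r s = true) (hj : j < 4) : (6, 8 + j) ∈ (PD.site r s).away φ := by
  simp only [PD.away, siteAway, h5, if_true, List.mem_append, List.mem_map, List.mem_range]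
  exact Or.inr ⟨j, hj, rfl⟩

/-- **Sites: every local vertex is drawn at its global position.** [folklore] -/
theorem pos_eq_site (hN : 0 < N φ) (hN3 : N φ = 3 * T φ + 1) (hodd : N φ % 2 = 1) {r s : ℕ} (hr : r < N φ) (hs : s < N φ)
    {i : ℕ} (hi : i < (sitePl φ r s).T.nv) : gpos φ ((sitePl φ r s).ν i) = (sitePl φ r s).shift (sitePl φ r s).T.pos[i] := by
  have hwf : (PD.site r s).WF φ := ⟨hr, hs⟩
  have hk := PD.getD_mem (φ := φ) hwf hi
  rcases (PD.keys hwf).2.2.1 _ hk with hh | ha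
  · exact gpos_home hN3 hwf hi hh
  simp only [PD.away, siteAway, List.mem_append, List.mem_map, List.mem_range, List.mem_ite_nil_left, List.mem_ite_nil_right] at ha
  rcases ha with ((ha | ⟨hf, k, hk4, hk⟩) | ⟨j, hj4, hk⟩) | ⟨h5, j, hj4, hk⟩
  · -- the chain exit `(0, 10)`, or (last site) the entry `(1, 0)` of the next row
    by_cases hl : sF2 φ s = true <;> simp only [hl, if_true, if_false, Bool.false_eq_true, List.mem_singleton] at ha
    · have hsN : s + 1 = N φ := by simpa [sF2] using hl
      by_cases h1 : r + 1 < N φ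
      · -- the site below
        set c := J φ r s with hcdef
        have hc : c < N φ := J_lt hs
        have hsc : J φ r c = s := J_J hs
        obtain ⟨hfv, hmv⟩ := flags_vert (φ := φ) (r := r) hc
        have hl' : sF2 φ (J φ r c) = true := by rw [hsc]; exact hl
        obtain ⟨-, bdQ'⟩ := site_bd (φ := φ) (s := J φ (r + 1) c) h1
        rw [hfv, hmv] at bdQ'
        -- restate in terms of the column (`subst`, not `rw`: `hi` occurs in the goal's `pos[i]`)
        clear_value c; subst hsc
        exact gpos_port_P hN3 (pdP := .site r (J φ r c)) (pdQ := .site (r + 1) (J φ (r + 1) c)) ⟨hr, J_lt hc⟩ ⟨h1, J_lt hc⟩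
          (vs_ports _ _ _ _ _ _ _ _ _ _) (site_bd hr).2 bdQ' (port_vs h1 hc) (fun k h => h)
          (fun k h => by rw [PD.home, hfv]; exact h) (by rw [hl']; exact mem_vsPorts_xc _) (away_xc hl') hi ha
      · -- the tile of `K_0` below
        obtain rfl : r = N φ - 1 := by omega
        obtain rfl : s = N φ - 1 := by omega
        obtain ⟨-, bdP'⟩ := site_bd (φ := φ) (s := N φ - 1) hr
        rw [hl, sMir_last hodd] at bdP'
        obtain ⟨⟨-, bdQ'⟩, -⟩ := k0_facts (FormulaCells.polOf φ 0)
        exact gpos_port_P hN3 (pdP := .site (N φ - 1) (N φ - 1)) (pdQ := .k0) ⟨hr, hr⟩ trivial (sk0_ports _ _ _ _) bdP' bdQ'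
          (port_sk0 hN hodd) (fun k h => by rw [PD.home, hl]; exact h) (fun k h => h) mem_sk0Ports_xc (away_xc hl) hi ha
    · -- the next site of the row
      have hs1 : s + 1 < N φ := by simp [sF2] at hl; omega
      obtain ⟨hf', hl0, h51⟩ := flags_succ (φ := φ) (r := r) hs1
      obtain ⟨-, bdP'⟩ := site_bd (φ := φ) (s := s) hr
      obtain ⟨-, bdQ'⟩ := site_bd (φ := φ) (s := s + 1) hr
      rw [hl0] at bdP'
      rw [hf', h51] at bdQ'
      exact gpos_port_P hN3 (pdP := .site r s) (pdQ := .site r (s + 1)) hwf ⟨hr, hs1⟩ (hs_ports _ _ _ _ _ _ _ _) bdP' bdQ' (port_hs hs1)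
        (fun k h => by rw [PD.home, hl0]; exact h) (fun k h => by rw [PD.home, hf', h51]; exact h) (mem_hsPorts_head _ _)
        (away_exit hl0) hi ha
  · -- a `q`-vertex of the previous site's diamond ladder
    have hf0 : 1 ≤ s := by simp [sF1] at hf; omega
    obtain ⟨s, rfl⟩ : ∃ s', s = s' + 1 := ⟨s - 1, by omega⟩
    obtain ⟨hf', hl0, h51⟩ := flags_succ (φ := φ) (r := r) hs
    obtain ⟨-, bdP'⟩ := site_bd (φ := φ) (s := s) hr
    obtain ⟨-, bdQ'⟩ := site_bd (φ := φ) (s := s + 1) hr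
    rw [hl0] at bdP'
    rw [hf', h51] at bdQ'
    exact gpos_port_Q hN3 (pdP := .site r s) (pdQ := .site r (s + 1)) ⟨hr, by omega⟩ hwf (hs_ports _ _ _ _ _ _ _ _) bdP' bdQ' (port_hs hs)
      (fun k h => by rw [PD.home, hl0]; exact h) (fun k h => by rw [PD.home, hf', h51]; exact h) (mem_hsPorts_q _ _ hk4)
      (away_q hf' hk4) hi hk.symm
  · -- a midpoint of the exit ladder
    by_cases h1 : r + 1 < N φ
    · set c := J φ r s with hcdef
      have hc : c < N φ := J_lt hs
      have hsc : J φ r c = s := J_J hs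
      obtain ⟨hfv, hmv⟩ := flags_vert (φ := φ) (r := r) hc
      obtain ⟨-, bdQ'⟩ := site_bd (φ := φ) (s := J φ (r + 1) c) h1
      rw [hfv, hmv] at bdQ'
      have ha : (5, 8 + j) ∈ (PD.site r (J φ r c)).away φ := by
        simp only [PD.away, siteAway, List.mem_append, List.mem_map, List.mem_range]
        exact Or.inl (Or.inr ⟨j, hj4, rfl⟩)
      clear_value c; subst hsc
      exact gpos_port_P hN3 (pdP := .site r (J φ r c)) (pdQ := .site (r + 1) (J φ (r + 1) c)) ⟨hr, J_lt hc⟩ ⟨h1, J_lt hc⟩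
        (vs_ports _ _ _ _ _ _ _ _ _ _) (site_bd hr).2 bdQ' (port_vs h1 hc) (fun k h => h)
        (fun k h => by rw [PD.home, hfv]; exact h) (mem_vsPorts_mid _ _ hj4) ha hi hk.symm
    · obtain rfl : r = N φ - 1 := by omega
      set c := J φ (N φ - 1) s with hcdef
      have hc : c < N φ := J_lt hs
      have hsc : J φ (N φ - 1) c = s := J_J hs
      have ha : ∀ s', (5, 8 + j) ∈ (PD.site (N φ - 1) s').away φ := fun s' => by
        simp only [PD.away, siteAway, List.mem_append, List.mem_map, List.mem_range]
        exact Or.inl (Or.inr ⟨j, hj4, rfl⟩)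
      by_cases hc0 : c = 0
      · have hss : s = N φ - 1 := by rw [J_last hodd] at hcdef; omega
        subst hss
        have hl : sF2 φ (N φ - 1) = true := by simp [sF2]; omega
        obtain ⟨-, bdP'⟩ := site_bd (φ := φ) (s := N φ - 1) hr
        rw [hl, sMir_last hodd] at bdP'
        obtain ⟨⟨-, bdQ'⟩, -⟩ := k0_facts (FormulaCells.polOf φ 0)
        exact gpos_port_P hN3 (pdP := .site (N φ - 1) (N φ - 1)) (pdQ := .k0) ⟨hr, hr⟩ trivial (sk0_ports _ _ _ _) bdP' bdQ'
          (port_sk0 hN hodd) (fun k h => by rw [PD.home, hl]; exact h) (fun k h => h) (mem_sk0Ports_mid hj4) (ha _) hi hk.symm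
      · obtain ⟨t, u, hu, hctu⟩ : ∃ t u, u < 3 ∧ c = 3 * t + 1 + u := ⟨(c - 1) / 3, (c - 1) % 3, Nat.mod_lt _ (by omega), by omega⟩
        have ht : t < T φ := by omega
        have hl : sF2 φ (J φ (N φ - 1) c) = false := by rw [J_last hodd]; simp [sF2]; omega
        obtain ⟨-, bdP'⟩ := site_bd (φ := φ) (s := J φ (N φ - 1) c) hr
        rw [hl, sMir_last hodd] at bdP'
        obtain ⟨⟨-, bdQ'⟩, -⟩ := clause_facts (cPols φ t).1 (cPols φ t).2.1 (cPols φ t).2.2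
        clear_value c; subst hsc; subst hctu
        exact gpos_port_P hN3 (pdP := .site (N φ - 1) (J φ (N φ - 1) (3 * t + 1 + u))) (pdQ := .clause t) ⟨hr, J_lt (by omega)⟩ ht
          (scl_ports _ _ _ _ u hu) bdP' bdQ' (port_scl hN (by omega)) (fun k h => by rw [PD.home, hl]; exact h) (fun k h => h)
          (mem_sclPorts u hj4) (ha _) hi hk.symm
  · -- a midpoint of the set ladder, at its second rail
    have h5' : 1 ≤ s := by simp [sF5] at h5; omega
    obtain ⟨s, rfl⟩ : ∃ s', s = s' + 1 := ⟨s - 1, by omega⟩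
    obtain ⟨hf', hl0, h51⟩ := flags_succ (φ := φ) (r := r) hs
    have h4 : sF4 φ r s = true := by rw [← h51]; exact h5
    obtain ⟨-, bdP'⟩ := site_bd (φ := φ) (s := s) hr
    obtain ⟨-, bdQ'⟩ := site_bd (φ := φ) (s := s + 1) hr
    rw [hl0] at bdP'
    rw [hf', h51] at bdQ'
    have ha : (6, 8 + j) ∈ (PD.site r (s + 1)).away φ := by
      simp only [PD.away, siteAway, List.mem_append, List.mem_map, List.mem_range, List.mem_ite_nil_right]
      exact Or.inr ⟨h5, j, hj4, rfl⟩
    have hmem := mem_hsPorts_set (sMir r) hj4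
    rw [← h4] at hmem
    exact gpos_port_Q hN3 (pdP := .site r s) (pdQ := .site r (s + 1)) ⟨hr, by omega⟩ hwf (hs_ports _ _ _ _ _ _ _ _) bdP' bdQ' (port_hs hs)
      (fun k h => by rw [PD.home, hl0]; exact h) (fun k h => by rw [PD.home, hf', h51]; exact h) hmem ha hi hk.symm

/-- **Dummy pairs: every local vertex is drawn at its global position.** [folklore] -/
theorem pos_eq_dummy (hN : 0 < N φ) (hN3 : N φ = 3 * T φ + 1) {c : ℕ} (hc : c < N φ)
    {i : ℕ} (hi : i < (dummyPl φ c).T.nv) : gpos φ ((dummyPl φ c).ν i) = (dummyPl φ c).shift (dummyPl φ c).T.pos[i] := by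
  have hwf : (PD.dummy c).WF φ := hc
  have hk := PD.getD_mem (φ := φ) hwf hi
  rcases (PD.keys hwf).2.2.1 _ hk with hh | ha
  · exact gpos_home hN3 hwf hi hh
  have ha' := ha
  simp only [PD.away, dummyAway, List.mem_append, List.mem_map, List.mem_range] at ha
  rcases ha with ha | ⟨j, hj4, hk⟩
  · by_cases hl : decide (c + 1 = N φ) = true <;> simp only [hl, if_true, if_false, Bool.false_eq_true, List.mem_singleton] at ha
    · -- the entry of row `0`, below the last dummy pair
      have hs := J_lt (φ := φ) (r := 0) hc
      have hf : sF1 (J φ 0 c) = decide (c + 1 = N φ) := by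
        unfold sF1 J; rw [if_neg (by omega)]; exact decide_eq_decide.2 (by omega)
      obtain ⟨-, bdQ'⟩ := site_bd (φ := φ) (s := J φ 0 c) hN
      rw [hf, sMir_zero] at bdQ'
      have hmem := mem_dvPorts_xc
      rw [← hl] at hmem
      rw [ha] at ha'
      exact gpos_port_P hN3 (pdP := .dummy c) (pdQ := .site 0 (J φ 0 c)) hwf ⟨hN, hs⟩
        (dv_ports (decide (c = 0)) (decide (c + 1 = N φ)) (prev? φ c).isNone _ _ _ _)
        (dummy_bdry (decide (c = 0)) (decide (c + 1 = N φ)) (prev? φ c).isNone).2 bdQ' (port_dv hc) (fun k h => h)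
        (fun k h => by rw [PD.home, hf]; exact h) hmem ha' hi ha
    · -- the chain exit, to the next dummy pair
      have hc1 : c + 1 < N φ := by simp at hl; omega
      have hf : decide (c + 1 = 0) = false := by simp
      obtain ⟨-, bdP'⟩ := dummy_bd (φ := φ) c
      obtain ⟨-, bdQ'⟩ := dummy_bd (φ := φ) (c + 1)
      simp only [Bool.not_eq_true] at hl
      rw [hl] at bdP'
      rw [hf] at bdQ'
      rw [ha] at ha'
      exact gpos_port_P hN3 (pdP := .dummy c) (pdQ := .dummy (c + 1)) hwf hc1 (dh_ports _ _ _ _) bdP' bdQ' (port_dh c)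
        (fun k h => h) (fun k h => h) (List.mem_singleton_self _) ha' hi ha
  · -- a midpoint of the exit ladder
    have hs := J_lt (φ := φ) (r := 0) hc
    have hf : sF1 (J φ 0 c) = decide (c + 1 = N φ) := by
      unfold sF1 J; rw [if_neg (by omega)]; exact decide_eq_decide.2 (by omega)
    obtain ⟨-, bdQ'⟩ := site_bd (φ := φ) (s := J φ 0 c) hN
    rw [hf, sMir_zero] at bdQ'
    rw [← hk] at ha'
    exact gpos_port_P hN3 (pdP := .dummy c) (pdQ := .site 0 (J φ 0 c)) hwf ⟨hN, hs⟩
      (dv_ports (decide (c = 0)) (decide (c + 1 = N φ)) (prev? φ c).isNone _ _ _ _)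
      (dummy_bdry (decide (c = 0)) (decide (c + 1 = N φ)) (prev? φ c).isNone).2 bdQ' (port_dv hc) (fun k h => h)
      (fun k h => by rw [PD.home, hf]; exact h) (mem_dvPorts_mid _ hj4) ha' hi hk.symm

/-- **The clause row: every local vertex is drawn at its global position.** [folklore] -/
theorem pos_eq_krow (hN : 0 < N φ) (hN3 : N φ = 3 * T φ + 1) :
    (∀ i (hi : i < (k0Pl φ).T.nv), gpos φ ((k0Pl φ).ν i) = (k0Pl φ).shift (k0Pl φ).T.pos[i]) ∧
    (∀ t < T φ, ∀ i (hi : i < (clausePl φ t).T.nv), gpos φ ((clausePl φ t).ν i) = (clausePl φ t).shift (clausePl φ t).T.pos[i]) ∧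
    (∀ i (hi : i < (zPl φ).T.nv), gpos φ ((zPl φ).ν i) = (zPl φ).shift (zPl φ).T.pos[i]) := by
  refine ⟨fun i hi => ?_, fun t ht i hi => ?_, fun i hi => ?_⟩
  · have hwf : PD.k0.WF φ := trivial
    have hk := PD.getD_mem (φ := φ) hwf hi
    rcases (PD.keys hwf).2.2.1 _ hk with hh | ha
    · exact gpos_home hN3 hwf hi hh
    have ha' := ha
    rw [PD.away, List.mem_singleton] at ha
    rw [ha] at ha'
    obtain ⟨⟨-, bdP'⟩, -⟩ := k0_facts (FormulaCells.polOf φ 0)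
    by_cases hT : 0 < T φ
    · obtain ⟨⟨-, bdQ'⟩, -⟩ := clause_facts (cPols φ 0).1 (cPols φ 0).2.1 (cPols φ 0).2.2
      exact gpos_port_P hN3 (pdP := .k0) (pdQ := .clause 0) hwf hT krow_ports.1 bdP' bdQ' port_kc
        (fun k h => h) (fun k h => h) (List.mem_singleton_self _) ha' hi ha
    · obtain ⟨⟨-, bdQ'⟩, -⟩ := z_facts
      exact gpos_port_P hN3 (pdP := .k0) (pdQ := .z) hwf trivial krow_ports.2.1 bdP' bdQ' (port_kz (by omega))
        (fun k h => h) (fun k h => h) (List.mem_singleton_self _) ha' hi ha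
  · have hwf : (PD.clause t).WF φ := ht
    have hk := PD.getD_mem (φ := φ) hwf hi
    rcases (PD.keys hwf).2.2.1 _ hk with hh | ha
    · exact gpos_home hN3 hwf hi hh
    have ha' := ha
    rw [PD.away, List.mem_singleton] at ha
    rw [ha] at ha'
    obtain ⟨⟨-, bdP'⟩, -⟩ := clause_facts (cPols φ t).1 (cPols φ t).2.1 (cPols φ t).2.2
    by_cases hT : t + 1 < T φ
    · obtain ⟨⟨-, bdQ'⟩, -⟩ := clause_facts (cPols φ (t + 1)).1 (cPols φ (t + 1)).2.1 (cPols φ (t + 1)).2.2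
      exact gpos_port_P hN3 (pdP := .clause t) (pdQ := .clause (t + 1)) hwf hT krow_ports.2.2.1 bdP' bdQ' (port_cc t)
        (fun k h => h) (fun k h => h) (List.mem_singleton_self _) ha' hi ha
    · obtain rfl : t = T φ - 1 := by omega
      obtain ⟨⟨-, bdQ'⟩, -⟩ := z_facts
      exact gpos_port_P hN3 (pdP := .clause (T φ - 1)) (pdQ := .z) hwf trivial krow_ports.2.2.2 bdP' bdQ' (port_cz hN3 (by omega))
        (fun k h => h) (fun k h => h) (List.mem_singleton_self _) ha' hi ha
  · have hwf : PD.z.WF φ := trivial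
    have hk := PD.getD_mem (φ := φ) hwf hi
    rcases (PD.keys hwf).2.2.1 _ hk with hh | ha
    · exact gpos_home hN3 hwf hi hh
    · simp [PD.away] at ha

/-- **Every local vertex of every placed tile is a vertex, drawn at its global position.** [folklore] -/
theorem pos_eq_placements (hN : 0 < N φ) (hN3 : N φ = 3 * T φ + 1) (hodd : N φ % 2 = 1) :
    ∀ P ∈ placements φ, ∀ i (hi : i < P.T.nv), P.ν i < totalV φ ∧ gpos φ (P.ν i) = P.shift P.T.pos[i] := by
  intro P hP i hi
  obtain ⟨pd, hwf, rfl⟩ := exists_pd hP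
  refine ⟨by rw [PD.pl_ν]; exact PD.ν_lt hN hwf (PD.getD_mem hwf hi), ?_⟩
  cases pd with
  | dummy c => exact pos_eq_dummy hN hN3 hwf hi
  | site r s => exact pos_eq_site hN hN3 hodd hwf.1 hwf.2 hi
  | k0 => exact (pos_eq_krow hN hN3).1 i hi
  | clause t => exact (pos_eq_krow hN hN3).2.1 t hwf i hi
  | z => exact (pos_eq_krow hN hN3).2.2 i hi

end poseq

/-! ### Cover: every vertex is a local vertex of some placed tile -/

section cover

/-- Home membership helpers. [folklore] -/
theorem home_site_0 {r s d : ℕ} (hd : d < 10) : (0, d) ∈ (PD.site r s).home φ := by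
  simp only [PD.home, siteHome, List.mem_append, List.mem_map, List.mem_range]
  exact Or.inl (Or.inl (Or.inl (Or.inl (Or.inl (Or.inl (Or.inl (Or.inl ⟨d, hd, rfl⟩)))))))

/-- Home membership helpers. [folklore] -/
theorem home_site_0' {r s d : ℕ} (hl : sF2 φ s = true) (hd : d < 5) : (0, 10 + d) ∈ (PD.site r s).home φ := by
  simp only [PD.home, siteHome, hl, if_true, List.mem_append, List.mem_map, List.mem_range]
  exact Or.inl (Or.inl (Or.inl (Or.inl (Or.inl (Or.inl (Or.inl (Or.inr ⟨d, hd, rfl⟩)))))))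

/-- Home membership helpers. [folklore] -/
theorem home_site_2 {r s d : ℕ} (hd : d < 24) (hd' : d < 4 ∨ 8 ≤ d) : (2, d) ∈ (PD.site r s).home φ := by
  simp only [PD.home, siteHome, List.mem_append, List.mem_map, List.mem_range, List.mem_filter, decide_eq_true_eq]
  exact Or.inl (Or.inl (Or.inl (Or.inl (Or.inl (Or.inl (Or.inr ⟨d, ⟨hd, hd'⟩, rfl⟩))))))

/-- Home membership helpers. [folklore] -/
theorem home_site_2' {r s d : ℕ} (hl : sF2 φ s = true) (hd : d < 4) : (2, 4 + d) ∈ (PD.site r s).home φ := by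
  simp only [PD.home, siteHome, hl, if_true, List.mem_append, List.mem_map, List.mem_range]
  exact Or.inl (Or.inl (Or.inl (Or.inl (Or.inl (Or.inr ⟨d, hd, rfl⟩)))))

/-- Home membership helpers. [folklore] -/
theorem home_site_3 {r s d : ℕ} (hf : sF1 s = false) (hd : d < 4) : (3, 4 + d) ∈ (PD.site r s).home φ := by
  simp only [PD.home, siteHome, hf, Bool.false_eq_true, if_false, List.mem_append, List.mem_map, List.mem_range]
  exact Or.inl (Or.inl (Or.inl (Or.inl (Or.inr ⟨d, hd, rfl⟩))))

/-- Home membership helpers. [folklore] -/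
theorem home_site_4 {r s d : ℕ} (hd : d < 60) (hd' : 4 ≤ d) : (4, d) ∈ (PD.site r s).home φ := by
  simp only [PD.home, siteHome, List.mem_append, List.mem_map, List.mem_range, List.mem_filter, decide_eq_true_eq]
  exact Or.inl (Or.inl (Or.inl (Or.inr ⟨d, ⟨hd, hd'⟩, rfl⟩)))

/-- Home membership helpers. [folklore] -/
theorem home_site_5 {r s d : ℕ} (hd : d < 4) : (5, d) ∈ (PD.site r s).home φ := by
  simp only [PD.home, siteHome, List.mem_append, List.mem_map, List.mem_range]
  exact Or.inl (Or.inl (Or.inr ⟨d, hd, rfl⟩))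

/-- Home membership helpers. [folklore] -/
theorem home_site_6 {r s d : ℕ} (h4 : sF4 φ r s = true) (hd : d < 12) (hd' : d < 4 ∨ 8 ≤ d) : (6, d) ∈ (PD.site r s).home φ := by
  simp only [PD.home, siteHome, h4, if_true, List.mem_append, List.mem_map, List.mem_range, List.mem_filter, decide_eq_true_eq]
  exact Or.inl (Or.inr ⟨d, ⟨hd, hd'⟩, rfl⟩)

/-- Home membership helpers. [folklore] -/
theorem home_site_6' {r s d : ℕ} (h : (sF5 φ r s || (sF4 φ r s && sF2 φ s)) = true) (hd : d < 4) : (6, 4 + d) ∈ (PD.site r s).home φ := by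
  simp only [PD.home, siteHome, h, if_true, List.mem_append, List.mem_map, List.mem_range]
  exact Or.inr ⟨d, hd, rfl⟩

/-- **Every chain vertex is a home key of a placed tile.** [folklore] -/
theorem cover_chain (hN : 0 < N φ) (hN3 : N φ = 3 * T φ + 1) {cell off : ℕ} (hcell : cell < M φ) (hoff : off < 5) :
    ∃ pd : PD, ∃ k, pd.WF φ ∧ k ∈ pd.home φ ∧ pd.ν φ k = 5 * cell + off := by
  by_cases h1 : cell < 2 * N φ
  · refine ⟨.dummy (cell / 2), (0, 5 * (cell % 2) + off), (by show cell / 2 < N φ; omega), ?_, ?_⟩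
    · simp only [PD.home, dummyHome, List.mem_append, List.mem_map, List.mem_range]
      exact Or.inl (Or.inl (Or.inl ⟨_, by omega, rfl⟩))
    · simp only [PD.ν, dummyAnchor]; omega
  by_cases h2 : cell < 2 * N φ + N φ * (2 * N φ + 1)
  · -- a row cell
    set r := (cell - 2 * N φ) / (2 * N φ + 1) with hr
    set k := (cell - 2 * N φ) % (2 * N φ + 1) with hk
    have hdm := Nat.div_add_mod' (cell - 2 * N φ) (2 * N φ + 1)
    have hcell' : cell = rowCell φ r k := by unfold rowCell rowStart; rw [hr, hk]; omega
    have hrN : r < N φ := by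
      by_contra hge
      have := Nat.mul_le_mul_right (2 * N φ + 1) (not_lt.1 hge)
      rw [hr] at this; omega
    have hkN : k ≤ 2 * N φ := by rw [hk]; have := Nat.mod_lt (cell - 2 * N φ) (show 0 < 2 * N φ + 1 by omega); omega
    by_cases h3 : k = 2 * N φ
    · refine ⟨.site r (N φ - 1), (0, 10 + off), ⟨hrN, by omega⟩, home_site_0' (by simp [sF2]; omega) hoff, ?_⟩
      simp only [PD.ν, siteAnchor]; rw [hcell', h3]; unfold blIdx rowCell; omega
    · refine ⟨.site r (k / 2), (0, 5 * (k % 2) + off), ⟨hrN, by omega⟩, home_site_0 (by omega), ?_⟩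
      simp only [PD.ν, siteAnchor]; rw [hcell']; unfold blIdx rowCell; omega
  by_cases h4 : cell < zIdx φ
  · set c := cell - kIdx φ 0 with hc
    have hcell' : cell = kIdx φ c := by unfold kIdx; unfold kIdx at hc; omega
    have hcN : c < N φ := by unfold zIdx at h4; unfold kIdx at hc; omega
    by_cases h0 : c = 0
    · refine ⟨.k0, (0, off), trivial, ?_, ?_⟩
      · simp only [PD.home, k0Home, List.mem_append, List.mem_map, List.mem_range]
        exact Or.inl (Or.inl ⟨off, hoff, rfl⟩)
      · simp only [PD.ν, k0Anchor]; rw [hcell', h0]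
    · refine ⟨.clause ((c - 1) / 3), (0, 5 * ((c - 1) % 3) + off), (by show (c - 1) / 3 < T φ; omega), ?_, ?_⟩
      · simp only [PD.home, clauseHome, List.mem_append, List.mem_map, List.mem_range]
        exact Or.inl (Or.inl ⟨_, by omega, rfl⟩)
      · simp only [PD.ν, clauseAnchor]; rw [hcell']; unfold kIdx; omega
  · have hz : cell = zIdx φ := by have := zIdx_lt (φ := φ); unfold zIdx M at *; omega
    refine ⟨.z, (0, off), trivial, ?_, ?_⟩
    · simp only [PD.home, List.mem_map, List.mem_range]; exact ⟨off, hoff, rfl⟩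
    · simp only [PD.ν]; rw [hz]

/-- **Every stage-1 gadget vertex is a home key of a placed tile.** [folklore] -/
theorem cover_stage1 (hN3 : N φ = 3 * T φ + 1) {v : ℕ} (h1 : base1 φ ≤ v) (h2 : v < base2 φ) :
    ∃ pd : PD, ∃ k, pd.WF φ ∧ k ∈ pd.home φ ∧ pd.ν φ k = v := by
  by_cases hdl : v < base1 φ + 24 * (N φ * N φ)
  · set t := (v - base1 φ) / 24 with ht
    set d := (v - base1 φ) % 24 with hd
    have hv : v = base1 φ + 24 * t + d := by have := Nat.div_add_mod (v - base1 φ) 24; omega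
    have htN : t < N φ * N φ := by omega
    obtain ⟨hr, hs⟩ := dl_site_lt φ htN
    have hd24 : d < 24 := Nat.mod_lt _ (by omega)
    have hrs : t = t / N φ * N φ + t % N φ := (Nat.div_add_mod' t (N φ)).symm
    by_cases hw : 4 ≤ d ∧ d < 8 ∧ t % N φ + 1 < N φ
    · refine ⟨.site (t / N φ) (t % N φ + 1), (3, 4 + (d - 4)), ⟨hr, hw.2.2⟩, home_site_3 (by simp [sF1]) (by omega), ?_⟩
      simp only [PD.ν, siteAnchor]; rw [hv, Nat.add_sub_cancel]; unfold dlBase; rw [← hrs]; omega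
    · refine ⟨.site (t / N φ) (t % N φ), (2, d), ⟨hr, hs⟩, ?_, ?_⟩
      · by_cases hd' : d < 4 ∨ 8 ≤ d
        · exact home_site_2 hd24 hd'
        · rw [show d = 4 + (d - 4) by omega]
          exact home_site_2' (by simp [sF2]; omega) (by omega)
      · simp only [PD.ν, siteAnchor]; rw [hv]; unfold dlBase; rw [← hrs]
  by_cases hpin : v < clause1Base φ
  · set i := (v - (base1 φ + 24 * (N φ * N φ))) / 3 with hi
    set d := (v - (base1 φ + 24 * (N φ * N φ))) % 3 with hd
    have hv : v = base1 φ + 24 * (N φ * N φ) + 3 * i + d := by have := Nat.div_add_mod (v - (base1 φ + 24 * (N φ * N φ))) 3; omega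
    have hiN : i < 2 * N φ := by unfold clause1Base at hpin; omega
    refine ⟨.dummy (i / 2), (2, 3 * (i % 2) + d), (by show i / 2 < N φ; omega), ?_, ?_⟩
    · simp only [PD.home, dummyHome, List.mem_append, List.mem_map, List.mem_range]
      exact Or.inl (Or.inl (Or.inr ⟨_, by omega, rfl⟩))
    · simp only [PD.ν, dummyAnchor]; rw [hv]; unfold pinBase; omega
  by_cases hcl : v < clause1Base φ + 3
  · refine ⟨.k0, (2, v - clause1Base φ), trivial, ?_, ?_⟩
    · simp only [PD.home, k0Home, List.mem_append, List.mem_map, List.mem_range]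
      exact Or.inr ⟨_, by omega, rfl⟩
    · simp only [PD.ν, k0Anchor]; omega
  · set t := (v - (clause1Base φ + 3)) / 27 with ht
    set d := (v - (clause1Base φ + 3)) % 27 with hd
    have hv : v = clause1Base φ + 3 + 27 * t + d := by have := Nat.div_add_mod (v - (clause1Base φ + 3)) 27; omega
    have htT : t < T φ := by unfold base2 at h2; omega
    refine ⟨.clause t, (2, d), htT, ?_, ?_⟩
    · simp only [PD.home, clauseHome, List.mem_append, List.mem_map, List.mem_range]
      exact Or.inr ⟨d, by omega, rfl⟩
    · simp only [PD.ν, clauseAnchor]; rw [hv]; unfold or3Base; omega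

/-- **Every stage-2 gadget vertex is a home key of a placed tile.** [folklore] -/
theorem cover_stage2 (hN : 0 < N φ) (hN3 : N φ = 3 * T φ + 1) (hodd : N φ % 2 = 1) {v : ℕ} (h1 : base2 φ ≤ v) (h2 : v < totalV φ) :
    ∃ pd : PD, ∃ k, pd.WF φ ∧ k ∈ pd.home φ ∧ pd.ν φ k = v := by
  have htot : totalV φ = base2 φ + 60 * (N φ * N φ) + 24 * N φ := rfl
  by_cases hh : v < base2 φ + 60 * (N φ * N φ)
  · set q := (v - base2 φ) / 60 with hq
    set d := (v - base2 φ) % 60 with hd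
    have hv : v = base2 φ + 60 * q + d := by have := Nat.div_add_mod (v - base2 φ) 60; omega
    have hqN : q < N φ * N φ := by omega
    obtain ⟨hc, hr⟩ := dl_site_lt φ hqN
    have hd60 : d < 60 := Nat.mod_lt _ (by omega)
    have hqs : q = q / N φ * N φ + q % N φ := (Nat.div_add_mod' q (N φ)).symm
    by_cases hd4 : d < 4
    · by_cases hr0 : q % N φ = 0
      · refine ⟨.dummy (q / N φ), (3, d), hc, ?_, ?_⟩
        · simp only [PD.home, dummyHome, List.mem_append, List.mem_map, List.mem_range]
          exact Or.inl (Or.inr ⟨d, hd4, rfl⟩)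
        · simp only [PD.ν, dummyAnchor]; rw [hv]; omega
      · have hJ := J_lt (φ := φ) (r := q % N φ - 1) hc
        refine ⟨.site (q % N φ - 1) (J φ (q % N φ - 1) (q / N φ)), (5, d), ⟨by omega, hJ⟩, home_site_5 hd4, ?_⟩
        simp only [PD.ν, siteAnchor]
        rw [if_pos (by omega), J_J hc, show q % N φ - 1 + 1 = q % N φ by omega, hv]
        conv_rhs => rw [hqs]
    · have hJ := J_lt (φ := φ) (r := q % N φ) hc
      refine ⟨.site (q % N φ) (J φ (q % N φ) (q / N φ)), (4, d), ⟨hr, hJ⟩, home_site_4 hd60 (by omega), ?_⟩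
      simp only [PD.ν, siteAnchor]
      rw [J_J hc, hv]
      conv_rhs => rw [hqs]
  by_cases hs : v < base2 φ + 60 * (N φ * N φ) + 12 * N φ
  · set c := (v - (base2 φ + 60 * (N φ * N φ))) / 12 with hcdef
    set d := (v - (base2 φ + 60 * (N φ * N φ))) % 12 with hd
    have hv : v = setBase φ c + d := by unfold setBase; have := Nat.div_add_mod (v - (base2 φ + 60 * (N φ * N φ))) 12; omega
    have hcN : c < N φ := by omega
    have hd12 : d < 12 := Nat.mod_lt _ (by omega)
    have hJ := J_lt (φ := φ) (r := c) hcN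
    by_cases hp : (prev? φ c).isSome = true
    · have h4 : sF4 φ c (J φ c c) = true := by simp [sF4, hp]
      by_cases hd' : d < 4 ∨ 8 ≤ d
      · exact ⟨.site c (J φ c c), (6, d), ⟨hcN, hJ⟩, home_site_6 h4 hd12 hd', by simp only [PD.ν, siteAnchor]; rw [hv]⟩
      · by_cases hl : J φ c c + 1 < N φ
        · refine ⟨.site c (J φ c c + 1), (6, 4 + (d - 4)), ⟨hcN, hl⟩, home_site_6' ?_ (by omega), ?_⟩
          · rw [Bool.or_eq_true]; left
            simp only [sF5, hp, Bool.and_true, decide_eq_true_eq]; omega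
          · simp only [PD.ν, siteAnchor]; rw [hv]; omega
        · refine ⟨.site c (J φ c c), (6, 4 + (d - 4)), ⟨hcN, hJ⟩, home_site_6' ?_ (by omega), ?_⟩
          · rw [Bool.or_eq_true]; right
            rw [Bool.and_eq_true]; refine ⟨h4, ?_⟩
            simp only [sF2, decide_eq_true_eq]; omega
          · simp only [PD.ν, siteAnchor]; rw [hv]; omega
    · refine ⟨.dummy c, (4, d), hcN, ?_, ?_⟩
      · have hv' : (prev? φ c).isNone = true := by
          cases h : prev? φ c
          · rfl
          · rw [h] at hp; exact absurd rfl hp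
        simp only [PD.home, dummyHome, hv', if_true, List.mem_append, List.mem_map, List.mem_range]
        exact Or.inr ⟨d, hd12, rfl⟩
      · simp only [PD.ν, dummyAnchor]; rw [hv]
  · set c := (v - (base2 φ + 60 * (N φ * N φ) + 12 * N φ)) / 12 with hcdef
    set d := (v - (base2 φ + 60 * (N φ * N φ) + 12 * N φ)) % 12 with hd
    have hv : v = klinkBase φ c + d := by
      unfold klinkBase; have := Nat.div_add_mod (v - (base2 φ + 60 * (N φ * N φ) + 12 * N φ)) 12; omega
    have hcN : c < N φ := by omega
    have hd12 : d < 12 := Nat.mod_lt _ (by omega)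
    by_cases hd4 : d < 4
    · have hJ := J_lt (φ := φ) (r := N φ - 1) hcN
      refine ⟨.site (N φ - 1) (J φ (N φ - 1) c), (5, d), ⟨by omega, hJ⟩, home_site_5 hd4, ?_⟩
      simp only [PD.ν, siteAnchor]
      rw [if_neg (by omega), J_J hcN, hv]; unfold klinkBase; ring
    by_cases hc0 : c = 0
    · refine ⟨.k0, (1, 4 + (d - 4)), trivial, ?_, ?_⟩
      · simp only [PD.home, k0Home, List.mem_append, List.mem_map, List.mem_range]
        exact Or.inl (Or.inr ⟨_, by omega, rfl⟩)
      · simp only [PD.ν, k0Anchor]; rw [hv, hc0]; omega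
    · refine ⟨.clause ((c - 1) / 3), (1, 12 * ((c - 1) % 3) + d), (by show (c - 1) / 3 < T φ; omega), ?_, ?_⟩
      · simp only [PD.home, clauseHome, List.mem_append, List.mem_map, List.mem_range, List.mem_filter, decide_eq_true_eq]
        exact Or.inl (Or.inr ⟨_, ⟨by omega, by omega⟩, rfl⟩)
      · simp only [PD.ν, clauseAnchor]; rw [hv]; unfold klinkBase; omega

/-- **Every vertex is a local vertex of some placed tile.** [folklore] -/
theorem cover_placements (hN : 0 < N φ) (hN3 : N φ = 3 * T φ + 1) (hodd : N φ % 2 = 1) :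
    ∀ v < totalV φ, ∃ P ∈ placements φ, ∃ i, i < P.T.nv ∧ P.ν i = v := by
  intro v hv
  obtain ⟨pd, k, hwf, hk, hν⟩ : ∃ pd : PD, ∃ k, pd.WF φ ∧ k ∈ pd.home φ ∧ pd.ν φ k = v := by
    by_cases h1 : v < base1 φ
    · obtain ⟨pd, k, h⟩ := cover_chain hN hN3 (cell := v / 5) (off := v % 5) (by unfold base1 at h1; omega) (Nat.mod_lt _ (by omega))
      exact ⟨pd, k, by rwa [Nat.div_add_mod] at h⟩
    by_cases h2 : v < base2 φ
    · exact cover_stage1 hN3 (by omega) h2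
    · exact cover_stage2 hN hN3 hodd (by omega) hv
  obtain ⟨hnd, hlen, -, hhome, -⟩ := PD.keys hwf
  have hmem := hhome k hk
  have hlt : (pd.num φ).idxOf k < (pd.num φ).length := List.idxOf_lt_length_iff.2 hmem
  refine ⟨pd.pl φ, PD.pl_mem hwf, (pd.num φ).idxOf k, by rw [← hlen]; exact hlt, ?_⟩
  rw [PD.pl_ν, List.getD_eq_getElem _ _ hlt, List.getElem_idxOf hlt, hν]

end cover

end LOTDrawing

end Literature.Barriers.CriticalPhenomena.GridSAW
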